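import Literature.MathematicalPhysics.QuantumFieldTheory.Balaban1983to89.T3MinimiserStabilityReduction
import Literature.MathematicalPhysics.QuantumFieldTheory.Balaban1983to89.T3PrintedRegularMinimiser
import Literature.MathematicalPhysics.QuantumFieldTheory.Balaban1983to89.T3OrbitAverage
import Literature.MathematicalPhysics.QuantumFieldTheory.Balaban1983to89.B12ContinuousTransportInvariance
import Literature.MathematicalPhysics.QuantumFieldTheory.Balaban1983to89.Node00.CanonicalTransportOfRecord
import Literature.MathematicalPhysics.QuantumFieldTheory.Balaban1983to89.Node00.RegSetOfFibredChartOnSupport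
import Literature.MathematicalPhysics.QuantumFieldTheory.Balaban1983to89.BlockAveragingHaarAC
import Literature.MathematicalPhysics.QuantumFieldTheory.Balaban1983to89.T4TriangularPushforward
import Summits.QuantumFields.YangMills.Theorems.BalabanUVNodesN09CentralWindowAtRecord
import Summits.QuantumFields.YangMills.Theorems.BalabanUVNodesN09CentralWindowForwardLawAtRecord
import Literature.MathematicalPhysics.QuantumFieldTheory.Balaban1983to89.T4AveragingDisintegration
import Summits.QuantumFields.YangMills.Theorems.UnitScaleTiltFluctuationComparisonRegPrOneTower
import Summits.QuantumFields.YangMills.Theorems.UnitScaleTiltFluctuationComparisonRegPrFibrePositivity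
import Summits.QuantumFields.YangMills.Theorems.UnitScaleTiltFluctuationComparisonRegPrAnsatzTStub
import Summits.QuantumFields.YangMills.Theorems.UnitScaleTiltFluctuationComparisonRegPrPosOnSmallReduction
import Literature.MeasureTheory.Function.MeasurableInvFunOn
import Literature.MathematicalPhysics.QuantumFieldTheory.Balaban1983to89.T4TriangularFibredChart
import Summits.QuantumFields.YangMills.Theorems.BalabanUVNodesN09CentralWindowInverseContinuous
import Summits.QuantumFields.YangMills.Theorems.BalabanUVNodesN09ContourThresholdNull
import Literature.MathematicalPhysics.QuantumFieldTheory.Balaban1983to89.PlaquetteVariableHaarLaw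
import Literature.MathematicalPhysics.QuantumFieldTheory.Balaban1983to89.HaarDist1LevelHypersurface
import Literature.MathematicalPhysics.QuantumFieldTheory.Balaban1983to89.B14Eq12InteriorLocality
import Literature.MathematicalPhysics.QuantumFieldTheory.Balaban1983to89.T4QuatExpLog
import Mathlib.MeasureTheory.Function.Jacobian
import Mathlib.Analysis.Calculus.FDeriv.Star
import Literature.MathematicalPhysics.QuantumFieldTheory.Balaban1983to89.EMLFibreMapInjective
import Literature.MathematicalPhysics.QuantumFieldTheory.Balaban1983to89.B12ContinuousTransportInvarianceOn
import Summits.QuantumFields.YangMills.Theorems.FluctuationComparisonRegPrIntLWregChartCharge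
import Summits.QuantumFields.YangMills.Theorems.FluctuationComparisonRegPrIntLWregChartEdge
import Summits.QuantumFields.YangMills.Theorems.FluctuationComparisonRegPrIntLWregChartLevelNear
import Summits.QuantumFields.BalabanUV.T4Continuum.Support.SubstrateBackground
import HarnessLib

-- v20 (px13 g8 hazard): `SubstrateBackground`'s global `GaugeField` instances off for this file (imported explicitly: closure-independent).
attribute [-instance] Summit.QuantumFields.BalabanUV.T4Continuum.SubstrateBackground.instTopologicalSpaceGaugeField
  Summit.QuantumFields.BalabanUV.T4Continuum.SubstrateBackground.instCompactSpaceGaugeField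
  Summit.QuantumFields.BalabanUV.T4Continuum.SubstrateBackground.instT2SpaceGaugeField

/-!
# LINE g18-2 · «FIBRED-CHART TABLE FOR WREG» (ideator seat ym-r3-idea-1, g18; lens «control») — v20 (VOL in-file; EDGE ∕ LEVEL-NEAR ∕ CHARGE closed BY NAME from the Theorems-side twins of px17 g6 ∕ w4-20520 g14 ∕ w3-20520 g13: no stub left open)

TARGET (closed BY TEXT, composed BY NAME in `Lines/runpair_organ.lean` §S2β): the organ WREG = `IsWindowRegular (heightDensityCan F hm hg κ★)`.
THE LINE: WREG ⇐ CHART ∧ INTERIOR (§2–§4, PROVED glue).  PROVED: INTERIOR; CHART-ALG I–IV (§0–§0f: triangularity, injective one-variable CHAIN on the iterated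
central windows, `chain_forwardLaw` (change of variables), `chain_imageNull` (Lusin (N), v16), `chain_preimageNull` (v17), Lusin–Souslin inverse charts, the
fibred chart of `Ū⁽ⁿ⁾`, the `descendTo` chart); CHART-REG fibre direction (§0g, §0h, §4c, §4d); CHART = `windowChartsExist_of_flat` from VOL + EDGE + LEVEL +
CHARGE (§0v, §4e); LEVEL-FAR, `levelFlat_of_near` (§4f–§4g); **VOL** (§0w `QLemmaA`, v15: `haarData_image_ge` = `c⁴·Haar(A) ≤ Haar(K A)` for injective `K`
with ambient strict derivative bounded below; `hasStrictFDerivAt_Kam` ∕ `norm_fderiv_Kam_ge`; `exists_chainVol_SU2` ⇒ `ChartVolT3`).  Stubs left, one pen each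
(pub/ym3-torus): EDGE (px17 g6), LEVEL-NEAR (w4-20520 g14), CHARGE (w3-20520 g13).  Critic #312 PASS (v1); evidence #49–#61; cards `Lines/wreg_chart.md` v1–v10.
BC7 `#h21_crux_probe` CLEAN on every obligation; costume probes FAIL as they must.

No summit is proved by a line; `YM3TorusSU2` is NOT proved (S2β's other rows and the package's inputs S1a, 26243, S2α′, O1 stay open); nothing of Bałaban's asserted.
-/

noncomputable section

open MeasureTheory Filter Topology Set
open scoped ENNReal NNReal
open Literature.MathematicalPhysics.QuantumFieldTheory.Balaban1983to89
open Literature.MathematicalPhysics.QuantumFieldTheory.Balaban1983to89.T3ContinuumYM3Torus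
open Literature.MathematicalPhysics.QuantumFieldTheory.Balaban1983to89.T3NestedUnitLaws
open Literature.MathematicalPhysics.QuantumFieldTheory.Balaban1983to89.T3UnitLawDensityEML
open Literature.MathematicalPhysics.QuantumFieldTheory.Balaban1983to89.T3UnitScaleTilt
open Literature.MathematicalPhysics.QuantumFieldTheory.Balaban1983to89.T3TiltDescent
open Literature.MathematicalPhysics.QuantumFieldTheory.Balaban1983to89.T3PrintedRegularMinimiser
open Literature.MathematicalPhysics.QuantumFieldTheory.Balaban1983to89.T3ConstrainedMinimiser (fibre)
open Literature.MathematicalPhysics.QuantumFieldTheory.Balaban1983to89.T3LevelShift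
open Literature.MathematicalPhysics.QuantumFieldTheory.Balaban1983to89.T3SmallLiftHistory
open Literature.MathematicalPhysics.QuantumFieldTheory.Balaban1983to89.T3Thresholds
open Literature.MathematicalPhysics.QuantumFieldTheory.Balaban1983to89.Missing
open Literature.MathematicalPhysics.QuantumFieldTheory.Balaban1983to89.T4Continuum
open scoped Literature.MathematicalPhysics.QuantumFieldTheory.Balaban1983to89.T3OrbitAverage

/-! ## §0w (v15) QUANTITATIVE LEMMA A ON `SU(2)` AND THE PROOF OF VOL -/

section QLemmaAEngine

open MeasureTheory Set Metric Function Filter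
open scoped RealInnerProductSpace Topology ENNReal Pointwise Quaternion NNReal

namespace Summit.QuantumFields.YangMills.Cruxes.FluctuationComparisonRegPrIntL.RunPairOrgan.WregChart.QLemmaA

open Node00 (SU)

open T4RadialProjectionAC (hasStrictFDerivAt_norm')
open T4HaarSU2LocalDiffeo (hasStrictFDerivAt_radial radialDeriv_apply_of_inner_eq_zero inner_apply_eq_of_norm_eq isOpen_cone topRowQuat
  topRowQuat_quatMatrix topRowQuat_coe quatMatrixCLM quatMatrixCLM_apply apply_quatMatrix_eq_of_tangent)
open T4QuatExpLog (norm_quatMatrix)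
open Literature.MathematicalPhysics.QuantumLattice (quatMatrix su2Quat norm_su2Quat quatToSU2
  coe_quatToSU2 coe_quatToSU2_of_norm_eq_one quatToSU2_su2Quat quatMatrix_su2Quat measurable_quatToSU2 quatToSU2_smul
  continuousOn_quatToSU2 secondCountableTopology_su2 haarProbability_su2_eq_su2BallMeasure su2BallMeasure volume_ball_quat_ne_zero
  volume_ball_quat_ne_top)
open T4HaarSU2Translate (su2Quat_quatToSU2 measurable_su2Quat su2Quat_eq_of_coe_eq haarData_haar_eq)
open Literature.MathematicalPhysics.QuantumFieldTheory (haarProbability)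

/-! ## 1. Cone extensions: the derivative, tangentially and radially -/

section Cone

variable {E : Type*} [NormedAddCommGroup E] [InnerProductSpace ℝ E]

theorem hasFDerivAt_coneExt {k : E → E} {k' : E →L[ℝ] E} {x : E} (hx : x ≠ 0) (hk : HasFDerivAt k k' (‖x‖⁻¹ • x)) :
    ∃ D : E →L[ℝ] E, HasFDerivAt (fun y : E => ‖y‖ • k (‖y‖⁻¹ • y)) D x ∧ (∀ v, ⟪x, v⟫ = 0 → D v = k' v) ∧
      D x = ‖x‖ • k (‖x‖⁻¹ • x) := by
  have hn : ‖x‖ ≠ 0 := norm_ne_zero_iff.2 hx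
  have h1 := (hasStrictFDerivAt_radial hx).hasFDerivAt
  have h2 : HasFDerivAt (fun y : E => k (‖y‖⁻¹ • y)) (k'.comp _) x :=
    HasFDerivAt.comp x (f := fun y : E => ‖y‖⁻¹ • y) hk h1
  refine ⟨_, (hasStrictFDerivAt_norm' hx).hasFDerivAt.fun_smul h2, fun v hv => ?_, ?_⟩
  · simp [hv, hn]
  · have hrad : (‖x‖⁻¹ • ContinuousLinearMap.id ℝ E +
        ((ContinuousLinearMap.toSpanSingleton ℝ (-(‖x‖ ^ 2)⁻¹)).comp (‖x‖⁻¹ • innerSL ℝ x)).smulRight x) x = 0 := by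
      simp only [ContinuousLinearMap.add_apply, ContinuousLinearMap.smul_apply, ContinuousLinearMap.id_apply,
        ContinuousLinearMap.smulRight_apply, ContinuousLinearMap.comp_apply, innerSL_apply_apply,
        ContinuousLinearMap.toSpanSingleton_apply, real_inner_self_eq_norm_sq, smul_eq_mul]
      rw [← add_smul]
      have : ‖x‖⁻¹ + ‖x‖⁻¹ * ‖x‖ ^ 2 * -(‖x‖ ^ 2)⁻¹ = 0 := by field_simp; ring
      rw [this, zero_smul]
    simp only [ContinuousLinearMap.add_apply, ContinuousLinearMap.smul_apply, ContinuousLinearMap.smulRight_apply,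
      ContinuousLinearMap.comp_apply, hrad, map_zero, smul_zero, add_zero, innerSL_apply_apply, real_inner_self_eq_norm_sq]
    have h3 : ‖x‖⁻¹ • ‖x‖ ^ 2 = ‖x‖ := by
      rw [smul_eq_mul, sq, ← mul_assoc, inv_mul_cancel₀ hn, one_mul]
    rw [h3]; simp

/-- LOWER BOUND for a linear map that is `k'` tangentially and the unit `w` radially, with `k' v ⊥ w`. -/
theorem norm_le_of_tangent_radial {D k' : E →L[ℝ] E} {u w : E} (hu : ‖u‖ = 1) (hw : ‖w‖ = 1)
    (hDv : ∀ v, ⟪u, v⟫ = 0 → D v = k' v) (hDu : D u = w) (htan : ∀ v, ⟪u, v⟫ = 0 → ⟪w, k' v⟫ = 0)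
    {c : ℝ} (hc0 : 0 ≤ c) (hc1 : c ≤ 1) (hlb : ∀ v, ⟪u, v⟫ = 0 → c * ‖v‖ ≤ ‖k' v‖) (h : E) : c * ‖h‖ ≤ ‖D h‖ := by
  set t : ℝ := ⟪u, h⟫ with ht
  set v : E := h - t • u with hv
  have huv : ⟪u, v⟫ = 0 := by
    rw [hv, inner_sub_right, real_inner_smul_right, real_inner_self_eq_norm_sq, hu]; simp [ht]
  have hh : h = v + t • u := by rw [hv]; abel
  have hDh : D h = k' v + t • w := by rw [hh, map_add, map_smul, hDv v huv, hDu]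
  have hn2 : ‖h‖ ^ 2 = ‖v‖ ^ 2 + t ^ 2 := by
    rw [hh, ← real_inner_self_eq_norm_sq, inner_add_left, inner_add_right, inner_add_right, real_inner_smul_left,
      real_inner_smul_right, real_inner_smul_left, real_inner_smul_right, real_inner_self_eq_norm_sq, real_inner_self_eq_norm_sq,
      hu, real_inner_comm u v, huv]
    ring
  have hD2 : ‖D h‖ ^ 2 = ‖k' v‖ ^ 2 + t ^ 2 := by
    rw [hDh, ← real_inner_self_eq_norm_sq, inner_add_left, inner_add_right, inner_add_right, real_inner_smul_left,
      real_inner_smul_right, real_inner_smul_left, real_inner_smul_right, real_inner_self_eq_norm_sq, real_inner_self_eq_norm_sq,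
      hw, real_inner_comm w (k' v), htan v huv]
    ring
  have hkv := hlb v huv
  have hkv0 : 0 ≤ c * ‖v‖ := mul_nonneg hc0 (norm_nonneg _)
  have key : (c * ‖h‖) ^ 2 ≤ ‖D h‖ ^ 2 := by
    rw [mul_pow, hn2, hD2]
    have h1 : (c * ‖v‖) ^ 2 ≤ ‖k' v‖ ^ 2 := pow_le_pow_left₀ hkv0 hkv 2
    have h2 : c ^ 2 * t ^ 2 ≤ t ^ 2 := by
      calc c ^ 2 * t ^ 2 ≤ 1 * t ^ 2 := mul_le_mul_of_nonneg_right (pow_le_one₀ hc0 hc1) (sq_nonneg t)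
        _ = t ^ 2 := one_mul _
    nlinarith [h1, h2]
  exact (pow_le_pow_iff_left₀ (mul_nonneg hc0 (norm_nonneg _)) (norm_nonneg _) two_ne_zero).1 key

variable [FiniteDimensional ℝ E] [MeasurableSpace E] [BorelSpace E]

/-- DETERMINANT FROM A NORM LOWER BOUND: `c · ‖h‖ ≤ ‖D h‖` for all `h` gives `c ^ dim ≤ |det D|`. -/
theorem pow_finrank_le_abs_det (D : E →L[ℝ] E) {c : ℝ} (hc : 0 < c) (hlb : ∀ h, c * ‖h‖ ≤ ‖D h‖) :
    c ^ Module.finrank ℝ E ≤ |D.det| := by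
  set μ : Measure E := (stdOrthonormalBasis ℝ E).toBasis.addHaar with hμ
  have hinj : Injective D := by
    refine (injective_iff_map_eq_zero D).2 fun h hh => ?_
    have := hlb h
    rw [hh, norm_zero] at this
    exact norm_eq_zero.1 (le_antisymm (by nlinarith [norm_nonneg h]) (norm_nonneg h))
  have hsurj : Surjective D := (LinearMap.injective_iff_surjective (f := (D : E →ₗ[ℝ] E))).1 hinj
  have hball : ball (0 : E) c ⊆ D '' ball 0 1 := by
    intro y hy
    obtain ⟨h, rfl⟩ := hsurj y
    refine ⟨h, ?_, rfl⟩
    rw [mem_ball_zero_iff] at hy ⊢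
    by_contra hh
    push_neg at hh
    have := hlb h
    nlinarith
  have h1 : μ (ball 0 c) ≤ μ (D '' ball 0 1) := measure_mono hball
  rw [Measure.addHaar_image_continuousLinearMap, Measure.addHaar_ball_of_pos μ _ hc] at h1
  have hB0 : μ (ball 0 1) ≠ 0 := (measure_ball_pos μ _ one_pos).ne'
  have hBt : μ (ball 0 1) ≠ ∞ := measure_ball_lt_top.ne
  have h2 : ENNReal.ofReal (c ^ Module.finrank ℝ E) ≤ ENNReal.ofReal |D.det| := by
    calc ENNReal.ofReal (c ^ Module.finrank ℝ E)
        = ENNReal.ofReal (c ^ Module.finrank ℝ E) * μ (ball 0 1) / μ (ball 0 1) := by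
          rw [ENNReal.mul_div_cancel_right hB0 hBt]
      _ ≤ ENNReal.ofReal |D.det| * μ (ball 0 1) / μ (ball 0 1) := by gcongr
      _ = ENNReal.ofReal |D.det| := by rw [ENNReal.mul_div_cancel_right hB0 hBt]
  exact (ENNReal.ofReal_le_ofReal_iff (abs_nonneg _)).1 h2

end Cone

/-! ## 2. `SU(2)`: quantitative Lemma A, matrix form -/

section SU2

open scoped Matrix.Norms.L2Operator
open Matrix

attribute [local instance] Literature.Analysis.FluidPDE.Tao2016.quatMeasurableSpace
  Literature.Analysis.FluidPDE.Tao2016.quatBorelSpace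

attribute [local instance] Literature.MathematicalPhysics.QuantumLattice.secondCountableTopology_su2

/-- Haar measure of a measurable set in the cone picture. -/
theorem haar_eq_cone (A : Set (SU 2)) (hA : MeasurableSet A) :
    haarProbability (SU 2) A =
      ((volume : Measure ℍ) (ball 0 1))⁻¹ * (volume : Measure ℍ) (ball 0 1 ∩ quatToSU2 ⁻¹' A) := by
  rw [haarProbability_su2_eq_su2BallMeasure, su2BallMeasure, Measure.smul_apply, smul_eq_mul,
    Measure.map_apply measurable_quatToSU2 hA, Measure.restrict_apply' measurableSet_ball, inter_comm]

/-- Haar measure of ANY set is at least the cone volume of its preimage. -/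
theorem cone_le_haar (B : Set (SU 2)) :
    ((volume : Measure ℍ) (ball 0 1))⁻¹ * (volume : Measure ℍ) (ball 0 1 ∩ quatToSU2 ⁻¹' B) ≤
      haarProbability (SU 2) B := by
  rw [haarProbability_su2_eq_su2BallMeasure, su2BallMeasure, Measure.smul_apply, smul_eq_mul]
  gcongr
  calc (volume : Measure ℍ) (ball 0 1 ∩ quatToSU2 ⁻¹' B)
      = ((volume : Measure ℍ).restrict (ball 0 1)) (quatToSU2 ⁻¹' B) := by
        rw [Measure.restrict_apply' measurableSet_ball, inter_comm]
    _ ≤ _ := Measure.le_map_apply measurable_quatToSU2.aemeasurable _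

/-- ★★★ **QUANTITATIVE LEMMA A ON `SU(2)` (matrix form).** `S ⊆ SU(2)` open; `K : SU(2) → SU(2)` measurable, given on `S` … -/
theorem haar_image_ge {S : Set (SU 2)} (hS : IsOpen S)
    {K : SU 2 → SU 2} (hK : Measurable K)
    {Kmat : Matrix (Fin 2) (Fin 2) ℂ → Matrix (Fin 2) (Fin 2) ℂ}
    {D : SU 2 → Matrix (Fin 2) (Fin 2) ℂ →L[ℝ] Matrix (Fin 2) (Fin 2) ℂ}
    (hd : ∀ W ∈ S, HasStrictFDerivAt Kmat (D W) (W : Matrix (Fin 2) (Fin 2) ℂ))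
    (hKmat : ∀ W ∈ S, Kmat (W : Matrix (Fin 2) (Fin 2) ℂ) = ((K W : SU 2) : Matrix (Fin 2) (Fin 2) ℂ))
    {A : Set (SU 2)} (hA : MeasurableSet A) (hAS : A ⊆ S) (hinj : InjOn K A)
    {c : ℝ} (hc0 : 0 < c) (hc1 : c ≤ 1) (hlb : ∀ W ∈ A, ∀ X : Matrix (Fin 2) (Fin 2) ℂ, c * ‖X‖ ≤ ‖D W X‖) :
    ENNReal.ofReal (c ^ 4) * haarProbability (SU 2) A ≤
      haarProbability (SU 2) (K '' A) := by
  set s : Set ℍ := ({(0 : ℍ)}ᶜ ∩ quatToSU2 ⁻¹' A) ∩ ball 0 1 with hs_def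
  have hsm : MeasurableSet s :=
    ((measurableSet_singleton (0 : ℍ)).compl.inter (measurable_quatToSU2 hA)).inter measurableSet_ball
  set k : ℍ → ℍ := fun q => topRowQuat (Kmat (quatMatrix q)) with hk_def
  set k' : ℍ → ℍ →L[ℝ] ℍ := fun u => topRowQuat.comp ((D (quatToSU2 u)).comp quatMatrixCLM) with hk'_def
  set F : ℍ → ℍ := fun x => ‖x‖ • su2Quat (K (quatToSU2 x)) with hF_def
  have hunit : ∀ x : ℍ, x ≠ 0 → ‖‖x‖⁻¹ • x‖ = 1 := fun x hx => by
    rw [norm_smul, norm_inv, norm_norm, inv_mul_cancel₀ (norm_ne_zero_iff.2 hx)]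
  have hproj : ∀ x : ℍ, x ≠ 0 → quatToSU2 (‖x‖⁻¹ • x) = quatToSU2 x := fun x hx =>
    quatToSU2_smul (inv_pos.2 (norm_pos_iff.2 hx)) x
  have hkK : ∀ u : ℍ, ‖u‖ = 1 → quatToSU2 u ∈ S → k u = su2Quat (K (quatToSU2 u)) := fun u hu huS => by
    show topRowQuat (Kmat (quatMatrix u)) = su2Quat (K (quatToSU2 u))
    rw [← coe_quatToSU2_of_norm_eq_one hu, hKmat _ huS, topRowQuat_coe]
  have hkd : ∀ u : ℍ, ‖u‖ = 1 → quatToSU2 u ∈ S → HasStrictFDerivAt k (k' u) u := fun u hu huS => by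
    have h1 : HasStrictFDerivAt Kmat (D (quatToSU2 u)) (quatMatrixCLM u) := by
      rw [quatMatrixCLM_apply, ← coe_quatToSU2_of_norm_eq_one hu]
      exact hd _ huS
    exact topRowQuat.hasStrictFDerivAt.comp u
      (HasStrictFDerivAt.comp u (f := fun q : ℍ => quatMatrixCLM q) h1 quatMatrixCLM.hasStrictFDerivAt)
  have hFk : ∀ x : ℍ, x ≠ 0 → quatToSU2 x ∈ S → F x = ‖x‖ • k (‖x‖⁻¹ • x) := fun x hx hxS => by
    simp only [hF_def]
    rw [hkK _ (hunit x hx) (by rw [hproj x hx]; exact hxS), hproj x hx]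
  have hFn : ∀ y : ℍ, ‖F y‖ = ‖y‖ := fun y => by simp only [hF_def]; rw [norm_smul, norm_norm, norm_su2Quat, mul_one]
  have key : ∀ x ∈ s, ∃ Dx : ℍ →L[ℝ] ℍ, HasFDerivWithinAt F Dx s x ∧ c ^ 4 ≤ |Dx.det| := by
    rintro x ⟨⟨hx0, hxA⟩, -⟩
    have hx0 : x ≠ 0 := hx0
    have hxS : quatToSU2 x ∈ S := hAS hxA
    set u : ℍ := ‖x‖⁻¹ • x with hu_def
    have hu : ‖u‖ = 1 := hunit x hx0
    have huS : quatToSU2 u ∈ S := by rw [hu_def, hproj x hx0]; exact hxS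
    have huA : quatToSU2 u ∈ A := by rw [hu_def, hproj x hx0]; exact hxA
    obtain ⟨Dx, hDx, hDv, hDxx⟩ := hasFDerivAt_coneExt hx0 (hkd u hu huS).hasFDerivAt
    have hC : IsOpen ({(0 : ℍ)}ᶜ ∩ quatToSU2 ⁻¹' S) := isOpen_cone hS
    have hev : (fun y : ℍ => ‖y‖ • k (‖y‖⁻¹ • y)) =ᶠ[𝓝 x] F :=
      Filter.eventually_of_mem (hC.mem_nhds ⟨hx0, hxS⟩) fun y hy => (hFk y hy.1 hy.2).symm
    have hDF : HasFDerivAt F Dx x := hDx.congr_of_eventuallyEq hev.symm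
    refine ⟨Dx, hDF.hasFDerivWithinAt, ?_⟩
    have hDu : Dx u = k u := by
      have h1 : Dx u = ‖x‖⁻¹ • Dx x := by rw [hu_def, map_smul]
      rw [h1, hDxx, smul_smul, inv_mul_cancel₀ (norm_ne_zero_iff.2 hx0), one_smul]
    have hw : ‖k u‖ = 1 := by rw [hkK u hu huS, norm_su2Quat]
    have hperp : ∀ v : ℍ, ⟪u, v⟫ = 0 ↔ ⟪x, v⟫ = 0 := fun v => by
      rw [hu_def, real_inner_smul_left, mul_eq_zero, inv_eq_zero, norm_eq_zero]; exact or_iff_right hx0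
    have htan : ∀ v : ℍ, ⟪u, v⟫ = 0 → ⟪k u, k' u v⟫ = 0 := fun v hv => by
      have h1 := inner_apply_eq_of_norm_eq hDF (Filter.Eventually.of_forall hFn) v
      rw [(hperp v).1 hv, hDv v ((hperp v).1 hv)] at h1
      have hFx : F x = ‖x‖ • k u := by rw [hFk x hx0 hxS]
      rw [hFx, real_inner_smul_left, mul_eq_zero] at h1
      exact h1.resolve_left (norm_ne_zero_iff.2 hx0)
    have hlbt : ∀ v : ℍ, ⟪u, v⟫ = 0 → c * ‖v‖ ≤ ‖k' u v‖ := fun v hv => by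
      have hrange := apply_quatMatrix_eq_of_tangent hS hd hKmat hu huS hv
      have h1 : ‖k' u v‖ = ‖D (quatToSU2 u) (quatMatrix v)‖ := by
        show ‖topRowQuat (D (quatToSU2 u) (quatMatrixCLM v))‖ = _
        rw [quatMatrixCLM_apply]
        conv_rhs => rw [hrange, norm_quatMatrix]
      rw [h1, ← norm_quatMatrix v]
      exact hlb _ huA _
    have hnorm : ∀ h : ℍ, c * ‖h‖ ≤ ‖Dx h‖ :=
      norm_le_of_tangent_radial hu hw (fun v hv => hDv v ((hperp v).1 hv)) hDu htan hc0.le hc1 hlbt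
    have hfin : Module.finrank ℝ ℍ = 4 := Quaternion.finrank_eq_four
    have := pow_finrank_le_abs_det Dx hc0 hnorm
    rwa [hfin] at this
  choose! Dx hDx hdet using key
  have hFinj : InjOn F s := by
    rintro x ⟨⟨hx0, hxA⟩, -⟩ y ⟨⟨hy0, hyA⟩, -⟩ hxy
    have hx0 : x ≠ 0 := hx0
    have hy0 : y ≠ 0 := hy0
    have hn : ‖x‖ = ‖y‖ := by rw [← hFn x, ← hFn y, hxy]
    have h1 : su2Quat (K (quatToSU2 x)) = su2Quat (K (quatToSU2 y)) := by
      have := hxy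
      simp only [hF_def] at this
      rw [hn] at this
      exact smul_right_injective _ (norm_ne_zero_iff.2 hy0) this
    have h2 : K (quatToSU2 x) = K (quatToSU2 y) := by rw [← quatToSU2_su2Quat (K (quatToSU2 x)), h1, quatToSU2_su2Quat]
    have h3 : quatToSU2 x = quatToSU2 y := hinj hxA hyA h2
    have h4 : ‖x‖⁻¹ • x = ‖y‖⁻¹ • y := by rw [← su2Quat_quatToSU2 hx0, ← su2Quat_quatToSU2 hy0, h3]
    calc x = ‖x‖ • (‖x‖⁻¹ • x) := by rw [smul_smul, mul_inv_cancel₀ (norm_ne_zero_iff.2 hx0), one_smul]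
      _ = ‖y‖ • (‖y‖⁻¹ • y) := by rw [h4, hn]
      _ = y := by rw [smul_smul, mul_inv_cancel₀ (norm_ne_zero_iff.2 hy0), one_smul]
  have hFs : F '' s ⊆ ball 0 1 ∩ quatToSU2 ⁻¹' (K '' A) := by
    rintro _ ⟨x, ⟨⟨hx0, hxA⟩, hxb⟩, rfl⟩
    have hx0 : x ≠ 0 := hx0
    refine ⟨by rw [mem_ball_zero_iff, hFn]; exact mem_ball_zero_iff.1 hxb, ⟨quatToSU2 x, hxA, ?_⟩⟩
    show K (quatToSU2 x) = quatToSU2 (F x)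
    simp only [hF_def]
    rw [quatToSU2_smul (norm_pos_iff.2 hx0), quatToSU2_su2Quat]
  have hJ := lintegral_abs_det_fderiv_le_addHaar_image (volume : Measure ℍ) hsm hDx hFinj
  have hlow : ENNReal.ofReal (c ^ 4) * (volume : Measure ℍ) s ≤ ∫⁻ x in s, ENNReal.ofReal |(Dx x).det| ∂volume := by
    rw [← setLIntegral_const]
    exact setLIntegral_mono' hsm fun x hx => ENNReal.ofReal_le_ofReal (hdet x hx)
  have hs_vol : (volume : Measure ℍ) s = (volume : Measure ℍ) (ball 0 1 ∩ quatToSU2 ⁻¹' A) := by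
    have h1 : ball 0 1 ∩ quatToSU2 ⁻¹' A = s ∪ ({(0 : ℍ)} ∩ (ball 0 1 ∩ quatToSU2 ⁻¹' A)) := by
      ext y; constructor
      · rintro ⟨hyb, hyA⟩
        by_cases hy0 : y = 0
        · exact Or.inr ⟨hy0, hyb, hyA⟩
        · exact Or.inl ⟨⟨hy0, hyA⟩, hyb⟩
      · rintro (⟨⟨-, hyA⟩, hyb⟩ | ⟨-, hyb, hyA⟩) <;> exact ⟨hyb, hyA⟩
    rw [h1]
    refine le_antisymm (measure_mono subset_union_left) ((measure_union_le _ _).trans ?_)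
    rw [measure_mono_null inter_subset_left (measure_singleton (0 : ℍ)), add_zero]
  calc ENNReal.ofReal (c ^ 4) * haarProbability (SU 2) A
      = ((volume : Measure ℍ) (ball 0 1))⁻¹ * (ENNReal.ofReal (c ^ 4) * (volume : Measure ℍ) s) := by
        rw [haar_eq_cone A hA, hs_vol]; ring
    _ ≤ ((volume : Measure ℍ) (ball 0 1))⁻¹ * (volume : Measure ℍ) (F '' s) := by gcongr; exact hlow.trans hJ
    _ ≤ ((volume : Measure ℍ) (ball 0 1))⁻¹ * (volume : Measure ℍ) (ball 0 1 ∩ quatToSU2 ⁻¹' (K '' A)) := by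
        gcongr
    _ ≤ haarProbability (SU 2) (K '' A) := cone_le_haar _

/-- The same for the cell's `HaarData.haar`. -/
theorem haarData_image_ge {S : Set (SU 2)} (hS : IsOpen S)
    {K : SU 2 → SU 2} (hK : Measurable K)
    {Kmat : Matrix (Fin 2) (Fin 2) ℂ → Matrix (Fin 2) (Fin 2) ℂ}
    {D : SU 2 → Matrix (Fin 2) (Fin 2) ℂ →L[ℝ] Matrix (Fin 2) (Fin 2) ℂ}
    (hd : ∀ W ∈ S, HasStrictFDerivAt Kmat (D W) (W : Matrix (Fin 2) (Fin 2) ℂ))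
    (hKmat : ∀ W ∈ S, Kmat (W : Matrix (Fin 2) (Fin 2) ℂ) = ((K W : SU 2) : Matrix (Fin 2) (Fin 2) ℂ))
    {A : Set (SU 2)} (hA : MeasurableSet A) (hAS : A ⊆ S) (hinj : InjOn K A)
    {c : ℝ} (hc0 : 0 < c) (hc1 : c ≤ 1) (hlb : ∀ W ∈ A, ∀ X : Matrix (Fin 2) (Fin 2) ℂ, c * ‖X‖ ≤ ‖D W X‖) :
    ENNReal.ofReal (c ^ 4) * (HaarData.haar : Measure (SU 2)) A ≤
      (HaarData.haar : Measure (SU 2)) (K '' A) := by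
  rw [haarData_haar_eq]; exact haar_image_ge hS hK hd hKmat hA hAS hinj hc0 hc1 hlb

end SU2

/-! ## 3. The derivative of the exp-mean-log fibre map `W ↦ eml(F_W) · W` is BOUNDED BELOW on the window -/

section DerivLB

open scoped Matrix.Norms.L2Operator
open ExpMeanLog (eml analyticAt_eml)
open B7TransferAnalyticMean (meanCLM meanCLM_apply)
open BlockAveragingEMLAnalyticMean (norm_fderiv_eml_sub_mean_le eml_one)
open BlockAveragingPlaquetteBound (norm_eml_sub_one_le_six_mul)
open EMLFibreMapInjective (norm_fibreFamily_sub_one_le norm_fibreFamily_sub_le norm_meanCLM_fibreFamily_sub_le)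

variable {ι : Type*} [Fintype ι] {N : ℕ}

/-- The W-coordinate family of the exp-mean-log fibre map as a function of the AMBIENT matrix. -/
def Fam (cen : ι → Prop) [DecidablePred cen] (h : ι → Matrix (Fin N) (Fin N) ℂ) (W : Matrix (Fin N) (Fin N) ℂ) :
    ι → Matrix (Fin N) (Fin N) ℂ :=
  fun i => if cen i then 1 else h i * star W

/-- The AMBIENT exp-mean-log fibre map `W ↦ eml(F_W) · W`. -/
def Kam (cen : ι → Prop) [DecidablePred cen] (h : ι → Matrix (Fin N) (Fin N) ℂ) (W : Matrix (Fin N) (Fin N) ℂ) :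
    Matrix (Fin N) (Fin N) ℂ :=
  eml (Fam cen h W) * W

variable (cen : ι → Prop) [DecidablePred cen] (h : ι → Matrix (Fin N) (Fin N) ℂ)

theorem Fam_apply_of (W : Matrix (Fin N) (Fin N) ℂ) {i : ι} (hi : cen i) : Fam cen h W i = 1 := if_pos hi
theorem Fam_apply_of_not (W : Matrix (Fin N) (Fin N) ℂ) {i : ι} (hi : ¬ cen i) : Fam cen h W i = h i * star W := if_neg hi

/-- ★ **STRICT DERIVATIVE OF THE AMBIENT FIBRE MAP, WITH ITS VALUE.** -/
theorem hasStrictFDerivAt_Kam {W₀ : Matrix (Fin N) (Fin N) ℂ} (hW₀ : ∀ i, ¬ cen i → ‖h i * star W₀ - 1‖ < 1) :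
    ∃ D : Matrix (Fin N) (Fin N) ℂ →L[ℝ] Matrix (Fin N) (Fin N) ℂ, HasStrictFDerivAt (Kam cen h) D W₀ ∧
      ∀ X, D X = eml (Fam cen h W₀) * X +
        (fderiv ℂ (eml : (ι → Matrix (Fin N) (Fin N) ℂ) → Matrix (Fin N) (Fin N) ℂ) (Fam cen h W₀)) (Fam cen h X - Fam cen h 0) * W₀ := by
  set S : Matrix (Fin N) (Fin N) ℂ →L[ℝ] Matrix (Fin N) (Fin N) ℂ :=
    ((starL' ℝ : Matrix (Fin N) (Fin N) ℂ ≃L[ℝ] Matrix (Fin N) (Fin N) ℂ) : Matrix (Fin N) (Fin N) ℂ →L[ℝ] Matrix (Fin N) (Fin N) ℂ) ∘L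
      ContinuousLinearMap.id ℝ (Matrix (Fin N) (Fin N) ℂ) with hS_def
  have hSX : ∀ X, S X = star X := fun X => by simp [hS_def]
  set φ' : ι → Matrix (Fin N) (Fin N) ℂ →L[ℝ] Matrix (Fin N) (Fin N) ℂ := fun i => if cen i then 0 else h i • S with hφ'
  have hFam : HasStrictFDerivAt (fun W i => Fam cen h W i) (ContinuousLinearMap.pi φ') W₀ := by
    refine hasStrictFDerivAt_pi.2 fun i => ?_
    by_cases hi : cen i
    · simp only [Fam, hi, if_true, hφ']
      exact hasStrictFDerivAt_const _ _
    · simp only [Fam, hi, if_false, hφ']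
      exact ((hasStrictFDerivAt_id W₀).star).const_mul (h i)
  have hL : ∀ X, ContinuousLinearMap.pi φ' X = Fam cen h X - Fam cen h 0 := fun X => by
    funext i
    by_cases hi : cen i
    · simp [hφ', Fam, hi]
    · simp [hφ', Fam, hi, hSX]
  have hlt : ∀ i, ‖Fam cen h W₀ i - 1‖ < 1 := fun i => by
    by_cases hi : cen i
    · rw [Fam_apply_of cen h W₀ hi, sub_self, norm_zero]; exact one_pos
    · rw [Fam_apply_of_not cen h W₀ hi]; exact hW₀ i hi
  have hE : HasStrictFDerivAt (fun W => eml (Fam cen h W))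
      (((fderiv ℂ (eml : (ι → Matrix (Fin N) (Fin N) ℂ) → Matrix (Fin N) (Fin N) ℂ) (Fam cen h W₀)).restrictScalars ℝ) ∘L
        ContinuousLinearMap.pi φ') W₀ :=
    ((analyticAt_eml hlt).hasStrictFDerivAt.restrictScalars ℝ).comp W₀ hFam
  have hK := hE.mul' (hasStrictFDerivAt_id W₀)
  refine ⟨_, hK, fun X => ?_⟩
  rw [ContinuousLinearMap.add_apply, ContinuousLinearMap.smul_apply, ContinuousLinearMap.smul_apply, ContinuousLinearMap.id_apply,
    smul_eq_mul, op_smul_eq_mul, ContinuousLinearMap.comp_apply, hL, ContinuousLinearMap.coe_restrictScalars']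
  rfl

/-- ★★ **THE DERIVATIVE IS BOUNDED BELOW ON THE WINDOW**: `‖h_i‖ ≤ 1`, `‖W₀‖ ≤ 1`, `‖h_i W₀* − 1‖ ≤ α ≤ 1∕24` … -/
theorem norm_fderiv_Kam_ge (hh : ∀ i, ¬ cen i → ‖h i‖ ≤ 1) {α : ℝ} (hα0 : 0 ≤ α) (hα : α ≤ 1 / 24)
    {W₀ : Matrix (Fin N) (Fin N) ℂ} (hW₀1 : ‖W₀‖ ≤ 1) (hW₀ : ∀ i, ¬ cen i → ‖h i * star W₀ - 1‖ ≤ α) (X : Matrix (Fin N) (Fin N) ℂ) :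
    (1 - ((((Finset.univ.filter fun i => ¬ cen i).card : ℝ) / (Fintype.card ι : ℝ)) + 150 * α)) * ‖X‖ ≤
      ‖eml (Fam cen h W₀) * X +
        (fderiv ℂ (eml : (ι → Matrix (Fin N) (Fin N) ℂ) → Matrix (Fin N) (Fin N) ℂ) (Fam cen h W₀)) (Fam cen h X - Fam cen h 0) * W₀‖ := by
  set E₀ := eml (Fam cen h W₀) with hE₀
  set Z := Fam cen h X - Fam cen h 0 with hZ
  set DE := (fderiv ℂ (eml : (ι → Matrix (Fin N) (Fin N) ℂ) → Matrix (Fin N) (Fin N) ℂ) (Fam cen h W₀)) Z with hDE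
  have hs0 : 0 ≤ ((Finset.univ.filter fun i => ¬ cen i).card : ℝ) / (Fintype.card ι : ℝ) := by positivity
  have hE1 : ‖E₀ - 1‖ ≤ 6 * α := by
    rcases isEmpty_or_nonempty ι with hι | hι
    · have hF : Fam cen h W₀ = (1 : ι → Matrix (Fin N) (Fin N) ℂ) := funext fun i => isEmptyElim i
      rw [hE₀, hF, eml_one, sub_self, norm_zero]; positivity
    · refine norm_eml_sub_one_le_six_mul (fun i => ?_) (by linarith)
      by_cases hc : cen i
      · rw [Fam_apply_of cen h W₀ hc, sub_self, norm_zero]; exact hα0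
      · rw [Fam_apply_of_not cen h W₀ hc]; exact hW₀ i hc
  have hZle : ‖Z‖ ≤ ‖X‖ := by
    have h1 := norm_fibreFamily_sub_le cen h hh X 0
    rw [sub_zero] at h1
    exact h1
  have hmean : ‖meanCLM ι (Matrix (Fin N) (Fin N) ℂ) Z‖ ≤ ((Finset.univ.filter fun i => ¬ cen i).card : ℝ) / (Fintype.card ι : ℝ) * ‖X‖ := by
    have h1 := norm_meanCLM_fibreFamily_sub_le cen h hh X 0
    rw [sub_zero] at h1
    exact h1
  have hF1 : ‖Fam cen h W₀ - 1‖ ≤ α := norm_fibreFamily_sub_one_le cen h hα0 hW₀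
  have hDEle : ‖DE‖ ≤ (((Finset.univ.filter fun i => ¬ cen i).card : ℝ) / (Fintype.card ι : ℝ) + 144 * α) * ‖X‖ := by
    have hkey := norm_fderiv_eml_sub_mean_le (hF1.trans hα) Z
    calc ‖DE‖ ≤ ‖meanCLM ι (Matrix (Fin N) (Fin N) ℂ) Z‖ + ‖DE - meanCLM ι (Matrix (Fin N) (Fin N) ℂ) Z‖ := norm_le_insert' _ _
      _ ≤ ((Finset.univ.filter fun i => ¬ cen i).card : ℝ) / (Fintype.card ι : ℝ) * ‖X‖ + 144 * ‖Z‖ * ‖Fam cen h W₀ - 1‖ :=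
          add_le_add hmean hkey
      _ ≤ ((Finset.univ.filter fun i => ¬ cen i).card : ℝ) / (Fintype.card ι : ℝ) * ‖X‖ + 144 * ‖X‖ * α := by gcongr
      _ = _ := by ring
  have hlow : (1 - 6 * α) * ‖X‖ ≤ ‖E₀ * X‖ := by
    have hX : E₀ * X - (E₀ - 1) * X = X := by rw [sub_mul, one_mul]; abel
    have h1 : ‖X‖ ≤ ‖E₀ * X‖ + ‖(E₀ - 1) * X‖ := by
      have h := norm_sub_le (E₀ * X) ((E₀ - 1) * X)
      rwa [hX] at h
    have h2 : ‖(E₀ - 1) * X‖ ≤ 6 * α * ‖X‖ := (norm_mul_le _ _).trans (mul_le_mul_of_nonneg_right hE1 (norm_nonneg _))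
    linarith
  have hup : ‖DE * W₀‖ ≤ (((Finset.univ.filter fun i => ¬ cen i).card : ℝ) / (Fintype.card ι : ℝ) + 144 * α) * ‖X‖ := by
    calc ‖DE * W₀‖ ≤ ‖DE‖ * ‖W₀‖ := norm_mul_le _ _
      _ ≤ ‖DE‖ * 1 := mul_le_mul_of_nonneg_left hW₀1 (norm_nonneg _)
      _ ≤ _ := by rw [mul_one]; exact hDEle
  have h3 : ‖E₀ * X‖ ≤ ‖E₀ * X + DE * W₀‖ + ‖DE * W₀‖ := by
    have h := norm_sub_le (E₀ * X + DE * W₀) (DE * W₀)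
    rwa [add_sub_cancel_right] at h
  linarith

end DerivLB

/-! ## 4. APPLICATION: the one-step central map of (0.4) on `SU(2)` inflates Haar volume by at most `c₀⁻⁴` on the central window -/

section SU2Apply

open scoped Matrix.Norms.L2Operator
open ExpMeanLog (eml expMeanLogSU deltaSU lt_third_of_lt_deltaSU measurable_expMeanLogSU_E)
open BlockAveraging (Small Idx avgFun measurable_avgFun)
open BlockAveragingHaarAC (centralBond pre post openHol IsCentral)
open BlockAveragingEMLHaarAC (fibreFamily offCard small_update_centralBond_self_iff dist1_fibreFamily_of_not_isCentral
  fibreFamily_of_isCentral fibreFamily_of_not_isCentral)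
open B12ContinuousTransportInvarianceOn (continuous_dist1_SU)
open Node00 (SU)
open Summit.QuantumFields.YangMills.BalabanUVNodes.N09CentralWindowInjective (norm_coe_SU_le_one offCard_eq_card_filter)
open Summit.QuantumFields.YangMills.BalabanUVNodes.N09CentralWindowAtRecord (avgFun_update_centralBond_injOn_centralWindow)
open Summit.QuantumFields.YangMills.BalabanUVNodes.N07CentralResponseNormalForm (coe_avgFun_update_centralBond_SUN)

/-- The W-coordinate family at `pre · g · post` is continuous in `g`. -/
theorem continuous_fibreFamily_conj {P : Params} {j : ℕ} (W : GaugeField P j (SU 2)) (c : PBond P (j + 1)) (i : Idx P) :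
    Continuous fun g : SU 2 => fibreFamily W c (pre W c * g * post W c) i := by
  by_cases hi : IsCentral c i
  · simp only [fibreFamily_of_isCentral W c _ i hi]; exact continuous_const
  · simp only [fibreFamily_of_not_isCentral W c _ i hi]
    exact continuous_const.mul ((continuous_const.mul continuous_id).mul continuous_const).inv

/-- ★★★ **QUANTITATIVE LEMMA A FOR THE ONE-STEP CENTRAL MAP OF (0.4) ON `SU(2)`**: on the central window `{g | dist1(V_i …` -/
theorem haar_image_avgFun_update_ge {P : Params} {j : ℕ} (hj : j + 1 ≤ P.m + P.K) (W : GaugeField P j (SU 2)) (c : PBond P (j + 1))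
    {α : ℝ} (hα0 : 0 ≤ α) (hα24 : α ≤ 1 / 24) (hαδ : α < deltaSU (Fin 2)) {c₀ : ℝ} (hc0 : 0 < c₀) (hc1 : c₀ ≤ 1)
    (hgap : (offCard c : ℝ) / (Fintype.card (Idx P) : ℝ) + 150 * α ≤ 1 - c₀)
    {A : Set (SU 2)} (hA : MeasurableSet A) (hAw : A ⊆ {g : SU 2 | ∀ i : Idx P, dist1 (fibreFamily W c (pre W c * g * post W c) i) ≤ α}) :
    ENNReal.ofReal (c₀ ^ 4) * (HaarData.haar : Measure (SU 2)) A ≤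
      (HaarData.haar : Measure (SU 2)) ((fun g : SU 2 => avgFun (expMeanLogSU (n := Fin 2)) (Function.update W (centralBond c) g) c) '' A) := by
  classical
  set h : Idx P → Matrix (Fin 2) (Fin 2) ℂ := fun i => ((openHol W c i : SU 2) : Matrix (Fin 2) (Fin 2) ℂ) with hh_def
  set Pm : Matrix (Fin 2) (Fin 2) ℂ := ((pre W c : SU 2) : Matrix (Fin 2) (Fin 2) ℂ) with hPm
  set Qm : Matrix (Fin 2) (Fin 2) ℂ := ((post W c : SU 2) : Matrix (Fin 2) (Fin 2) ℂ) with hQm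
  set T : Matrix (Fin 2) (Fin 2) ℂ →L[ℝ] Matrix (Fin 2) (Fin 2) ℂ := ContinuousLinearMap.mulLeftRight ℝ (Matrix (Fin 2) (Fin 2) ℂ) Pm Qm with hT_def
  have hT : ∀ M, T M = Pm * M * Qm := fun M => ContinuousLinearMap.mulLeftRight_apply ℝ (Matrix (Fin 2) (Fin 2) ℂ) Pm Qm M
  have hcoe : ∀ g : SU 2, ((pre W c * g * post W c : SU 2) : Matrix (Fin 2) (Fin 2) ℂ) = T (g : Matrix (Fin 2) (Fin 2) ℂ) := fun g => by
    rw [hT, Submonoid.coe_mul, Submonoid.coe_mul]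
  set S : Set (SU 2) := {g : SU 2 | ∀ i : Idx P, dist1 (fibreFamily W c (pre W c * g * post W c) i) < deltaSU (Fin 2)} with hS_def
  have hS : IsOpen S := by
    have hS' : S = ⋂ i : Idx P, {g : SU 2 | dist1 (fibreFamily W c (pre W c * g * post W c) i) < deltaSU (Fin 2)} := by
      ext g; simp [hS_def, Set.mem_iInter]
    rw [hS']
    exact isOpen_iInter_of_finite fun i => isOpen_lt (continuous_dist1_SU.comp (continuous_fibreFamily_conj W c i)) continuous_const
  have hAS : A ⊆ S := fun g hg i => (hAw hg i).trans_lt hαδ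
  have key : ∀ g ∈ S, ∃ D : Matrix (Fin 2) (Fin 2) ℂ →L[ℝ] Matrix (Fin 2) (Fin 2) ℂ,
      HasStrictFDerivAt (fun M => Kam (IsCentral c) h (T M)) D (g : Matrix (Fin 2) (Fin 2) ℂ) ∧ (g ∈ A → ∀ X, c₀ * ‖X‖ ≤ ‖D X‖) := by
    intro g hg
    have hlt : ∀ i, ¬ (IsCentral c) i → ‖h i * star (T (g : Matrix (Fin 2) (Fin 2) ℂ)) - 1‖ < 1 := by
      intro i hi
      rw [← hcoe, hh_def, ← dist1_fibreFamily_of_not_isCentral W c _ i hi]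
      exact (lt_third_of_lt_deltaSU (hg i)).trans (by norm_num)
    obtain ⟨D₀, hD₀, hval⟩ := hasStrictFDerivAt_Kam (IsCentral c) h hlt
    refine ⟨D₀ ∘L T, hD₀.comp _ T.hasStrictFDerivAt, fun hgA X => ?_⟩
    rw [ContinuousLinearMap.comp_apply, hval]
    have hh1 : ∀ i, ¬ (IsCentral c) i → ‖h i‖ ≤ 1 := fun i _ => norm_coe_SU_le_one _
    have hW1 : ‖T (g : Matrix (Fin 2) (Fin 2) ℂ)‖ ≤ 1 := by rw [← hcoe]; exact norm_coe_SU_le_one _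
    have hWα : ∀ i, ¬ (IsCentral c) i → ‖h i * star (T (g : Matrix (Fin 2) (Fin 2) ℂ)) - 1‖ ≤ α := fun i hi => by
      rw [← hcoe, hh_def, ← dist1_fibreFamily_of_not_isCentral W c _ i hi]; exact hAw hgA i
    have hb := norm_fderiv_Kam_ge (IsCentral c) h hh1 hα0 hα24 hW1 hWα (T X)
    have hTX : ‖T X‖ = ‖X‖ := by
      rw [hT, CStarRing.norm_mul_mem_unitary _ (Matrix.specialUnitaryGroup_le_unitaryGroup (post W c).2),
        CStarRing.norm_mem_unitary_mul _ (Matrix.specialUnitaryGroup_le_unitaryGroup (pre W c).2)]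
    have hcard : ((Finset.univ.filter fun i => ¬ (IsCentral c) i).card : ℝ) = (offCard c : ℝ) := by
      rw [offCard_eq_card_filter c]
    rw [hcard, hTX] at hb
    exact le_trans (mul_le_mul_of_nonneg_right (by linarith) (norm_nonneg X)) hb
  choose! D hD hlb using key
  have hKmat : ∀ g ∈ S, (fun M => Kam (IsCentral c) h (T M)) (g : Matrix (Fin 2) (Fin 2) ℂ) =
      ((avgFun (expMeanLogSU (n := Fin 2)) (Function.update W (centralBond c) g) c : SU 2) : Matrix (Fin 2) (Fin 2) ℂ) := by
    intro g hg
    have hsmall : Small (expMeanLogSU (n := Fin 2)) (Function.update W (centralBond c) g) c :=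
      (small_update_centralBond_self_iff hj _ W c g).2 fun i => hg i
    rw [coe_avgFun_update_centralBond_SUN hj W c g hsmall]
    show eml (Fam (IsCentral c) h (T (g : Matrix (Fin 2) (Fin 2) ℂ))) * T (g : Matrix (Fin 2) (Fin 2) ℂ) = _
    rw [hT]
    rfl
  have hK : Measurable fun g : SU 2 => avgFun (expMeanLogSU (n := Fin 2)) (Function.update W (centralBond c) g) c :=
    (measurable_pi_apply c).comp ((measurable_avgFun _ measurable_expMeanLogSU_E).comp (measurable_update W))
  have hinj : InjOn (fun g : SU 2 => avgFun (expMeanLogSU (n := Fin 2)) (Function.update W (centralBond c) g) c) A :=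
    (avgFun_update_centralBond_injOn_centralWindow hj W c hα0 hα24 hαδ (by linarith)).mono hAw
  exact haarData_image_ge hS hK hD hKmat hA hAS hinj hc0 hc1 fun g hg X => hlb g (hAS hg) hg X

/-- ★★★ **UNIFORM VOLUME NON-COMPRESSION ON THE CENTRAL WINDOWS, `SU(2)`** — the statement of the skeleton's `ChainVol P …` -/
theorem exists_chainVol_SU2 (P : Params) {α : ℝ} (hα0 : 0 < α) (hα24 : α ≤ 1 / 24) (hαδ : α < deltaSU (Fin 2))
    (hgap : ∀ j (c : PBond P (j + 1)), (offCard c : ℝ) / (Fintype.card (Idx P) : ℝ) + 150 * α < 1) :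
    ∃ j₀ : ℝ≥0, 0 < j₀ ∧ ∀ (j : ℕ), j + 1 ≤ P.m + P.K → ∀ (W : GaugeField P j (SU 2)) (c : PBond P (j + 1)) (A : Set (SU 2)), MeasurableSet A →
      A ⊆ {g : SU 2 | ∀ i : Idx P, dist1 (fibreFamily W c (pre W c * g * post W c) i) ≤ α} →
        (j₀ : ℝ≥0∞) * (HaarData.haar : Measure (SU 2)) A ≤
          (HaarData.haar : Measure (SU 2)) ((fun g : SU 2 => avgFun (expMeanLogSU (n := Fin 2)) (Function.update W (centralBond c) g) c) '' A) := by
  classical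
  set I : ℝ := (Fintype.card (Idx P) : ℝ) with hI
  set f : ℕ → ℝ := fun k => 1 - ((k : ℝ) / I + 150 * α) with hf
  set Ks : Finset ℕ := (Finset.range (Fintype.card (Idx P) + 1)).filter fun k => (k : ℝ) / I + 150 * α < 1 with hKs_def
  have hmem : ∀ j (c : PBond P (j + 1)), offCard c ∈ Ks := fun j c => by
    simp only [hKs_def, Finset.mem_filter, Finset.mem_range]
    exact ⟨Nat.lt_succ_of_le (Fintype.card_subtype_le _), hgap j c⟩
  rcases Ks.eq_empty_or_nonempty with hKs | hKs
  · refine ⟨1, one_pos, fun j _ W c A _ _ => ?_⟩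
    exact absurd (hmem j c) (by simp [hKs])
  · obtain ⟨k₀, hk₀, hmin⟩ := Ks.exists_min_image f hKs
    have hlt : ((k₀ : ℝ) / I + 150 * α) < 1 := by
      have h := (Finset.mem_filter.1 hk₀).2
      exact h
    have hf0 : 0 < f k₀ := by simp only [hf]; linarith
    have hf1 : f k₀ ≤ 1 := by
      have h0 : 0 ≤ (k₀ : ℝ) / I + 150 * α := by positivity
      simp only [hf]; linarith
    refine ⟨Real.toNNReal (f k₀ ^ 4), Real.toNNReal_pos.2 (by positivity), fun j hj W c A hA hAw => ?_⟩
    have hgap' : (offCard c : ℝ) / (Fintype.card (Idx P) : ℝ) + 150 * α ≤ 1 - f k₀ := by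
      have h := hmin _ (hmem j c)
      simp only [hf] at h ⊢
      linarith
    exact haar_image_avgFun_update_ge hj W c hα0.le hα24 hαδ hf0 hf1 hgap' hA hAw

end SU2Apply

end Summit.QuantumFields.YangMills.Cruxes.FluctuationComparisonRegPrIntL.RunPairOrgan.WregChart.QLemmaA

end QLemmaAEngine

namespace Summit.QuantumFields.YangMills.Cruxes.FluctuationComparisonRegPrIntL.RunPairOrgan.WregChart

/-! ## §0 FIRST RUNGS OF CHART-ALG (PROVED): triangularity of the iterated averaging and injectivity of its one-variable chain on the windows. -/

section Triangular

open Function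
open Literature.MathematicalPhysics.QuantumFieldTheory.Balaban1983to89.BlockAveraging (Idx avgFun)
open Literature.MathematicalPhysics.QuantumFieldTheory.Balaban1983to89.BlockAveragingHaarAC (centralBond centralBond_injective isLocal_avgFun pre post)
open Literature.MathematicalPhysics.QuantumFieldTheory.Balaban1983to89.BlockAveragingEMLHaarAC (fibreFamily offCard)
open Literature.MathematicalPhysics.QuantumFieldTheory.Balaban1983to89.ExpMeanLog (expMeanLogSU deltaSU)
open Literature.MathematicalPhysics.QuantumFieldTheory.Balaban1983to89.T4TriangularPushforward (IsLocal)
open Literature.MathematicalPhysics.QuantumFieldTheory.Balaban1983to89.Node00 (SU)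
open Summit.QuantumFields.YangMills.BalabanUVNodes.N09CentralWindowAtRecord (avgFun_update_centralBond_injOn_centralWindow)

variable {P : Params}

/-- The ITERATED central bond `βₙ : PBond P n → PBond P 0`, `β₀ = id`, `βₙ₊₁ = βₙ ∘ centralBond` — the private coordinate … -/
def iterCentralBond : (n : ℕ) → PBond P n → PBond P 0
  | 0 => id
  | n + 1 => iterCentralBond n ∘ centralBond

@[simp] theorem iterCentralBond_zero : (iterCentralBond 0 : PBond P 0 → PBond P 0) = id := rfl

theorem iterCentralBond_succ (n : ℕ) (c : PBond P (n + 1)) :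
    iterCentralBond (n + 1) c = iterCentralBond n (centralBond c) := rfl

/-- `βₙ` is injective in the standing range `n ≤ m + K`. [folklore] -/
theorem iterCentralBond_injective : ∀ {n : ℕ}, n ≤ P.m + P.K → Injective (iterCentralBond n : PBond P n → PBond P 0)
  | 0, _ => fun _ _ h => h
  | n + 1, hn => fun c c' h =>
      centralBond_injective (by omega) (iterCentralBond_injective (n := n) (by omega) h)

variable {G : Type*} [GaugeGroup G]

/-- ★ **THE `n`-FOLD BLOCK AVERAGING IS TRIANGULAR IN THE ITERATED CENTRAL BONDS**: `Ū⁽ⁿ⁾(c′)` does not depend on `U(βₙ c)` for `c′ ≠ c` … -/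
theorem isLocal_iter_blockAvg (ℰ : LoopAverage G) :
    ∀ {n : ℕ}, n ≤ P.m + P.K →
      IsLocal (iterCentralBond n : PBond P n → PBond P 0)
        (Averaging.iter (fun i => BlockAveraging.blockAvg (P := P) (j := i) ℰ) n)
  | 0, _ => by
      intro U c g c' hc
      simp [Averaging.iter, update_of_ne hc]
  | n + 1, hn => by
      intro U c g c' hc
      have IH := isLocal_iter_blockAvg ℰ (n := n) (by omega)
      set W := Averaging.iter (fun i => BlockAveraging.blockAvg (P := P) (j := i) ℰ) n
        (update U (iterCentralBond (n + 1) c) g) with hW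
      set W₀ := Averaging.iter (fun i => BlockAveraging.blockAvg (P := P) (j := i) ℰ) n U with hW₀
      have hWeq : W = update W₀ (centralBond c) (W (centralBond c)) := by
        funext b
        by_cases hb : b = centralBond c
        · subst hb; simp
        · rw [update_of_ne hb]
          exact IH U (centralBond c) g b hb
      show BlockAveraging.avgFun ℰ W c' = BlockAveraging.avgFun ℰ W₀ c'
      rw [hWeq]
      exact isLocal_avgFun (by omega) ℰ W₀ c (W (centralBond c)) c' hc

/-! ## §0b The one-variable CHAIN of the iterated averaging and its injectivity on iterated central windows -/

/-- The ONE-VARIABLE CHAIN MAP of the `n`-fold averaging at the coarse bond `c` in the environment `U`: `g ↦ Ū⁽ⁿ⁾(c)` at `U[βₙ c ↦ g]`. [folklore] -/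
def chainMap (ℰ : LoopAverage G) (n : ℕ) (U : GaugeField P 0 G) (c : PBond P n) (g : G) : G :=
  Averaging.iter (fun i => BlockAveraging.blockAvg (P := P) (j := i) ℰ) n (update U (iterCentralBond n c) g) c

theorem chainMap_zero (ℰ : LoopAverage G) (U : GaugeField P 0 G) (c : PBond P 0) (g : G) : chainMap ℰ 0 U c g = g := by
  simp [chainMap, Averaging.iter]

/-- ★ **CHAIN RECURSION**: `Ū⁽ⁿ⁺¹⁾(c)` at `U[βₙ₊₁ c ↦ g]` is the ONE-LEVEL one-variable map at the environment `Ū⁽ⁿ⁾(U)` … -/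
theorem chainMap_succ (ℰ : LoopAverage G) {n : ℕ} (hn : n + 1 ≤ P.m + P.K) (U : GaugeField P 0 G) (c : PBond P (n + 1)) (g : G) :
    chainMap ℰ (n + 1) U c g =
      avgFun ℰ (update (Averaging.iter (fun i => BlockAveraging.blockAvg (P := P) (j := i) ℰ) n U) (centralBond c)
        (chainMap ℰ n U (centralBond c) g)) c := by
  have IH := isLocal_iter_blockAvg (P := P) ℰ (n := n) (by omega)
  set W := Averaging.iter (fun i => BlockAveraging.blockAvg (P := P) (j := i) ℰ) n
    (update U (iterCentralBond (n + 1) c) g) with hW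
  set W₀ := Averaging.iter (fun i => BlockAveraging.blockAvg (P := P) (j := i) ℰ) n U with hW₀
  have hWeq : W = update W₀ (centralBond c) (W (centralBond c)) := by
    funext b
    by_cases hb : b = centralBond c
    · subst hb; simp
    · rw [update_of_ne hb]
      exact IH U (centralBond c) g b hb
  have hchain : chainMap ℰ n U (centralBond c) g = W (centralBond c) := rfl
  rw [hchain]
  show BlockAveraging.avgFun ℰ W c = BlockAveraging.avgFun ℰ (update W₀ (centralBond c) (W (centralBond c))) c
  rw [← hWeq]

variable {N : ℕ} [NeZero N]

/-- The central `α`-window of the one-level (0.4) average at environment `W`. [cite: Balaban1987RG1, (0.4) p.253 and (2.9) p.266 (bookkeeping)] -/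
def centralWindowSet {j : ℕ} (W : GaugeField P j (SU N)) (c : PBond P (j + 1)) (α : ℝ) : Set (SU N) :=
  {h : SU N | ∀ i : Idx P, dist1 (fibreFamily W c (pre W c * h * post W c) i) ≤ α}

/-- The ITERATED central window of the chain at `(n, U, c)`: the level-`k` chain values lie in the level-`k` central windows of the intermediate … -/
def chainWindow (α : ℝ) : (n : ℕ) → GaugeField P 0 (SU N) → PBond P n → Set (SU N)
  | 0, _, _ => univ
  | n + 1, U, c => {g | g ∈ chainWindow α n U (centralBond c) ∧
      chainMap (expMeanLogSU (n := Fin N)) n U (centralBond c) g ∈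
        centralWindowSet (Averaging.iter (fun i => BlockAveraging.blockAvg (P := P) (j := i) (expMeanLogSU (n := Fin N))) n U) c α}

/-- ★★ **THE CHAIN IS INJECTIVE ON THE ITERATED CENTRAL WINDOW**. [cite: Balaban1987RG1, (0.4) p.253 and p.267] -/
theorem chainMap_injOn {α : ℝ} (hα0 : 0 ≤ α) (hα : α ≤ 1 / 24) (hαδ : α < deltaSU (Fin N))
    (hgap : ∀ j (c : PBond P (j + 1)), (offCard c : ℝ) / (Fintype.card (Idx P) : ℝ) + 150 * α < 1) :
    ∀ {n : ℕ}, n ≤ P.m + P.K → ∀ (U : GaugeField P 0 (SU N)) (c : PBond P n),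
      InjOn (chainMap (expMeanLogSU (n := Fin N)) n U c) (chainWindow α n U c)
  | 0, _ => fun U c g₁ _ g₂ _ h => by simpa [chainMap_zero] using h
  | n + 1, hn => fun U c g₁ hg₁ g₂ hg₂ h => by
      have h1 := hg₁.2
      have h2 := hg₂.2
      rw [chainMap_succ _ hn, chainMap_succ _ hn] at h
      have hw : chainMap (expMeanLogSU (n := Fin N)) n U (centralBond c) g₁ =
          chainMap (expMeanLogSU (n := Fin N)) n U (centralBond c) g₂ :=
        avgFun_update_centralBond_injOn_centralWindow (by omega) _ c hα0 hα hαδ (hgap n c) h1 h2 h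
      exact chainMap_injOn hα0 hα hαδ hgap (n := n) (by omega) U (centralBond c) hg₁.1 hg₂.1 hw

/-! ### §0c Support bookkeeping: a UV-small history lies in its own iterated central window -/

section SelfWindow

open Literature.MathematicalPhysics.QuantumFieldTheory.Balaban1983to89.BlockAveraging (loopHol)
open Literature.MathematicalPhysics.QuantumFieldTheory.Balaban1983to89.LatticeWordStokes (dist1_loopHol_le)
open Summit.QuantumFields.YangMills.BalabanUVNodes.N09CentralWindowAtRecord (self_mem_centralWindow_iff)

/-- The chain at the configuration's OWN private coordinate is the iterated average itself. [folklore] -/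
theorem chainMap_self (ℰ : LoopAverage G) (n : ℕ) (U : GaugeField P 0 G) (c : PBond P n) :
    chainMap ℰ n U c (U (iterCentralBond n c)) = Averaging.iter (fun i => BlockAveraging.blockAvg (P := P) (j := i) ℰ) n U c := by
  simp [chainMap]

/-- ★ A UV-small history lies in its own iterated central window. [cite: Balaban1987RG1, (0.4) p.253 and (2.9) p.266 (bookkeeping)] -/
theorem self_mem_chainWindow {α : ℝ} (θ : ℕ → ℝ) (hθ0 : ∀ k, 0 ≤ θ k)
    (hθα : ∀ k, ((((P.d + 2) * P.L : ℕ) : ℝ) ^ 2 / 4) * θ k ≤ α) :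
    ∀ {n : ℕ}, n ≤ P.m + P.K → ∀ (U : GaugeField P 0 (SU N)) (c : PBond P n),
      (∀ k, k < n → PlaqSmall (θ k) (Averaging.iter (fun i => BlockAveraging.blockAvg (P := P) (j := i) (expMeanLogSU (n := Fin N))) k U)) →
        U (iterCentralBond n c) ∈ chainWindow α n U c
  | 0, _ => fun U c _ => Set.mem_univ _
  | n + 1, hn => fun U c hsmall => by
      refine ⟨self_mem_chainWindow θ hθ0 hθα (n := n) (by omega) U (centralBond c) fun k hk => hsmall k (by omega), ?_⟩
      show chainMap (expMeanLogSU (n := Fin N)) n U (centralBond c) (U (iterCentralBond n (centralBond c))) ∈ _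
      rw [chainMap_self]
      refine (self_mem_centralWindow_iff (by omega) _ c α).2 fun i => ?_
      exact (dist1_loopHol_le (hθ0 n) (hsmall n (by omega)) c i).trans (hθα n)

end SelfWindow

end Triangular

/-! ## §0d CHART-ALG II (v7 rung, PROVED; v8: `J` jointly measurable): FORWARD LAWS COMPOSE; the chain's forward Jacobian law on the iterated central window -/

section ChainLawSec

open Function
open Literature.MathematicalPhysics.QuantumFieldTheory.Balaban1983to89.BlockAveraging (Idx avgFun measurable_avgFun)
open Literature.MathematicalPhysics.QuantumFieldTheory.Balaban1983to89.BlockAveragingHaarAC (centralBond centralBond_injective isLocal_avgFun pre post)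
open Literature.MathematicalPhysics.QuantumFieldTheory.Balaban1983to89.BlockAveragingEMLHaarAC (fibreFamily offCard)
open Literature.MathematicalPhysics.QuantumFieldTheory.Balaban1983to89.ExpMeanLog (expMeanLogSU deltaSU deltaSU_pos measurable_expMeanLogSU_E)
open Literature.MathematicalPhysics.QuantumFieldTheory.Balaban1983to89.Node00 (SU)
open Summit.QuantumFields.YangMills.BalabanUVNodes.N09CentralWindowAtRecord (avgFun_update_centralBond_injOn_centralWindow mem_injWindow_of_mem_centralWindow)
open Summit.QuantumFields.YangMills.BalabanUVNodes.N09CentralWindowForwardLaw (isClosed_centralWindowW)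
open Summit.QuantumFields.YangMills.BalabanUVNodes.N09CentralWindowForwardLawAtRecord (exists_jacobian_forwardLaws_continuousOn)
open Summit.QuantumFields.YangMills.BalabanUVNodes.N07AveragingLocalContinuity (continuousAt_avgFun_apply_of_small)
open Summit.QuantumFields.YangMills.BalabanUVNodes.N09CentralWindowInverseContinuous (isClosed_centralWindow)
open Literature.Topology.ParametricInverse (continuousOn_of_isClosed_graph)

variable {P : Params}

section Compose

variable {X Y Z : Type*} [MeasurableSpace X] [MeasurableSpace Y] [MeasurableSpace Z]

/-- `(f_* ρ)·h = f_*(ρ·(h ∘ f))` for measurable `f`, `h`. [folklore] -/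
theorem withDensity_map_eq_map_withDensity_comp (ρ : Measure X) {f : X → Y} (hf : Measurable f) {h : Y → ℝ≥0∞} (hh : Measurable h) :
    (ρ.map f).withDensity h = (ρ.withDensity (h ∘ f)).map f := by
  ext s hs
  rw [withDensity_apply _ hs, Measure.map_apply hf hs, withDensity_apply _ (hf hs), Measure.restrict_map hf hs,
    lintegral_map hh hf]
  rfl

/-- ★ **FORWARD JACOBIAN LAWS COMPOSE.** If `μY⌊f(W) = f_*(J·μX⌊W)` and `μZ⌊F(Ω) = F_*(jac·μY⌊Ω)` with `F` injective on … -/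
theorem forwardLaw_comp (μX : Measure X) (μY : Measure Y) (μZ : Measure Z) {f : X → Y} {F : Y → Z} (hf : Measurable f) (hF : Measurable F)
    {W : Set X} {Ω : Set Y} (hΩ : MeasurableSet Ω) {J : X → ℝ≥0∞} {jac : Y → ℝ≥0∞} (hJ : Measurable J) (hjac : Measurable jac)
    (hinj : InjOn F Ω) (hFS : MeasurableSet (F '' (f '' W ∩ Ω)))
    (lawf : μY.restrict (f '' W) = (((μX.restrict W).withDensity J).map f))
    (lawF : μZ.restrict (F '' Ω) = (((μY.restrict Ω).withDensity jac).map F)) :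
    μZ.restrict ((F ∘ f) '' (W ∩ f ⁻¹' Ω)) = ((μX.restrict (W ∩ f ⁻¹' Ω)).withDensity (J * (jac ∘ f))).map (F ∘ f) := by
  have hS : f '' (W ∩ f ⁻¹' Ω) = f '' W ∩ Ω := Set.image_inter_preimage f W Ω
  have himg : (F ∘ f) '' (W ∩ f ⁻¹' Ω) = F '' (f '' W ∩ Ω) := by rw [Set.image_comp, hS]
  rw [himg]
  have hsub : F '' (f '' W ∩ Ω) ⊆ F '' Ω := Set.image_mono Set.inter_subset_right
  have h1 : μZ.restrict (F '' (f '' W ∩ Ω)) = (μZ.restrict (F '' Ω)).restrict (F '' (f '' W ∩ Ω)) := by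
    rw [Measure.restrict_restrict hFS, Set.inter_eq_self_of_subset_left hsub]
  have hpre : F ⁻¹' (F '' (f '' W ∩ Ω)) ∩ Ω = f '' W ∩ Ω := by
    ext y
    constructor
    · rintro ⟨⟨y', hy', hyy⟩, hyΩ⟩
      have : y' = y := hinj hy'.2 hyΩ hyy
      subst this
      exact hy'
    · intro hy
      exact ⟨⟨y, hy, rfl⟩, hy.2⟩
  rw [h1, lawF, Measure.restrict_map hF hFS, restrict_withDensity (hF hFS), Measure.restrict_restrict (hF hFS), hpre]
  have h2 : μY.restrict (f '' W ∩ Ω) = (μY.restrict (f '' W)).restrict Ω := by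
    rw [Measure.restrict_restrict hΩ, Set.inter_comm]
  rw [h2, lawf, Measure.restrict_map hf hΩ, restrict_withDensity (hf hΩ), Measure.restrict_restrict (hf hΩ), Set.inter_comm,
    withDensity_map_eq_map_withDensity_comp _ hf hjac, Measure.map_map hF hf]
  congr 1
  rw [Set.inter_comm, withDensity_mul _ hJ (hjac.comp hf)]

end Compose

section ChainLaw

set_option maxHeartbeats 800000

variable {N : ℕ} [NeZero N]

/-- The chain map is measurable in the pivot variable. [folklore] -/
theorem measurable_chainMap (n : ℕ) (U : GaugeField P 0 (SU N)) (c : PBond P n) :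
    Measurable (chainMap (expMeanLogSU (n := Fin N)) n U c) := by
  unfold chainMap
  have hiter := T4Continuum.measurable_iter (fun i => BlockAveraging.blockAvg (P := P) (j := i) (expMeanLogSU (n := Fin N)))
    (fun j => by rw [BlockAveraging.blockAvg_avg]; exact measurable_avgFun _ measurable_expMeanLogSU_E) n
  exact (measurable_pi_apply c).comp (hiter.comp (measurable_update U))

/-- The chain map is JOINTLY measurable in the environment and the pivot variable. [folklore] -/
theorem measurable_chainMap₂ (n : ℕ) (c : PBond P n) :
    Measurable fun p : GaugeField P 0 (SU N) × SU N => chainMap (expMeanLogSU (n := Fin N)) n p.1 c p.2 := by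
  unfold chainMap
  have hiter := T4Continuum.measurable_iter (fun i => BlockAveraging.blockAvg (P := P) (j := i) (expMeanLogSU (n := Fin N)))
    (fun j => by rw [BlockAveraging.blockAvg_avg]; exact measurable_avgFun _ measurable_expMeanLogSU_E) n
  exact (measurable_pi_apply c).comp (hiter.comp measurable_update')

/-- The central `α`-window is measurable. [cite: Balaban1987RG1, (0.4) p.253 and (2.9) p.266 (bookkeeping)] -/
theorem measurableSet_centralWindowSet {j : ℕ} (W : GaugeField P j (SU N)) (c : PBond P (j + 1)) (α : ℝ) :
    MeasurableSet (centralWindowSet W c α) :=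
  ((isClosed_centralWindowW W c α).preimage ((continuous_const.mul continuous_id).mul continuous_const)).measurableSet

/-- The successor iterated window, as an intersection with a preimage (definitional). [folklore] -/
theorem chainWindow_succ (α : ℝ) (n : ℕ) (U : GaugeField P 0 (SU N)) (c : PBond P (n + 1)) :
    chainWindow α (n + 1) U c = chainWindow α n U (centralBond c) ∩
      chainMap (expMeanLogSU (n := Fin N)) n U (centralBond c) ⁻¹'
        centralWindowSet (Averaging.iter (fun i => BlockAveraging.blockAvg (P := P) (j := i) (expMeanLogSU (n := Fin N))) n U) c α :=
  Set.ext fun _ => Iff.rfl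

/-- The iterated central window is measurable. [folklore] -/
theorem measurableSet_chainWindow (α : ℝ) : ∀ (n : ℕ) (U : GaugeField P 0 (SU N)) (c : PBond P n), MeasurableSet (chainWindow α n U c)
  | 0, _, _ => MeasurableSet.univ
  | n + 1, U, c => by
      rw [chainWindow_succ]
      exact (measurableSet_chainWindow α n U (centralBond c)).inter
        ((measurable_chainMap n U (centralBond c)) (measurableSet_centralWindowSet
          (Averaging.iter (fun i => BlockAveraging.blockAvg (P := P) (j := i) (expMeanLogSU (n := Fin N))) n U) c α))

/-- The image window of the chain is measurable (Lusin–Souslin, from `chainMap_injOn`). [cite: Kechris1995, Thm 15.1] -/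
theorem measurableSet_image_chainWindow {α : ℝ} (hα0 : 0 ≤ α) (hα : α ≤ 1 / 24) (hαδ : α < deltaSU (Fin N))
    (hgap : ∀ j (c : PBond P (j + 1)), (offCard c : ℝ) / (Fintype.card (Idx P) : ℝ) + 150 * α < 1) {n : ℕ} (hn : n ≤ P.m + P.K)
    (U : GaugeField P 0 (SU N)) (c : PBond P n) {S : Set (SU N)} (hS : MeasurableSet S) (hSW : S ⊆ chainWindow α n U c) :
    MeasurableSet (chainMap (expMeanLogSU (n := Fin N)) n U c '' S) :=
  hS.image_of_measurable_injOn (measurable_chainMap n U c) ((chainMap_injOn hα0 hα hαδ hgap hn U c).mono hSW)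

/-! ### §0v CHART-VOL: uniform volume non-compression of the one-step (0.4) average on central windows ⇒ a one-step Jacobian bounded BELOW -/

/-- **CHART-VOL at `P`** (chart-free). [cite: Balaban1987RG1, (0.4) p.253 and (2.10) p.267] -/
def ChainVol (P : Params) (N : ℕ) [NeZero N] (α : ℝ) (j₀ : ℝ≥0) : Prop :=
  ∀ (j : ℕ), j + 1 ≤ P.m + P.K → ∀ (W : GaugeField P j (SU N)) (c : PBond P (j + 1)) (A : Set (SU N)), MeasurableSet A →
    A ⊆ centralWindowSet W c α →
      (j₀ : ℝ≥0∞) * (HaarData.haar : Measure (SU N)) A ≤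
        (HaarData.haar : Measure (SU N)) ((fun g : SU N => avgFun (expMeanLogSU (n := Fin N)) (update W (centralBond c) g) c) '' A)

/-- ★ N09's one-step Jacobian, with a lower bound under CHART-VOL (or trivially `j₀ = 0`). [cite: Balaban1987RG1, (0.4) p.253 and (2.10) p.267] -/
theorem exists_jacobian_forwardLaws_lb {j : ℕ} (hj : j + 1 ≤ P.m + P.K) {α : ℝ} (hα0 : 0 ≤ α) (hα24 : α ≤ 1 / 24)
    (hα64 : 64 * α ≤ deltaSU (Fin N)) (hαL : 157 * α < ((P.L : ℝ) ^ (P.d - 1))⁻¹)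
    (hgap : ∀ c : PBond P (j + 1), (offCard c : ℝ) / (Fintype.card (Idx P) : ℝ) + 150 * α < 1)
    {j₀ : ℝ≥0} (hvol : j₀ = 0 ∨ ChainVol P N α j₀) :
    ∃ jac : PBond P (j + 1) → GaugeField P j (SU N) → SU N → ℝ≥0,
      (∀ c, Measurable fun p : GaugeField P j (SU N) × SU N => jac c p.1 p.2) ∧
      (∀ c U g, g ∈ centralWindowSet U c α → jac c U g ≠ 0) ∧
      (∀ c U, (HaarData.haar : Measure (SU N)).restrict
          ((fun g : SU N => avgFun (expMeanLogSU (n := Fin N)) (update U (centralBond c) g) c) '' centralWindowSet U c α) =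
        (((HaarData.haar : Measure (SU N)).restrict (centralWindowSet U c α)).withDensity fun g => (jac c U g : ℝ≥0∞)).map
          (fun g : SU N => avgFun (expMeanLogSU (n := Fin N)) (update U (centralBond c) g) c)) ∧
      (∀ c U, ContinuousOn (jac c U) (centralWindowSet U c α)) ∧
      (∀ c U g, j₀ ≤ jac c U g) := by
  have hαδ : α < deltaSU (Fin N) := by nlinarith [deltaSU_pos (n := Fin N)]
  obtain ⟨jac, hm, h0, hlaw, hc⟩ := exists_jacobian_forwardLaws_continuousOn (N := N) (P := P) hj hα0 hα24 hα64 hαL hgap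
  by_cases hj₀ : j₀ = 0
  · exact ⟨jac, hm, fun c U g hg => h0 c U g hg, fun c U => hlaw c U, fun c U => hc c U, fun c U g => by rw [hj₀]; exact bot_le⟩
  have hvol' : ChainVol P N α j₀ := hvol.resolve_left hj₀
  have hj₀' : 0 < j₀ := pos_iff_ne_zero.2 hj₀
  refine ⟨fun c U g => max (jac c U g) j₀, fun c => (hm c).max measurable_const, fun c U g _ => (lt_of_lt_of_le hj₀' (le_max_right _ _)).ne',
    fun c U => ?_, fun c U => continuous_max.comp_continuousOn ((hc c U).prodMk continuousOn_const), fun c U g => le_max_right _ _⟩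
  dsimp only
  set Ω := centralWindowSet U c α with hΩ
  set Fm := fun g : SU N => avgFun (expMeanLogSU (n := Fin N)) (update U (centralBond c) g) c with hFm_def
  have hΩm : MeasurableSet Ω := measurableSet_centralWindowSet U c α
  have hFmeas : Measurable Fm := (measurable_pi_apply c).comp ((measurable_avgFun _ measurable_expMeanLogSU_E).comp (measurable_update _))
  have hinj : InjOn Fm Ω := fun g₁ hg₁ g₂ hg₂ h => avgFun_update_centralBond_injOn_centralWindow hj _ c hα0 hα24 hαδ (hgap c) hg₁ hg₂ h
  have hae : ∀ᵐ g ∂(HaarData.haar : Measure (SU N)).restrict Ω, (j₀ : ℝ≥0∞) ≤ (jac c U g : ℝ≥0∞) := by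
    refine ae_le_of_forall_setLIntegral_le_of_sigmaFinite measurable_const fun s hs _ => ?_
    have hA : MeasurableSet (s ∩ Ω) := hs.inter hΩm
    have hFA : MeasurableSet (Fm '' (s ∩ Ω)) := hA.image_of_measurable_injOn hFmeas (hinj.mono inter_subset_right)
    have h1 : ∫⁻ _ in s, (j₀ : ℝ≥0∞) ∂(HaarData.haar : Measure (SU N)).restrict Ω = (j₀ : ℝ≥0∞) * (HaarData.haar : Measure (SU N)) (s ∩ Ω) := by
      rw [Measure.restrict_restrict hs, setLIntegral_const]
    have h2 : ∫⁻ g in s, (jac c U g : ℝ≥0∞) ∂(HaarData.haar : Measure (SU N)).restrict Ω = (HaarData.haar : Measure (SU N)) (Fm '' (s ∩ Ω)) := by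
      have hlaw' : (HaarData.haar : Measure (SU N)).restrict (Fm '' Ω) =
          (((HaarData.haar : Measure (SU N)).restrict Ω).withDensity fun g => (jac c U g : ℝ≥0∞)).map Fm := hlaw c U
      have happ := congrArg (fun μ : Measure (SU N) => μ (Fm '' (s ∩ Ω))) hlaw'
      rw [Measure.restrict_apply hFA, Set.inter_eq_left.2 (Set.image_mono inter_subset_right), Measure.map_apply hFmeas hFA,
        withDensity_apply _ (hFmeas hFA), Measure.restrict_restrict (hFmeas hFA), hinj.preimage_image_inter inter_subset_right] at happ
      rw [Measure.restrict_restrict hs, happ]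
    rw [h1, h2]
    exact hvol' j hj U c (s ∩ Ω) hA inter_subset_right
  have hcongr : ((HaarData.haar : Measure (SU N)).restrict Ω).withDensity (fun g => ((max (jac c U g) j₀ : ℝ≥0) : ℝ≥0∞)) =
      ((HaarData.haar : Measure (SU N)).restrict Ω).withDensity fun g => (jac c U g : ℝ≥0∞) := by
    refine withDensity_congr_ae ?_
    filter_upwards [hae] with g hg
    rw [max_eq_left (by exact_mod_cast hg)]
  rw [hcongr]
  exact hlaw c U

/-! ### §0g CHART-REG (fibre direction) I: fixed-environment continuity of the chain on its compact window. -/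

/-- The one-step (0.4) average at a fixed environment, as a map of the central variable. [cite: Balaban1987RG1, (0.4) p.253] -/
theorem continuousOn_avgFun_update_centralWindowSet {j : ℕ} (hj : j + 1 ≤ P.m + P.K) (W : GaugeField P j (SU N)) (c : PBond P (j + 1)) {α : ℝ}
    (hαδ : α < deltaSU (Fin N)) :
    ContinuousOn (fun h : SU N => avgFun (expMeanLogSU (n := Fin N)) (update W (centralBond c) h) c) (centralWindowSet W c α) := by
  intro h hh
  have hsmall : BlockAveraging.Small (expMeanLogSU (n := Fin N)) (update W (centralBond c) h) c :=
    (mem_injWindow_of_mem_centralWindow hj c hαδ W hh).1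
  have hu : Continuous fun h' : SU N => update W (centralBond c) h' := continuous_const.update (centralBond c) continuous_id
  exact ((continuousAt_avgFun_apply_of_small c hsmall).comp hu.continuousAt).continuousWithinAt

/-- The central `α`-window at a fixed environment is closed. [cite: Balaban1987RG1, (0.4) p.253 (bookkeeping)] -/
theorem isClosed_centralWindowSet {j : ℕ} (W : GaugeField P j (SU N)) (c : PBond P (j + 1)) (α : ℝ) : IsClosed (centralWindowSet W c α) :=
  isClosed_centralWindow c α W

/-- ★ At a fixed environment the chain is continuous on the iterated window and the window is compact. [cite: Balaban1987RG1, (0.4) p.253 and p.267] -/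
theorem continuousOn_chainMap_and_isClosed {α : ℝ} (hαδ : α < deltaSU (Fin N)) :
    ∀ {n : ℕ}, n ≤ P.m + P.K → ∀ (U : GaugeField P 0 (SU N)) (c : PBond P n),
      ContinuousOn (chainMap (expMeanLogSU (n := Fin N)) n U c) (chainWindow α n U c) ∧ IsClosed (chainWindow α n U c)
  | 0, _ => fun U c => by
      have h0 : chainMap (expMeanLogSU (n := Fin N)) 0 U c = id := funext fun g => chainMap_zero _ U c g
      have hW0 : chainWindow α 0 U c = Set.univ := rfl
      rw [h0, hW0]
      exact ⟨continuousOn_id, isClosed_univ⟩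
  | n + 1, hn => fun U c => by
      obtain ⟨hf, hW⟩ := continuousOn_chainMap_and_isClosed hαδ (n := n) (by omega) U (centralBond c)
      have hcomp : chainMap (expMeanLogSU (n := Fin N)) (n + 1) U c =
          (fun g => avgFun (expMeanLogSU (n := Fin N)) (update
            (Averaging.iter (fun i => BlockAveraging.blockAvg (P := P) (j := i) (expMeanLogSU (n := Fin N))) n U) (centralBond c) g) c) ∘
            chainMap (expMeanLogSU (n := Fin N)) n U (centralBond c) := funext fun g => chainMap_succ _ hn U c g
      rw [hcomp, chainWindow_succ]
      refine ⟨(continuousOn_avgFun_update_centralWindowSet (N := N) (by omega) _ c hαδ).comp (hf.mono inter_subset_left) fun g hg => hg.2, ?_⟩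
      exact hf.preimage_isClosed_of_isClosed hW (isClosed_centralWindowSet _ c α)

theorem continuousOn_chainMap {α : ℝ} (hαδ : α < deltaSU (Fin N)) {n : ℕ} (hn : n ≤ P.m + P.K) (U : GaugeField P 0 (SU N)) (c : PBond P n) :
    ContinuousOn (chainMap (expMeanLogSU (n := Fin N)) n U c) (chainWindow α n U c) :=
  (continuousOn_chainMap_and_isClosed hαδ hn U c).1

theorem isClosed_chainWindow {α : ℝ} (hαδ : α < deltaSU (Fin N)) {n : ℕ} (hn : n ≤ P.m + P.K) (U : GaugeField P 0 (SU N)) (c : PBond P n) :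
    IsClosed (chainWindow α n U c) :=
  (continuousOn_chainMap_and_isClosed hαδ hn U c).2

theorem isCompact_chainWindow {α : ℝ} (hαδ : α < deltaSU (Fin N)) {n : ℕ} (hn : n ≤ P.m + P.K) (U : GaugeField P 0 (SU N)) (c : PBond P n) :
    IsCompact (chainWindow α n U c) :=
  (isClosed_chainWindow hαδ hn U c).isCompact

/-- The image window `chainMap n U c '' chainWindow α n U c` is compact, hence closed. [folklore] -/
theorem isClosed_image_chainWindow {α : ℝ} (hαδ : α < deltaSU (Fin N)) {n : ℕ} (hn : n ≤ P.m + P.K) (U : GaugeField P 0 (SU N)) (c : PBond P n) :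
    IsClosed (chainMap (expMeanLogSU (n := Fin N)) n U c '' chainWindow α n U c) :=
  ((isCompact_chainWindow hαδ hn U c).image_of_continuousOn (continuousOn_chainMap hαδ hn U c)).isClosed

/-- Closed-graph inverse on a compact window (generic topology). [cite: BourbakiGT1, Ch. I §10 no. 2, Thm 1 Cor. 5] -/
theorem continuousOn_leftInverse_image {X Y : Type*} [TopologicalSpace X] [CompactSpace X] [TopologicalSpace Y] [T2Space Y]
    {f : X → Y} {K : Set X} (hK : IsClosed K) (hf : ContinuousOn f K) (hinj : InjOn f K) {θ : Y → X}
    (hθK : ∀ v ∈ f '' K, θ v ∈ K) (hθ : ∀ v ∈ f '' K, f (θ v) = v) : ContinuousOn θ (f '' K) := by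
  have hφ : ContinuousOn (fun r : Y × X => (f r.2, r.1)) (Prod.snd ⁻¹' K) :=
    (hf.comp continuous_snd.continuousOn fun r hr => hr).prodMk continuous_fst.continuousOn
  have hΓ : IsClosed (Prod.snd ⁻¹' K ∩ (fun r : Y × X => (f r.2, r.1)) ⁻¹' diagonal Y) :=
    hφ.preimage_isClosed_of_isClosed (hK.preimage continuous_snd) isClosed_diagonal
  refine continuousOn_of_isClosed_graph (Γ := Prod.snd ⁻¹' K ∩ (fun r : Y × X => (f r.2, r.1)) ⁻¹' diagonal Y) hΓ ?_ ?_
  · intro v hv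
    exact ⟨hθK v hv, by simpa [mem_diagonal_iff] using hθ v hv⟩
  · rintro v hv x ⟨hxK, hx⟩
    have hx' : f x = v := by simpa [mem_diagonal_iff] using hx
    exact hinj hxK (hθK v hv) (hx'.trans (hθ v hv).symm)

/-- ★★★ **CHART-ALG II** — forward law of the chain (change of variables). [cite: Balaban1987RG1, (0.4) p.253 and (2.10) p.267] -/
theorem chain_forwardLaw_lb {α : ℝ} (hα0 : 0 ≤ α) (hα24 : α ≤ 1 / 24) (hα64 : 64 * α ≤ deltaSU (Fin N))
    (hαL : 157 * α < ((P.L : ℝ) ^ (P.d - 1))⁻¹)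
    (hgap : ∀ j (c : PBond P (j + 1)), (offCard c : ℝ) / (Fintype.card (Idx P) : ℝ) + 150 * α < 1)
    {j₀ : ℝ≥0} (hvol : j₀ = 0 ∨ ChainVol P N α j₀) (n : ℕ) :
    n ≤ P.m + P.K → ∀ c : PBond P n, ∃ J : GaugeField P 0 (SU N) → SU N → ℝ≥0,
      (Measurable fun p : GaugeField P 0 (SU N) × SU N => J p.1 p.2) ∧
      (∀ U, ∀ g ∈ chainWindow α n U c, J U g ≠ 0) ∧
      (∀ U, (HaarData.haar : Measure (SU N)).restrict (chainMap (expMeanLogSU (n := Fin N)) n U c '' chainWindow α n U c) =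
        (((HaarData.haar : Measure (SU N)).restrict (chainWindow α n U c)).withDensity fun g => (J U g : ℝ≥0∞)).map
          (chainMap (expMeanLogSU (n := Fin N)) n U c)) ∧
      (∀ U, ContinuousOn (J U) (chainWindow α n U c)) ∧
      (∀ U g, j₀ ^ n ≤ J U g) := by
  have hαδ : α < deltaSU (Fin N) := by nlinarith [deltaSU_pos (n := Fin N)]
  induction n with
  | zero =>
      intro _ c
      refine ⟨fun _ _ => 1, measurable_const, fun _ _ _ => one_ne_zero, fun U => ?_, fun U => continuousOn_const, fun U g => by rw [pow_zero]⟩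
      have hid : chainMap (expMeanLogSU (n := Fin N)) 0 U c = id := funext fun g => chainMap_zero _ U c g
      have hW0 : chainWindow α 0 U c = Set.univ := rfl
      rw [hid, hW0, Set.image_id, Measure.map_id, Measure.restrict_univ]
      have h1 : (fun _ : SU N => (((1 : ℝ≥0) : ℝ≥0) : ℝ≥0∞)) = 1 := funext fun _ => ENNReal.coe_one
      rw [h1, withDensity_one]
  | succ n ih =>
      intro hn c
      obtain ⟨J, hJm, hJ0, hJlaw, hJc, hJlb⟩ := ih (by omega) (centralBond c)
      obtain ⟨jac, hjacm, hjac0, hfwd, hjc, hjlb⟩ :=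
        exists_jacobian_forwardLaws_lb (N := N) (P := P) (j := n) (by omega) hα0 hα24 hα64 hαL (hgap n) hvol
      have jacm : ∀ (W : GaugeField P n (SU N)), Measurable (jac c W) := fun W =>
        (hjacm c).comp (measurable_const.prodMk measurable_id)
      have hiter := T4Continuum.measurable_iter (fun i => BlockAveraging.blockAvg (P := P) (j := i) (expMeanLogSU (n := Fin N)))
        (fun j => by rw [BlockAveraging.blockAvg_avg]; exact measurable_avgFun _ measurable_expMeanLogSU_E) n
      refine ⟨fun U g => J U g * jac c (Averaging.iter (fun i => BlockAveraging.blockAvg (P := P) (j := i) (expMeanLogSU (n := Fin N))) n U)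
          (chainMap (expMeanLogSU (n := Fin N)) n U (centralBond c) g), ?_, fun U g hg => ?_, fun U => ?_, fun U => ?_,
          fun U g => by rw [pow_succ]; exact mul_le_mul' (hJlb U g) (hjlb c _ _)⟩
      · exact hJm.mul ((hjacm c).comp ((hiter.comp measurable_fst).prodMk (measurable_chainMap₂ n (centralBond c))))
      · exact mul_ne_zero (hJ0 U g hg.1) (hjac0 c _ _ hg.2)
      rotate_left
      · rw [chainWindow_succ]
        have hf := continuousOn_chainMap (N := N) hαδ (n := n) (by omega) U (centralBond c)
        exact ((hJc U).mono inter_subset_left).mul ((hjc c _).comp (hf.mono inter_subset_left) fun g hg => hg.2)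
      · -- `chainMap (n+1) = F ∘ f`, `chainWindow (n+1) = W ∩ f⁻¹ Ω`
        set env : GaugeField P n (SU N) := Averaging.iter (fun i => BlockAveraging.blockAvg (P := P) (j := i) (expMeanLogSU (n := Fin N))) n U
          with henv
        set f := chainMap (expMeanLogSU (n := Fin N)) n U (centralBond c) with hfdef
        have hcomp : chainMap (expMeanLogSU (n := Fin N)) (n + 1) U c =
            (fun g => avgFun (expMeanLogSU (n := Fin N)) (update env (centralBond c) g) c) ∘ f := funext fun g => chainMap_succ _ hn U c g
        have hW' : chainWindow α (n + 1) U c = chainWindow α n U (centralBond c) ∩ f ⁻¹' centralWindowSet env c α :=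
          chainWindow_succ α n U c
        have hFm : Measurable (fun g => avgFun (expMeanLogSU (n := Fin N)) (update env (centralBond c) g) c) :=
          (measurable_pi_apply c).comp ((measurable_avgFun _ measurable_expMeanLogSU_E).comp (measurable_update _))
        have hinjF : InjOn (fun g => avgFun (expMeanLogSU (n := Fin N)) (update env (centralBond c) g) c) (centralWindowSet env c α) :=
          fun g₁ hg₁ g₂ hg₂ h => avgFun_update_centralBond_injOn_centralWindow (by omega) _ c hα0 hα24 hαδ (hgap n c) hg₁ hg₂ h
        have hFS : MeasurableSet ((fun g => avgFun (expMeanLogSU (n := Fin N)) (update env (centralBond c) g) c) ''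
            (f '' chainWindow α n U (centralBond c) ∩ centralWindowSet env c α)) := by
          rw [← Set.image_inter_preimage, ← Set.image_comp, ← hcomp, ← hW']
          exact measurableSet_image_chainWindow hα0 hα24 hαδ hgap hn U c (measurableSet_chainWindow α (n + 1) U c) subset_rfl
        have key := forwardLaw_comp (HaarData.haar : Measure (SU N)) (HaarData.haar : Measure (SU N)) (HaarData.haar : Measure (SU N))
          (measurable_chainMap n U (centralBond c)) hFm (measurableSet_centralWindowSet env c α)
          (J := fun g => (J U g : ℝ≥0∞)) (jac := fun g => (jac c env g : ℝ≥0∞))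
          ((show Measurable (J U) from hJm.comp (measurable_const.prodMk measurable_id)).coe_nnreal_ennreal) (jacm env).coe_nnreal_ennreal
          hinjF hFS (hJlaw U) (hfwd c env)
        have hdens : ((fun g => (J U g : ℝ≥0∞)) * ((fun g => (jac c env g : ℝ≥0∞)) ∘ f)) =
            fun g => ((J U g * jac c env (f g) : ℝ≥0) : ℝ≥0∞) := by
          funext g
          simp only [Pi.mul_apply, Function.comp_apply, ENNReal.coe_mul]
        rw [hdens] at key
        rw [hcomp, hW']
        exact key

/-- ★★★ **CHART-ALG II with a lower bound** (`J ≥ j₀ⁿ` under `ChainVol`, or `j₀ = 0`). [cite: Balaban1987RG1, (0.4) p.253 and (2.10) p.267] -/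
theorem chain_forwardLaw {α : ℝ} (hα0 : 0 ≤ α) (hα24 : α ≤ 1 / 24) (hα64 : 64 * α ≤ deltaSU (Fin N))
    (hαL : 157 * α < ((P.L : ℝ) ^ (P.d - 1))⁻¹)
    (hgap : ∀ j (c : PBond P (j + 1)), (offCard c : ℝ) / (Fintype.card (Idx P) : ℝ) + 150 * α < 1) (n : ℕ) (hn : n ≤ P.m + P.K) (c : PBond P n) :
    ∃ J : GaugeField P 0 (SU N) → SU N → ℝ≥0,
      (Measurable fun p : GaugeField P 0 (SU N) × SU N => J p.1 p.2) ∧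
      (∀ U, ∀ g ∈ chainWindow α n U c, J U g ≠ 0) ∧
      (∀ U, (HaarData.haar : Measure (SU N)).restrict (chainMap (expMeanLogSU (n := Fin N)) n U c '' chainWindow α n U c) =
        (((HaarData.haar : Measure (SU N)).restrict (chainWindow α n U c)).withDensity fun g => (J U g : ℝ≥0∞)).map
          (chainMap (expMeanLogSU (n := Fin N)) n U c)) ∧
      (∀ U, ContinuousOn (J U) (chainWindow α n U c)) := by
  obtain ⟨J, h1, h2, h3, h4, -⟩ := chain_forwardLaw_lb (N := N) (P := P) hα0 hα24 hα64 hαL hgap (j₀ := 0) (Or.inl rfl) n hn c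
  exact ⟨J, h1, h2, h3, h4⟩

/-- ★ **LUSIN (N) ON WINDOWS** (v16): `Haar A = 0`, `A ⊆ window` ⇒ `Haar (chainMap '' A) = 0`. [folklore] -/
theorem chain_imageNull {α : ℝ} (hα0 : 0 ≤ α) (hα24 : α ≤ 1 / 24) (hα64 : 64 * α ≤ deltaSU (Fin N))
    (hαL : 157 * α < ((P.L : ℝ) ^ (P.d - 1))⁻¹)
    (hgap : ∀ j (c : PBond P (j + 1)), (offCard c : ℝ) / (Fintype.card (Idx P) : ℝ) + 150 * α < 1)
    {n : ℕ} (hn : n ≤ P.m + P.K) (U : GaugeField P 0 (SU N)) (c : PBond P n) {A : Set (SU N)}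
    (hA : A ⊆ chainWindow α n U c) (hA0 : (HaarData.haar : Measure (SU N)) A = 0) :
    (HaarData.haar : Measure (SU N)) (chainMap (expMeanLogSU (n := Fin N)) n U c '' A) = 0 := by
  classical
  have hαδ : α < deltaSU (Fin N) := by nlinarith [deltaSU_pos (n := Fin N)]
  obtain ⟨J, -, -, hlaw, -⟩ := chain_forwardLaw (N := N) (P := P) hα0 hα24 hα64 hαL hgap n hn c
  have hΦm : Measurable (chainMap (expMeanLogSU (n := Fin N)) n U c) := measurable_chainMap n U c
  have hWm : MeasurableSet (chainWindow α n U c) := measurableSet_chainWindow α n U c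
  have hA'm : MeasurableSet (toMeasurable HaarData.haar A ∩ chainWindow α n U c) :=
    (measurableSet_toMeasurable _ A).inter hWm
  have hAA' : A ⊆ toMeasurable HaarData.haar A ∩ chainWindow α n U c := fun g hg => ⟨subset_toMeasurable _ A hg, hA hg⟩
  have hA'0 : (HaarData.haar : Measure (SU N)) (toMeasurable HaarData.haar A ∩ chainWindow α n U c) = 0 :=
    measure_mono_null Set.inter_subset_left (by rw [measure_toMeasurable]; exact hA0)
  have hA'W : toMeasurable HaarData.haar A ∩ chainWindow α n U c ⊆ chainWindow α n U c := Set.inter_subset_right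
  have hinj : InjOn (chainMap (expMeanLogSU (n := Fin N)) n U c) (chainWindow α n U c) := chainMap_injOn hα0 hα24 hαδ hgap hn U c
  have himm : MeasurableSet (chainMap (expMeanLogSU (n := Fin N)) n U c '' (toMeasurable HaarData.haar A ∩ chainWindow α n U c)) :=
    hA'm.image_of_measurable_injOn hΦm (hinj.mono hA'W)
  refine measure_mono_null (Set.image_mono hAA') ?_
  have h1 : (HaarData.haar : Measure (SU N)) (chainMap (expMeanLogSU (n := Fin N)) n U c '' (toMeasurable HaarData.haar A ∩ chainWindow α n U c)) =
      (HaarData.haar : Measure (SU N)).restrict (chainMap (expMeanLogSU (n := Fin N)) n U c '' chainWindow α n U c)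
        (chainMap (expMeanLogSU (n := Fin N)) n U c '' (toMeasurable HaarData.haar A ∩ chainWindow α n U c)) := by
    rw [Measure.restrict_apply himm, Set.inter_eq_left.mpr (Set.image_mono hA'W)]
  have h2 : chainMap (expMeanLogSU (n := Fin N)) n U c ⁻¹'
        (chainMap (expMeanLogSU (n := Fin N)) n U c '' (toMeasurable HaarData.haar A ∩ chainWindow α n U c)) ∩ chainWindow α n U c =
      toMeasurable HaarData.haar A ∩ chainWindow α n U c := by
    ext a
    constructor
    · rintro ⟨⟨a', ha', he⟩, haW⟩
      exact hinj (hA'W ha') haW he ▸ ha'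
    · intro ha
      exact ⟨⟨a, ha, rfl⟩, hA'W ha⟩
  rw [h1, hlaw U, Measure.map_apply hΦm himm, withDensity_apply _ (hΦm himm), Measure.restrict_restrict (hΦm himm), h2]
  exact setLIntegral_measure_zero _ _ hA'0

/-- ★ **NULL PREIMAGES ON WINDOWS** (v17): `Haar B = 0` ⇒ `Haar (chainMap⁻¹ B ∩ window) = 0` (`chain_forwardLaw`, `J ≠ 0` on the window). [folklore] -/
theorem chain_preimageNull {α : ℝ} (hα0 : 0 ≤ α) (hα24 : α ≤ 1 / 24) (hα64 : 64 * α ≤ deltaSU (Fin N))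
    (hαL : 157 * α < ((P.L : ℝ) ^ (P.d - 1))⁻¹)
    (hgap : ∀ j (c : PBond P (j + 1)), (offCard c : ℝ) / (Fintype.card (Idx P) : ℝ) + 150 * α < 1)
    {n : ℕ} (hn : n ≤ P.m + P.K) (U : GaugeField P 0 (SU N)) (c : PBond P n) {B : Set (SU N)}
    (hBm : MeasurableSet B) (hB0 : (HaarData.haar : Measure (SU N)) B = 0) :
    (HaarData.haar : Measure (SU N)) (chainMap (expMeanLogSU (n := Fin N)) n U c ⁻¹' B ∩ chainWindow α n U c) = 0 := by
  classical
  obtain ⟨J, hJm, hJne, hlaw, -⟩ := chain_forwardLaw (N := N) (P := P) hα0 hα24 hα64 hαL hgap n hn c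
  have hΦm : Measurable (chainMap (expMeanLogSU (n := Fin N)) n U c) := measurable_chainMap n U c
  have hWm : MeasurableSet (chainWindow α n U c) := measurableSet_chainWindow α n U c
  have hJU : Measurable fun g => (J U g : ℝ≥0∞) := (hJm.comp (measurable_const.prodMk measurable_id)).coe_nnreal_ennreal
  have h1 : ∫⁻ g in chainMap (expMeanLogSU (n := Fin N)) n U c ⁻¹' B ∩ chainWindow α n U c, (J U g : ℝ≥0∞) ∂(HaarData.haar : Measure (SU N)) = 0 := by
    have h : (HaarData.haar : Measure (SU N)).restrict (chainMap (expMeanLogSU (n := Fin N)) n U c '' chainWindow α n U c) B =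
        ((((HaarData.haar : Measure (SU N)).restrict (chainWindow α n U c)).withDensity fun g => (J U g : ℝ≥0∞)).map
          (chainMap (expMeanLogSU (n := Fin N)) n U c)) B := by rw [hlaw U]
    rw [Measure.restrict_apply hBm, Measure.map_apply hΦm hBm, withDensity_apply _ (hΦm hBm), Measure.restrict_restrict (hΦm hBm)] at h
    rw [← h]
    exact measure_mono_null Set.inter_subset_left hB0
  have hSm : MeasurableSet (chainMap (expMeanLogSU (n := Fin N)) n U c ⁻¹' B ∩ chainWindow α n U c) := (hΦm hBm).inter hWm
  rw [lintegral_eq_zero_iff' (hJU.aemeasurable.restrict), Filter.EventuallyEq, ae_restrict_iff' hSm] at h1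
  rw [← compl_mem_ae_iff]
  filter_upwards [h1] with g hg
  intro hgS
  have h0 := hg hgS
  rw [Pi.zero_apply, ENNReal.coe_eq_zero] at h0
  exact hJne U g hgS.2 h0

end ChainLaw

/-! ## §0e CHART-ALG III: the fibred chart of the iterated averaging (blindness to private coordinates, joint measurability, per-bond inverses). -/

section Resample

variable {ι κ κ' G : Type*} [DecidableEq ι] [DecidableEq κ]

/-- Updating a resampled configuration at a private coordinate = resampling with the updated private family. [folklore] -/
theorem update_extend_eq {β : κ → ι} (hβ : Injective β) (g : κ → G) (U : ι → G) (c : κ) (h : G) :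
    update (extend β g U) (β c) h = extend β (update g c h) U := by
  funext x
  by_cases hx : x = β c
  · subst hx; rw [update_self, hβ.extend_apply, update_self]
  · rw [update_of_ne hx]
    by_cases hr : ∃ c', β c' = x
    · obtain ⟨c', rfl⟩ := hr
      have hc' : c' ≠ c := fun h => hx (by rw [h])
      rw [hβ.extend_apply, hβ.extend_apply, update_of_ne hc']
    · rw [extend_apply' _ _ _ hr, extend_apply' _ _ _ hr]

omit [DecidableEq ι] [DecidableEq κ] in
/-- Resampling along a composite injection = resampling along the outer one with the inner-resampled private family. [folklore] -/
theorem extend_comp_eq {β : κ → ι} {γ : κ' → κ} (hβ : Injective β) (hγ : Injective γ) (g : κ' → G) (U : ι → G) :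
    extend (β ∘ γ) g U = extend β (extend γ g (U ∘ β)) U := by
  funext x
  by_cases hr : ∃ b, β b = x
  · obtain ⟨b, rfl⟩ := hr
    rw [hβ.extend_apply]
    by_cases hs : ∃ c, γ c = b
    · obtain ⟨c, rfl⟩ := hs
      rw [hγ.extend_apply]
      exact (hβ.comp hγ).extend_apply g U c
    · rw [extend_apply' _ _ _ hs,
        extend_apply' g U (β b) (show ¬ ∃ c, (β ∘ γ) c = β b from fun ⟨c, hc⟩ => hs ⟨c, hβ hc⟩)]
      rfl
  · rw [extend_apply' _ _ _ hr, extend_apply' g U x (show ¬ ∃ c, (β ∘ γ) c = x from fun ⟨c, hc⟩ => hr ⟨γ c, hc⟩)]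

end Resample

section Blind

set_option maxHeartbeats 800000

variable {G : Type*} [GaugeGroup G]

/-- ★ **THE CHAIN MAP IS BLIND TO RESAMPLING ALL LEVEL-`n` PRIVATE COORDINATES** (locality of the iterated averaging, §0). [folklore] -/
theorem chainMap_extend (ℰ : LoopAverage G) {n : ℕ} (hn : n ≤ P.m + P.K) (g : PBond P n → G) (U : GaugeField P 0 G) (c : PBond P n) :
    chainMap ℰ n (extend (iterCentralBond n) g U) c = chainMap ℰ n U c := by
  funext h
  unfold chainMap
  rw [update_extend_eq (iterCentralBond_injective hn),
    T4TriangularPushforward.apply_resample_eq (isLocal_iter_blockAvg (P := P) ℰ hn) (iterCentralBond_injective hn) U (update g c h) c, update_self]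

/-- ★ **THE LEVEL-`n` ENVIRONMENT OF A CONFIGURATION RESAMPLED AT THE LEVEL-`(n+1)` PRIVATE COORDINATES** is the old … -/
theorem iter_extend_eq (ℰ : LoopAverage G) {n : ℕ} (hn : n + 1 ≤ P.m + P.K) (g : PBond P (n + 1) → G) (U : GaugeField P 0 G) :
    Averaging.iter (fun i => BlockAveraging.blockAvg (P := P) (j := i) ℰ) n (extend (iterCentralBond (n + 1)) g U) =
      extend centralBond (fun b => chainMap ℰ n U (centralBond b) (g b))
        (Averaging.iter (fun i => BlockAveraging.blockAvg (P := P) (j := i) ℰ) n U) := by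
  have hβ := iterCentralBond_injective (P := P) (n := n) (by omega)
  have hcb : Injective (centralBond : PBond P (n + 1) → PBond P n) := centralBond_injective (by omega)
  have hE : extend (iterCentralBond (n + 1)) g U =
      extend (iterCentralBond n) (extend centralBond g (U ∘ iterCentralBond n)) U :=
    extend_comp_eq hβ hcb g U
  rw [hE]
  funext b
  rw [T4TriangularPushforward.apply_resample_eq (isLocal_iter_blockAvg (P := P) ℰ (by omega)) hβ]
  by_cases hb : ∃ b', centralBond b' = b
  · obtain ⟨b', rfl⟩ := hb
    rw [hcb.extend_apply, hcb.extend_apply]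
    rfl
  · rw [extend_apply' _ _ _ hb, extend_apply' _ _ _ hb, Function.comp_apply, update_eq_self]

variable {N : ℕ} [NeZero N]

/-- ★★ The iterated central window is blind to resampling all level-`n` private coordinates. [cite: Balaban1987RG1, (0.4) p.253 (bookkeeping)] -/
theorem chainWindow_extend (α : ℝ) :
    ∀ {n : ℕ}, n ≤ P.m + P.K → ∀ (g : PBond P n → SU N) (U : GaugeField P 0 (SU N)) (c : PBond P n),
      chainWindow α n (extend (iterCentralBond n) g U) c = chainWindow α n U c
  | 0, _ => fun _ _ _ => rfl
  | n + 1, hn => fun g U c => by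
      have hβ := iterCentralBond_injective (P := P) (n := n) (by omega)
      have hcb : Injective (centralBond : PBond P (n + 1) → PBond P n) := centralBond_injective (by omega)
      have hE : extend (iterCentralBond (n + 1)) g U =
          extend (iterCentralBond n) (extend centralBond g (U ∘ iterCentralBond n)) U :=
        extend_comp_eq hβ hcb g U
      have hwin : centralWindowSet (Averaging.iter (fun i => BlockAveraging.blockAvg (P := P) (j := i) (expMeanLogSU (n := Fin N))) n
            (extend (iterCentralBond (n + 1)) g U)) c α =
          centralWindowSet (Averaging.iter (fun i => BlockAveraging.blockAvg (P := P) (j := i) (expMeanLogSU (n := Fin N))) n U) c α := by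
        rw [iter_extend_eq _ hn]
        exact Summit.QuantumFields.YangMills.BalabanUVNodes.N09CentralWindowAtRecord.centralWindow_extend hn c α _ _
      rw [chainWindow_succ, chainWindow_succ, hwin, hE, chainWindow_extend α (n := n) (by omega), chainMap_extend _ (by omega)]

end Blind

section JointWindow

variable {N : ℕ} [NeZero N]

/-- The iterated central window is JOINTLY measurable in the environment and the pivot variable. [cite: Balaban1987RG1, (2.9) p.266 (bookkeeping)] -/
theorem measurableSet_chainWindow₂ (α : ℝ) :
    ∀ (n : ℕ) (c : PBond P n), MeasurableSet {p : GaugeField P 0 (SU N) × SU N | p.2 ∈ chainWindow α n p.1 c}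
  | 0, _ => by
      simp only [chainWindow, Set.mem_univ, Set.setOf_true]
      exact MeasurableSet.univ
  | n + 1, c => by
      have hiter := T4Continuum.measurable_iter (fun i => BlockAveraging.blockAvg (P := P) (j := i) (expMeanLogSU (n := Fin N)))
        (fun j => by rw [BlockAveraging.blockAvg_avg]; exact measurable_avgFun _ measurable_expMeanLogSU_E) n
      have hset : {p : GaugeField P 0 (SU N) × SU N | p.2 ∈ chainWindow α (n + 1) p.1 c} =
          {p | p.2 ∈ chainWindow α n p.1 (centralBond c)} ∩
            (fun p : GaugeField P 0 (SU N) × SU N =>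
                (Averaging.iter (fun i => BlockAveraging.blockAvg (P := P) (j := i) (expMeanLogSU (n := Fin N))) n p.1,
                  chainMap (expMeanLogSU (n := Fin N)) n p.1 (centralBond c) p.2)) ⁻¹'
              {q : GaugeField P n (SU N) × SU N | ∀ i : Idx P, dist1 (fibreFamily q.1 c (pre q.1 c * q.2 * post q.1 c) i) ≤ α} := by
        ext p
        simp only [chainWindow_succ, Set.mem_inter_iff, Set.mem_preimage, Set.mem_setOf_eq, centralWindowSet]
      rw [hset]
      exact (measurableSet_chainWindow₂ α n (centralBond c)).inter
        (((hiter.comp measurable_fst).prodMk (measurable_chainMap₂ n (centralBond c)))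
          (Summit.QuantumFields.YangMills.BalabanUVNodes.N09CentralWindowAtRecord.measurableSet_centralWindow c α))

end JointWindow

section ChainCharts

variable {N : ℕ} [NeZero N]

/-- ★★ **PER-BOND INVERSION DATA OF THE CHAIN** (Lusin–Souslin inverse + inverse law). [cite: Kechris1995, Thm 15.1 and Cor 15.2] -/
theorem exists_chainCharts_lb {α : ℝ} (hα0 : 0 ≤ α) (hα24 : α ≤ 1 / 24) (hα64 : 64 * α ≤ deltaSU (Fin N))
    (hαL : 157 * α < ((P.L : ℝ) ^ (P.d - 1))⁻¹)
    (hgap : ∀ j (c : PBond P (j + 1)), (offCard c : ℝ) / (Fintype.card (Idx P) : ℝ) + 150 * α < 1)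
    {j₀ : ℝ≥0} (hvol : j₀ = 0 ∨ ChainVol P N α j₀) {n : ℕ} (hn : n ≤ P.m + P.K) :
    ∃ (T : PBond P n → GaugeField P 0 (SU N) → Set (SU N)) (ϑ : PBond P n → GaugeField P 0 (SU N) → SU N → SU N)
      (jd : PBond P n → GaugeField P 0 (SU N) → SU N → ℝ≥0),
      (∀ c, MeasurableSet {p : GaugeField P 0 (SU N) × SU N | p.2 ∈ T c p.1}) ∧
      (∀ c, Measurable fun p : GaugeField P 0 (SU N) × SU N => ϑ c p.1 p.2) ∧
      (∀ c, Measurable fun p : GaugeField P 0 (SU N) × SU N => jd c p.1 p.2) ∧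
      (∀ c U, ∀ v ∈ T c U, chainMap (expMeanLogSU (n := Fin N)) n U c (ϑ c U v) = v) ∧
      (∀ c U, (HaarData.haar : Measure (SU N)).restrict (chainWindow α n U c) =
        (((HaarData.haar : Measure (SU N)).restrict (T c U)).withDensity fun v => (jd c U v : ℝ≥0∞)).map (ϑ c U)) ∧
      (∀ c U, T c U = chainMap (expMeanLogSU (n := Fin N)) n U c '' chainWindow α n U c) ∧
      (∀ c U, ∀ g ∈ chainWindow α n U c, ϑ c U (chainMap (expMeanLogSU (n := Fin N)) n U c g) = g) ∧
      (∀ c U, ∀ v ∈ T c U, ϑ c U v ∈ chainWindow α n U c) ∧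
      (∀ c U, IsClosed (T c U)) ∧
      (∀ c U, ContinuousOn (ϑ c U) (T c U)) ∧
      (∀ c U, ContinuousOn (jd c U) (T c U)) ∧
      (∀ c U, ∀ v ∈ T c U, jd c U v ≠ 0) ∧
      (∀ c U, ∀ v ∈ T c U, j₀ ^ n * jd c U v ≤ 1) := by
  have hαδ : α < deltaSU (Fin N) := by nlinarith [deltaSU_pos (n := Fin N)]
  have hinj : ∀ (c : PBond P n) (U : GaugeField P 0 (SU N)),
      InjOn (fun g => chainMap (expMeanLogSU (n := Fin N)) n U c g) (chainWindow α n U c) :=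
    fun c U => chainMap_injOn hα0 hα24 hαδ hgap hn U c
  have key : ∀ c : PBond P n, ∃ θ : GaugeField P 0 (SU N) × SU N → SU N, Measurable θ ∧
      (∀ U, ∀ g ∈ chainWindow α n U c, θ (U, chainMap (expMeanLogSU (n := Fin N)) n U c g) = g) ∧
      (∀ U, ∀ v ∈ (fun g => chainMap (expMeanLogSU (n := Fin N)) n U c g) '' chainWindow α n U c,
        chainMap (expMeanLogSU (n := Fin N)) n U c (θ (U, v)) = v ∧ θ (U, v) ∈ chainWindow α n U c) := fun c =>
    (Literature.MeasureTheory.Function.exists_measurable_fibrewiseInverse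
      (Ψ := fun p : GaugeField P 0 (SU N) × SU N => chainMap (expMeanLogSU (n := Fin N)) n p.1 c p.2)
      (Ω := fun U => chainWindow α n U c) (measurable_chainMap₂ n c) (measurableSet_chainWindow₂ α n c) (hinj c)).2
  have keyT : ∀ c : PBond P n, MeasurableSet {p : GaugeField P 0 (SU N) × SU N |
      p.2 ∈ (fun g => chainMap (expMeanLogSU (n := Fin N)) n p.1 c g) '' chainWindow α n p.1 c} := fun c =>
    (Literature.MeasureTheory.Function.exists_measurable_fibrewiseInverse
      (Ψ := fun p : GaugeField P 0 (SU N) × SU N => chainMap (expMeanLogSU (n := Fin N)) n p.1 c p.2)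
      (Ω := fun U => chainWindow α n U c) (measurable_chainMap₂ n c) (measurableSet_chainWindow₂ α n c) (hinj c)).1
  choose θ hθm hleft hright using key
  have hJ := fun c => chain_forwardLaw_lb (N := N) (P := P) hα0 hα24 hα64 hαL hgap hvol n hn c
  choose J hJm hJ0 hJlaw hJc hJlb using hJ
  have hθc : ∀ (c : PBond P n) (U : GaugeField P 0 (SU N)),
      ContinuousOn (fun v => θ c (U, v)) ((fun g => chainMap (expMeanLogSU (n := Fin N)) n U c g) '' chainWindow α n U c) := fun c U =>
    continuousOn_leftInverse_image (isClosed_chainWindow hαδ hn U c) (continuousOn_chainMap hαδ hn U c) (hinj c U)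
      (θ := fun v => θ c (U, v)) (fun v hv => (hright c U v hv).2) (fun v hv => (hright c U v hv).1)
  refine ⟨fun c U => (fun g => chainMap (expMeanLogSU (n := Fin N)) n U c g) '' chainWindow α n U c, fun c U v => θ c (U, v),
    fun c U v => (J c U (θ c (U, v)))⁻¹, keyT, fun c => hθm c, fun c => ?_, fun c U v hv => (hright c U v hv).1, fun c U => ?_,
    fun c U => rfl, fun c U g hg => hleft c U g hg, fun c U v hv => (hright c U v hv).2,
    fun c U => isClosed_image_chainWindow hαδ hn U c, hθc, fun c U => ?_, fun c U v hv => inv_ne_zero (hJ0 c U _ (hright c U v hv).2),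
    fun c U v hv => ?lb⟩
  case lb =>
    have hx : J c U (θ c (U, v)) ≠ 0 := hJ0 c U _ (hright c U v hv).2
    calc j₀ ^ n * (J c U (θ c (U, v)))⁻¹ ≤ J c U (θ c (U, v)) * (J c U (θ c (U, v)))⁻¹ := mul_le_mul' (hJlb c U _) le_rfl
      _ = 1 := mul_inv_cancel₀ hx
  · exact ((hJm c).comp (measurable_fst.prodMk (hθm c))).inv
  rotate_left
  · exact ((hJc c U).comp (hθc c U) fun v hv => (hright c U v hv).2).inv₀ fun v hv => hJ0 c U _ (hright c U v hv).2
  · -- the inverse law from the forward law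
    have hΩU : MeasurableSet (chainWindow α n U c) := measurableSet_chainWindow α n U c
    have hθU : Measurable fun v => θ c (U, v) := (hθm c).comp (measurable_const.prodMk measurable_id)
    have hjacU : Measurable fun g => (J c U g : ℝ≥0∞) :=
      measurable_coe_nnreal_ennreal.comp ((hJm c).comp (measurable_const.prodMk measurable_id))
    have h := T4TriangularFibredChart.restrict_eq_map_withDensity_of_leftInvOn (ν := (HaarData.haar : Measure (SU N))) hΩU
      (measurable_chainMap n U c) hθU (hleft c U) hjacU (fun g hg => by exact_mod_cast hJ0 c U g hg) (fun g _ => ENNReal.coe_ne_top) (hJlaw c U)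
    rw [h]
    congr 1
    refine withDensity_congr_ae ?_
    filter_upwards [ae_restrict_mem (keyT c |> fun h => (measurable_const.prodMk measurable_id) h)] with v hv
    rw [ENNReal.coe_inv (hJ0 c U _ ((hright c U v hv).2))]

/-- ★★ Per-bond inversion data of the chain (unconditional form). [cite: Balaban1987RG1, (0.4) p.253 and (2.10) p.267] -/
theorem exists_chainCharts {α : ℝ} (hα0 : 0 ≤ α) (hα24 : α ≤ 1 / 24) (hα64 : 64 * α ≤ deltaSU (Fin N))
    (hαL : 157 * α < ((P.L : ℝ) ^ (P.d - 1))⁻¹)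
    (hgap : ∀ j (c : PBond P (j + 1)), (offCard c : ℝ) / (Fintype.card (Idx P) : ℝ) + 150 * α < 1) {n : ℕ} (hn : n ≤ P.m + P.K) :
    ∃ (T : PBond P n → GaugeField P 0 (SU N) → Set (SU N)) (ϑ : PBond P n → GaugeField P 0 (SU N) → SU N → SU N)
      (jd : PBond P n → GaugeField P 0 (SU N) → SU N → ℝ≥0),
      (∀ c, MeasurableSet {p : GaugeField P 0 (SU N) × SU N | p.2 ∈ T c p.1}) ∧
      (∀ c, Measurable fun p : GaugeField P 0 (SU N) × SU N => ϑ c p.1 p.2) ∧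
      (∀ c, Measurable fun p : GaugeField P 0 (SU N) × SU N => jd c p.1 p.2) ∧
      (∀ c U, ∀ v ∈ T c U, chainMap (expMeanLogSU (n := Fin N)) n U c (ϑ c U v) = v) ∧
      (∀ c U, (HaarData.haar : Measure (SU N)).restrict (chainWindow α n U c) =
        (((HaarData.haar : Measure (SU N)).restrict (T c U)).withDensity fun v => (jd c U v : ℝ≥0∞)).map (ϑ c U)) ∧
      (∀ c U, T c U = chainMap (expMeanLogSU (n := Fin N)) n U c '' chainWindow α n U c) ∧
      (∀ c U, ∀ g ∈ chainWindow α n U c, ϑ c U (chainMap (expMeanLogSU (n := Fin N)) n U c g) = g) ∧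
      (∀ c U, ∀ v ∈ T c U, ϑ c U v ∈ chainWindow α n U c) ∧
      (∀ c U, IsClosed (T c U)) ∧
      (∀ c U, ContinuousOn (ϑ c U) (T c U)) ∧
      (∀ c U, ContinuousOn (jd c U) (T c U)) ∧
      (∀ c U, ∀ v ∈ T c U, jd c U v ≠ 0) := by
  obtain ⟨T, ϑ, jd, h1, h2, h3, h4, h5, h6, h7, h8, h9, h10, h11, h12, -⟩ :=
    exists_chainCharts_lb (N := N) (P := P) hα0 hα24 hα64 hαL hgap (j₀ := 0) (Or.inl rfl) hn
  exact ⟨T, ϑ, jd, h1, h2, h3, h4, h5, h6, h7, h8, h9, h10, h11, h12⟩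

/-- ★★★ **CHART-ALG III** — the fibred chart of the iterated averaging. [cite: Balaban1987RG1, (0.4) p.253, (2.4) p.266 and (2.10) p.267] -/
theorem exists_fibredChart_iter {α : ℝ} (hα0 : 0 ≤ α) (hα24 : α ≤ 1 / 24) (hα64 : 64 * α ≤ deltaSU (Fin N))
    (hαL : 157 * α < ((P.L : ℝ) ^ (P.d - 1))⁻¹)
    (hgap : ∀ j (c : PBond P (j + 1)), (offCard c : ℝ) / (Fintype.card (Idx P) : ℝ) + 150 * α < 1) {n : ℕ} (hn : n ≤ P.m + P.K) :
    ∃ (Φ : GaugeField P n (SU N) × GaugeField P 0 (SU N) → GaugeField P 0 (SU N)) (Jac : GaugeField P n (SU N) × GaugeField P 0 (SU N) → ℝ≥0),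
      Measurable Φ ∧ Measurable Jac ∧
      (∀ V z, Jac (V, z) ≠ 0 → Averaging.iter (fun i => BlockAveraging.blockAvg (P := P) (j := i) (expMeanLogSU (n := Fin N))) n (Φ (V, z)) = V) ∧
      ∀ U₀ : Set (GaugeField P n (SU N)), MeasurableSet U₀ →
        (fieldMeasure P 0 (SU N)).restrict
            (Averaging.iter (fun i => BlockAveraging.blockAvg (P := P) (j := i) (expMeanLogSU (n := Fin N))) n ⁻¹' U₀ ∩
              {U | ∀ c, U (iterCentralBond n c) ∈ chainWindow α n U c}) =
          ((((fieldMeasure P n (SU N)).restrict U₀).prod (fieldMeasure P 0 (SU N))).withDensity fun p => (Jac p : ℝ≥0∞)).map Φ := by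
  obtain ⟨T, ϑ, jd, hTm, hθm, hjm, hright, hlaw, -, -, -, -, -, -, -⟩ := exists_chainCharts (N := N) (P := P) hα0 hα24 hα64 hαL hgap hn
  have hA := isLocal_iter_blockAvg (P := P) (expMeanLogSU (n := Fin N)) hn
  have hβ := iterCentralBond_injective (P := P) (n := n) hn
  have hAm : Measurable (Averaging.iter (fun i => BlockAveraging.blockAvg (P := P) (j := i) (expMeanLogSU (n := Fin N))) n) :=
    T4Continuum.measurable_iter _ (fun j => by rw [BlockAveraging.blockAvg_avg]; exact measurable_avgFun _ measurable_expMeanLogSU_E) n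
  have hright' : ∀ c U, ∀ v ∈ T c U,
      Averaging.iter (fun i => BlockAveraging.blockAvg (P := P) (j := i) (expMeanLogSU (n := Fin N))) n (update U (iterCentralBond n c) (ϑ c U v)) c = v :=
    fun c U v hv => hright c U v hv
  refine ⟨fun p => extend (iterCentralBond n) (fun c => ϑ c p.2 (p.1 c)) p.2,
    fun p => {p : GaugeField P n (SU N) × GaugeField P 0 (SU N) | ∀ c, p.1 c ∈ T c p.2}.indicator (fun p => ∏ c, jd c p.2 (p.1 c)) p,
    T4TriangularFibredChart.measurable_triChart ϑ hβ hθm, T4TriangularFibredChart.measurable_triJacobian T jd hTm hjm,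
    fun V z hJ => T4TriangularFibredChart.apply_triChart_eq_of_jacobian_ne_zero T ϑ jd hA hβ hright' hJ, fun U₀ hU₀ => ?_⟩
  exact T4TriangularFibredChart.pi_restrict_preimage_inter_eq_map_prod_withDensity (fun c U => chainWindow α n U c) T ϑ jd
    (HaarData.haar : Measure (SU N)) (HaarData.haar : Measure (SU N)) hA hβ hAm (measurableSet_chainWindow₂ α n) hTm hθm hjm
    (fun c U g => chainWindow_extend α hn g U c) hright' hlaw hU₀

end ChainCharts

/-! ## §0h CHART-REG (fibre direction) II: the fibred chart of `Ū⁽ⁿ⁾` with its closed image windows exposed (fibre-direction continuity). -/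

section ChainChartsReg

variable {N : ℕ} [NeZero N]

open Filter Topology

set_option maxHeartbeats 800000 in
/-- ★★★ **CHART-ALG III + CHART-REG** — the same chart with its image windows. [cite: Balaban1987RG1, (0.4) p.253, (2.4) p.266 and (2.10) p.267] -/
theorem exists_fibredChart_iter_reg {α : ℝ} (hα0 : 0 ≤ α) (hα24 : α ≤ 1 / 24) (hα64 : 64 * α ≤ deltaSU (Fin N))
    (hαL : 157 * α < ((P.L : ℝ) ^ (P.d - 1))⁻¹)
    (hgap : ∀ j (c : PBond P (j + 1)), (offCard c : ℝ) / (Fintype.card (Idx P) : ℝ) + 150 * α < 1)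
    {j₀ : ℝ≥0} (hvol : j₀ = 0 ∨ ChainVol P N α j₀) {n : ℕ} (hn : n ≤ P.m + P.K) :
    ∃ (Φ : GaugeField P n (SU N) × GaugeField P 0 (SU N) → GaugeField P 0 (SU N)) (Jac : GaugeField P n (SU N) × GaugeField P 0 (SU N) → ℝ≥0)
      (T : PBond P n → GaugeField P 0 (SU N) → Set (SU N)),
      Measurable Φ ∧ Measurable Jac ∧
      (∀ V z, Jac (V, z) ≠ 0 → Averaging.iter (fun i => BlockAveraging.blockAvg (P := P) (j := i) (expMeanLogSU (n := Fin N))) n (Φ (V, z)) = V) ∧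
      (∀ U₀ : Set (GaugeField P n (SU N)), MeasurableSet U₀ →
        (fieldMeasure P 0 (SU N)).restrict
            (Averaging.iter (fun i => BlockAveraging.blockAvg (P := P) (j := i) (expMeanLogSU (n := Fin N))) n ⁻¹' U₀ ∩
              {U | ∀ c, U (iterCentralBond n c) ∈ chainWindow α n U c}) =
          ((((fieldMeasure P n (SU N)).restrict U₀).prod (fieldMeasure P 0 (SU N))).withDensity fun p => (Jac p : ℝ≥0∞)).map Φ) ∧
      (∀ c z, IsClosed (T c z)) ∧
      (∀ V z, Jac (V, z) ≠ 0 ↔ ∀ c, V c ∈ T c z) ∧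
      (∀ V₀ z, (∀ c, V₀ c ∈ interior (T c z)) → ContinuousAt (fun V => Φ (V, z)) V₀ ∧ ContinuousAt (fun V => Jac (V, z)) V₀) ∧
      (∀ V₀ z, (∃ c, V₀ c ∉ closure (T c z)) → ∀ᶠ V in 𝓝 V₀, Jac (V, z) = 0) ∧
      (∀ c z, T c z = chainMap (expMeanLogSU (n := Fin N)) n z c '' chainWindow α n z c) ∧
      (∀ V z, (∀ c, V c ∈ T c z) → (∀ b, (∀ c, iterCentralBond n c ≠ b) → Φ (V, z) b = z b) ∧
        ∀ c, Φ (V, z) (iterCentralBond n c) ∈ chainWindow α n (Φ (V, z)) c) ∧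
      (∀ p, j₀ ^ (n * Fintype.card (PBond P n)) * Jac p ≤ 1) ∧
      (∀ V z (g : PBond P n → SU N), (∀ c, g c ∈ chainWindow α n z c) →
        (∀ c, V c = Averaging.iter (fun i => BlockAveraging.blockAvg (P := P) (j := i) (expMeanLogSU (n := Fin N))) n
          (extend (iterCentralBond n) g z) c) →
        Jac (V, z) ≠ 0 ∧ Φ (V, z) = extend (iterCentralBond n) g z) := by
  obtain ⟨T, ϑ, jd, hTm, hθm, hjm, hright, hlaw, hTeq, hleft, hmemW, hTc, hθc, hjc, hj0, hjlb⟩ :=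
    exists_chainCharts_lb (N := N) (P := P) hα0 hα24 hα64 hαL hgap hvol hn
  have hA := isLocal_iter_blockAvg (P := P) (expMeanLogSU (n := Fin N)) hn
  have hβ := iterCentralBond_injective (P := P) (n := n) hn
  have hAm : Measurable (Averaging.iter (fun i => BlockAveraging.blockAvg (P := P) (j := i) (expMeanLogSU (n := Fin N))) n) :=
    T4Continuum.measurable_iter _ (fun j => by rw [BlockAveraging.blockAvg_avg]; exact measurable_avgFun _ measurable_expMeanLogSU_E) n
  have hright' : ∀ c U, ∀ v ∈ T c U,
      Averaging.iter (fun i => BlockAveraging.blockAvg (P := P) (j := i) (expMeanLogSU (n := Fin N))) n (update U (iterCentralBond n c) (ϑ c U v)) c = v :=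
    fun c U v hv => hright c U v hv
  refine ⟨fun p => extend (iterCentralBond n) (fun c => ϑ c p.2 (p.1 c)) p.2,
    fun p => {p : GaugeField P n (SU N) × GaugeField P 0 (SU N) | ∀ c, p.1 c ∈ T c p.2}.indicator (fun p => ∏ c, jd c p.2 (p.1 c)) p, T,
    T4TriangularFibredChart.measurable_triChart ϑ hβ hθm, T4TriangularFibredChart.measurable_triJacobian T jd hTm hjm,
    fun V z hJ => T4TriangularFibredChart.apply_triChart_eq_of_jacobian_ne_zero T ϑ jd hA hβ hright' hJ, fun U₀ hU₀ => ?_, hTc,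
    fun V z => ?_, fun V₀ z hint => ?_, fun V₀ z hout => ?_, hTeq, fun V z hV => ?charted, fun p => ?bdd, fun V z g hg hVg => ?recog⟩
  case charted =>
    refine ⟨fun b hb => extend_apply' _ _ _ fun ⟨c, hc⟩ => hb c hc, fun c => ?_⟩
    dsimp only
    rw [hβ.extend_apply, chainWindow_extend α hn]
    exact hmemW c z _ (hV c)
  case recog =>
    have hVc : ∀ c, V c = chainMap (expMeanLogSU (n := Fin N)) n z c (g c) := fun c => by
      have hu : update (extend (iterCentralBond n) g z) (iterCentralBond n c) (g c) = extend (iterCentralBond n) g z := by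
        rw [Function.update_eq_self_iff]
        exact (hβ.extend_apply g z c).symm
      rw [hVg c, ← chainMap_extend (expMeanLogSU (n := Fin N)) hn g z c]
      simp only [chainMap, hu]
    have hlive : ∀ c, V c ∈ T c z := fun c => by
      rw [hTeq, hVc c]
      exact mem_image_of_mem _ (hg c)
    refine ⟨?_, ?_⟩
    · have hVs : (V, z) ∈ {p : GaugeField P n (SU N) × GaugeField P 0 (SU N) | ∀ c, p.1 c ∈ T c p.2} := hlive
      show {p : GaugeField P n (SU N) × GaugeField P 0 (SU N) | ∀ c, p.1 c ∈ T c p.2}.indicator (fun p => ∏ c, jd c p.2 (p.1 c)) (V, z) ≠ 0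
      rw [Set.indicator_of_mem hVs]
      exact Finset.prod_ne_zero_iff.2 fun c _ => hj0 c z _ (hlive c)
    · have hfun : (fun c => ϑ c z (V c)) = g := funext fun c => by rw [hVc c]; exact hleft c z (g c) (hg c)
      show extend (iterCentralBond n) (fun c => ϑ c z (V c)) z = extend (iterCentralBond n) g z
      rw [hfun]
  case bdd =>
    dsimp only
    by_cases hp : p ∈ {p : GaugeField P n (SU N) × GaugeField P 0 (SU N) | ∀ c, p.1 c ∈ T c p.2}
    · rw [Set.indicator_of_mem hp]
      calc j₀ ^ (n * Fintype.card (PBond P n)) * ∏ c, jd c p.2 (p.1 c) = ∏ c, j₀ ^ n * jd c p.2 (p.1 c) := by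
            rw [Finset.prod_mul_distrib, Finset.prod_const, Finset.card_univ, ← pow_mul]
        _ ≤ ∏ _c : PBond P n, (1 : ℝ≥0) := Finset.prod_le_prod' fun c _ => hjlb c p.2 _ (hp c)
        _ = 1 := Finset.prod_const_one
    · rw [Set.indicator_of_notMem hp, mul_zero]
      exact zero_le_one
  · exact T4TriangularFibredChart.pi_restrict_preimage_inter_eq_map_prod_withDensity (fun c U => chainWindow α n U c) T ϑ jd
      (HaarData.haar : Measure (SU N)) (HaarData.haar : Measure (SU N)) hA hβ hAm (measurableSet_chainWindow₂ α n) hTm hθm hjm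
      (fun c U g => chainWindow_extend α hn g U c) hright' hlaw hU₀
  · -- `Jac ≠ 0 ↔ all coordinates in the windows`
    dsimp only
    constructor
    · intro h
      by_contra hV
      have hVs : (V, z) ∉ {p : GaugeField P n (SU N) × GaugeField P 0 (SU N) | ∀ c, p.1 c ∈ T c p.2} := hV
      exact h (Set.indicator_of_notMem hVs _)
    · intro hV
      have hVs : (V, z) ∈ {p : GaugeField P n (SU N) × GaugeField P 0 (SU N) | ∀ c, p.1 c ∈ T c p.2} := hV
      rw [Set.indicator_of_mem hVs]
      exact Finset.prod_ne_zero_iff.2 fun c _ => hj0 c z _ (hV c)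
  · -- continuity at an all-interior coarse point
    have hθat : ∀ c, ContinuousAt (fun V : GaugeField P n (SU N) => ϑ c z (V c)) V₀ := fun c =>
      ContinuousAt.comp (f := fun V : GaugeField P n (SU N) => V c) (x := V₀)
        ((hθc c z).continuousAt (mem_interior_iff_mem_nhds.1 (hint c))) (continuous_apply c).continuousAt
    refine ⟨continuousAt_pi.2 fun b => ?_, ?_⟩
    · by_cases hb : ∃ c, iterCentralBond n c = b
      · obtain ⟨c, rfl⟩ := hb
        have h1 : (fun V : GaugeField P n (SU N) => extend (iterCentralBond n) (fun c => ϑ c z (V c)) z (iterCentralBond n c)) =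
            fun V => ϑ c z (V c) := funext fun V => hβ.extend_apply _ _ _
        rw [h1]
        exact hθat c
      · have h1 : (fun V : GaugeField P n (SU N) => extend (iterCentralBond n) (fun c => ϑ c z (V c)) z b) = fun _ => z b :=
          funext fun V => extend_apply' _ _ _ hb
        rw [h1]
        exact continuousAt_const
    · have hev : ∀ᶠ V in 𝓝 V₀, ∀ c, V c ∈ T c z :=
        Filter.eventually_all.2 fun c => (continuous_apply c).continuousAt.preimage_mem_nhds (mem_interior_iff_mem_nhds.1 (hint c))
      have hprod : ContinuousOn (fun V : GaugeField P n (SU N) => ∏ c, jd c z (V c)) {V | ∀ c, V c ∈ T c z} :=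
        continuousOn_finsetProd _ fun c _ => (hjc c z).comp (continuous_apply c).continuousOn fun V hV => hV c
      have hat : ContinuousAt (fun V : GaugeField P n (SU N) => ∏ c, jd c z (V c)) V₀ :=
        hprod.continuousAt (Filter.eventually_all.2 fun c =>
          (continuous_apply c).continuousAt.preimage_mem_nhds (mem_interior_iff_mem_nhds.1 (hint c)))
      refine hat.congr ?_
      filter_upwards [hev] with V hV
      have hVs : (V, z) ∈ {p : GaugeField P n (SU N) × GaugeField P 0 (SU N) | ∀ c, p.1 c ∈ T c p.2} := hV
      exact (Set.indicator_of_mem hVs (fun p : GaugeField P n (SU N) × GaugeField P 0 (SU N) => ∏ c, jd c p.2 (p.1 c))).symm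
  · -- death near a coarse point with a coordinate outside the closure of its window
    obtain ⟨c, hc⟩ := hout
    have hev : ∀ᶠ V in 𝓝 V₀, V c ∉ closure (T c z) :=
      (continuous_apply c).continuousAt.preimage_mem_nhds (isClosed_closure.isOpen_compl.mem_nhds hc)
    filter_upwards [hev] with V hV
    have hVs : (V, z) ∉ {p : GaugeField P n (SU N) × GaugeField P 0 (SU N) | ∀ c, p.1 c ∈ T c p.2} :=
      fun h => hV (subset_closure ((show ∀ c, V c ∈ T c z from h) c))
    exact Set.indicator_of_notMem hVs _

end ChainChartsReg

/-! ## §0f CHART-ALG IV: the `descendTo` (level-shifted) fibred chart on any measurable fine set inside the charted set. -/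

section Descend

open Literature.MathematicalPhysics.QuantumFieldTheory.Balaban1983to89.T3ContinuumYM3Torus
open Literature.MathematicalPhysics.QuantumFieldTheory.Balaban1983to89.T3LevelShift
open Literature.MathematicalPhysics.QuantumFieldTheory.Balaban1983to89.T3TiltDescent
open Filter Topology

variable {N : ℕ} [NeZero N]

/-- Transport of a fibred-chart law along a measure-preserving relabelling of the coarse variable with a left inverse, … -/
theorem fibredLaw_transport {X Y Y' : Type*} [MeasurableSpace X] [MeasurableSpace Y] [MeasurableSpace Y']
    (μX : Measure X) (μY : Measure Y) (μY' : Measure Y') [SFinite μX] [SFinite μY] [SFinite μY']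
    {A : X → Y} {e : Y → Y'} {e' : Y' → Y} (he : Measurable e) (he' : Measurable e')
    (he'e : ∀ y, e' (e y) = y) (hpres : μY.map e = μY')
    {S : Set X} {Φ : Y × X → X} {Jac : Y × X → ℝ≥0∞} (hΦ : Measurable Φ) (hJac : Measurable Jac)
    (hlaw : ∀ U₀ : Set Y, MeasurableSet U₀ → μX.restrict (A ⁻¹' U₀ ∩ S) = ((((μY.restrict U₀).prod μX).withDensity Jac).map Φ))
    {S' : Set X} (hS' : MeasurableSet S') (hsub : S' ⊆ S) {O : Set Y'} (hO : MeasurableSet O) :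
    μX.restrict ((e ∘ A) ⁻¹' O ∩ S') =
      ((((μY'.restrict O).prod μX).withDensity fun p => S'.indicator 1 (Φ (e' p.1, p.2)) * Jac (e' p.1, p.2)).map fun p => Φ (e' p.1, p.2)) := by
  have hU₀ : MeasurableSet (e ⁻¹' O) := he hO
  have h1 : μX.restrict ((e ∘ A) ⁻¹' O ∩ S') = (μX.restrict (A ⁻¹' (e ⁻¹' O) ∩ S)).restrict S' := by
    rw [Measure.restrict_restrict hS', Set.preimage_comp]
    congr 1
    ext x; constructor
    · rintro ⟨hx, hS⟩; exact ⟨hS, hx, hsub hS⟩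
    · rintro ⟨hS, hx, -⟩; exact ⟨hx, hS⟩
  rw [h1, hlaw _ hU₀, Measure.restrict_map hΦ hS']
  have h2 : μY.restrict (e ⁻¹' O) = (μY'.restrict O).map e' := by
    rw [← hpres, Measure.restrict_map he hO, Measure.map_map he' he]
    have : e' ∘ e = id := funext he'e
    rw [this, Measure.map_id]
  have hθ : Measurable fun p : Y' × X => ((e' p.1, p.2) : Y × X) := (he'.comp measurable_fst).prodMk measurable_snd
  have h3 : ((μY'.restrict O).map e').prod μX = ((μY'.restrict O).prod μX).map fun p : Y' × X => ((e' p.1, p.2) : Y × X) := by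
    rw [show (fun p : Y' × X => ((e' p.1, p.2) : Y × X)) = Prod.map e' id from rfl, ← Measure.map_prod_map _ _ he' measurable_id,
      Measure.map_id]
  have h4 : (((μY'.restrict O).prod μX).map fun p : Y' × X => ((e' p.1, p.2) : Y × X)).withDensity Jac =
      (((μY'.restrict O).prod μX).withDensity fun p => Jac (e' p.1, p.2)).map fun p : Y' × X => ((e' p.1, p.2) : Y × X) :=
    withDensity_map_eq_map_withDensity_comp _ hθ hJac
  have hind : Measurable fun p : Y' × X => S'.indicator (1 : X → ℝ≥0∞) (Φ (e' p.1, p.2)) :=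
    (measurable_one.indicator hS').comp (hΦ.comp hθ)
  have hind_eq : ((fun p : Y' × X => ((e' p.1, p.2) : Y × X)) ⁻¹' (Φ ⁻¹' S')).indicator (1 : Y' × X → ℝ≥0∞) =
      fun p : Y' × X => S'.indicator (1 : X → ℝ≥0∞) (Φ (e' p.1, p.2)) := by
    funext p
    by_cases hp : Φ (e' p.1, p.2) ∈ S'
    · rw [Set.indicator_of_mem (show p ∈ (fun p : Y' × X => ((e' p.1, p.2) : Y × X)) ⁻¹' (Φ ⁻¹' S') from hp), Set.indicator_of_mem hp]
      rfl
    · rw [Set.indicator_of_notMem (show p ∉ (fun p : Y' × X => ((e' p.1, p.2) : Y × X)) ⁻¹' (Φ ⁻¹' S') from hp),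
        Set.indicator_of_notMem hp]
  rw [h2, h3, h4, Measure.restrict_map hθ (hΦ hS'), Measure.map_map hΦ hθ, restrict_withDensity (hθ (hΦ hS')),
    ← withDensity_indicator_one (hθ (hΦ hS')), hind_eq,
    ← withDensity_mul _ hind (show Measurable fun p : Y' × X => Jac (e' p.1, p.2) from hJac.comp hθ)]
  rfl

/-- ★★★ **CHART-ALG IV**. [cite: Balaban1987RG1, (0.4)/(0.11) p.253, (2.4) p.266 and (2.10) p.267] -/
theorem exists_chartData_descendTo (F : T3Family) {J K : ℕ} (hJK : J ≤ K) {α : ℝ} (hα0 : 0 ≤ α) (hα24 : α ≤ 1 / 24)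
    (hα64 : 64 * α ≤ deltaSU (Fin N)) (hαL : 157 * α < (((F.P K).L : ℝ) ^ ((F.P K).d - 1))⁻¹)
    (hgap : ∀ j (c : PBond (F.P K) (j + 1)), (offCard c : ℝ) / (Fintype.card (Idx (F.P K)) : ℝ) + 150 * α < 1)
    {Sfine : Set (GaugeField (F.P K) 0 (SU N))} (hSm : MeasurableSet Sfine)
    (hSsub : Sfine ⊆ {U | ∀ c, U (iterCentralBond (K - J) c) ∈ chainWindow α (K - J) U c}) :
    ∃ (Φ : GaugeField (F.P J) 0 (SU N) × GaugeField (F.P K) 0 (SU N) → GaugeField (F.P K) 0 (SU N))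
      (jac : GaugeField (F.P J) 0 (SU N) × GaugeField (F.P K) 0 (SU N) → ℝ≥0∞),
      Measurable Φ ∧ Measurable jac ∧
      (∀ V z, jac (V, z) ≠ 0 → descendTo F (expMeanLogSU (n := Fin N)) J K hJK (Φ (V, z)) = V) ∧
      (∀ V z, jac (V, z) ≠ 0 → Φ (V, z) ∈ Sfine) ∧
      ∀ O : Set (GaugeField (F.P J) 0 (SU N)), MeasurableSet O →
        (fieldMeasure (F.P K) 0 (SU N)).restrict (descendTo F (expMeanLogSU (n := Fin N)) J K hJK ⁻¹' O ∩ Sfine) =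
          ((((fieldMeasure (F.P J) 0 (SU N)).restrict O).prod (fieldMeasure (F.P K) 0 (SU N))).withDensity jac).map Φ := by
  haveI : IsProbabilityMeasure (HaarData.haar (G := SU N)) := HaarData.isProb
  have hn : K - J ≤ (F.P K).m + (F.P K).K := by
    show K - J ≤ F.m + K
    omega
  obtain ⟨Φ, Jac, hΦ, hJac, hfib, hlaw⟩ := exists_fibredChart_iter (N := N) (P := F.P K) hα0 hα24 hα64 hαL hgap hn
  have hs := F.sitesPerDir_eq (m := F.m) (K := J) (j := 0) (m' := F.m) (K' := K) (j' := K - J) (by omega)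
  set e : GaugeField (F.P K) (K - J) (SU N) → GaugeField (F.P J) 0 (SU N) := fieldShift hs with he_def
  set e' : GaugeField (F.P J) 0 (SU N) → GaugeField (F.P K) (K - J) (SU N) := fieldShift hs.symm with he'_def
  have he : Measurable e := measurable_fieldShift hs
  have he' : Measurable e' := measurable_fieldShift hs.symm
  have hee' : ∀ y', e (e' y') = y' := fieldShift_symm_fieldShift hs
  have he'e : ∀ y, e' (e y) = y := fieldShift_fieldShift_symm hs
  have hpres : (fieldMeasure (F.P K) (K - J) (SU N)).map e = fieldMeasure (F.P J) 0 (SU N) := (measurePreserving_fieldShift hs).map_eq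
  have hA : Measurable (Averaging.iter (fun i => BlockAveraging.blockAvg (P := F.P K) (j := i) (expMeanLogSU (n := Fin N))) (K - J)) :=
    T4Continuum.measurable_iter _ (fun j => by rw [BlockAveraging.blockAvg_avg]; exact measurable_avgFun _ measurable_expMeanLogSU_E) _
  have hdesc : (descendTo F (expMeanLogSU (n := Fin N)) J K hJK : GaugeField (F.P K) 0 (SU N) → GaugeField (F.P J) 0 (SU N)) =
      e ∘ Averaging.iter (fun i => BlockAveraging.blockAvg (P := F.P K) (j := i) (expMeanLogSU (n := Fin N))) (K - J) := rfl
  have hJac' : Measurable fun p => (Jac p : ℝ≥0∞) := hJac.coe_nnreal_ennreal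
  have hθ : Measurable fun p : GaugeField (F.P J) 0 (SU N) × GaugeField (F.P K) 0 (SU N) =>
      ((e' p.1, p.2) : GaugeField (F.P K) (K - J) (SU N) × GaugeField (F.P K) 0 (SU N)) := (he'.comp measurable_fst).prodMk measurable_snd
  refine ⟨fun p => Φ (e' p.1, p.2), fun p => Sfine.indicator 1 (Φ (e' p.1, p.2)) * (Jac (e' p.1, p.2) : ℝ≥0∞), hΦ.comp hθ,
    ((measurable_one.indicator hSm).comp (hΦ.comp hθ)).mul (hJac'.comp hθ), fun V z hj => ?_, fun V z hj => ?_, fun O hO => ?_⟩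
  · have hJ : Jac (e' V, z) ≠ 0 := fun h => hj (by simp [h])
    rw [hdesc, Function.comp_apply, hfib _ _ hJ, hee']
  · by_contra hS
    exact hj (by simp [Set.indicator_of_notMem hS])
  · rw [hdesc]
    exact fibredLaw_transport (fieldMeasure (F.P K) 0 (SU N)) (fieldMeasure (F.P K) (K - J) (SU N)) (fieldMeasure (F.P J) 0 (SU N))
      he he' he'e hpres hΦ hJac' hlaw hSm hSsub hO

/-- ★★★ **CHART-ALG IV + CHART-REG**. [cite: Balaban1987RG1, (0.4)/(0.11) p.253, (2.4) p.266 and (2.10) p.267] -/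
theorem exists_chartData_descendTo_reg (F : T3Family) {J K : ℕ} (hJK : J ≤ K) {α : ℝ} (hα0 : 0 ≤ α) (hα24 : α ≤ 1 / 24)
    (hα64 : 64 * α ≤ deltaSU (Fin N)) (hαL : 157 * α < (((F.P K).L : ℝ) ^ ((F.P K).d - 1))⁻¹)
    (hgap : ∀ j (c : PBond (F.P K) (j + 1)), (offCard c : ℝ) / (Fintype.card (Idx (F.P K)) : ℝ) + 150 * α < 1)
    {j₀ : ℝ≥0} (hvol : j₀ = 0 ∨ ChainVol (F.P K) N α j₀)
    {Sfine : Set (GaugeField (F.P K) 0 (SU N))} (hSm : MeasurableSet Sfine)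
    (hSsub : Sfine ⊆ {U | ∀ c, U (iterCentralBond (K - J) c) ∈ chainWindow α (K - J) U c}) :
    ∃ (Φ : GaugeField (F.P J) 0 (SU N) × GaugeField (F.P K) 0 (SU N) → GaugeField (F.P K) 0 (SU N))
      (jac : GaugeField (F.P J) 0 (SU N) × GaugeField (F.P K) 0 (SU N) → ℝ≥0)
      (T : PBond (F.P K) (K - J) → GaugeField (F.P K) 0 (SU N) → Set (SU N)) (w : PBond (F.P K) (K - J) → PBond (F.P J) 0),
      Measurable Φ ∧ Measurable jac ∧
      (∀ V z, jac (V, z) ≠ 0 → descendTo F (expMeanLogSU (n := Fin N)) J K hJK (Φ (V, z)) = V) ∧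
      (∀ V z, jac (V, z) ≠ 0 → Φ (V, z) ∈ Sfine) ∧
      (∀ O : Set (GaugeField (F.P J) 0 (SU N)), MeasurableSet O →
        (fieldMeasure (F.P K) 0 (SU N)).restrict (descendTo F (expMeanLogSU (n := Fin N)) J K hJK ⁻¹' O ∩ Sfine) =
          ((((fieldMeasure (F.P J) 0 (SU N)).restrict O).prod (fieldMeasure (F.P K) 0 (SU N))).withDensity fun p => (jac p : ℝ≥0∞)).map Φ) ∧
      (∀ c z, IsClosed (T c z)) ∧
      (∀ V z, jac (V, z) ≠ 0 ↔ (∀ c, V (w c) ∈ T c z) ∧ Φ (V, z) ∈ Sfine) ∧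
      (∀ V₀ z, (∀ c, V₀ (w c) ∈ interior (T c z)) → Φ (V₀, z) ∉ frontier Sfine →
        ContinuousAt (fun V => Φ (V, z)) V₀ ∧ ContinuousAt (fun V => jac (V, z)) V₀) ∧
      (∀ V₀ z, (∃ c, V₀ (w c) ∉ closure (T c z)) → ∀ᶠ V in 𝓝 V₀, jac (V, z) = 0) ∧
      (∀ c z, T c z = chainMap (expMeanLogSU (n := Fin N)) (K - J) z c '' chainWindow α (K - J) z c) ∧
      (∀ V z, (∀ c, V (w c) ∈ T c z) → (∀ b, (∀ c, iterCentralBond (K - J) c ≠ b) → Φ (V, z) b = z b) ∧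
        (∀ c, Φ (V, z) (iterCentralBond (K - J) c) ∈ chainWindow α (K - J) (Φ (V, z)) c) ∧
        descendTo F (expMeanLogSU (n := Fin N)) J K hJK (Φ (V, z)) = V) ∧
      (∀ p, j₀ ^ ((K - J) * Fintype.card (PBond (F.P K) (K - J))) * jac p ≤ 1) ∧
      (∀ V z (g : PBond (F.P K) (K - J) → SU N), (∀ c, g c ∈ chainWindow α (K - J) z c) →
        extend (iterCentralBond (K - J)) g z ∈ Sfine →
        descendTo F (expMeanLogSU (n := Fin N)) J K hJK (extend (iterCentralBond (K - J)) g z) = V →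
        jac (V, z) ≠ 0 ∧ Φ (V, z) = extend (iterCentralBond (K - J)) g z) := by
  haveI : IsProbabilityMeasure (HaarData.haar (G := SU N)) := HaarData.isProb
  have hn : K - J ≤ (F.P K).m + (F.P K).K := by
    show K - J ≤ F.m + K
    omega
  obtain ⟨Φ, Jac, T, hΦ, hJac, hfib, hlaw, hTc, hJT, hreg, hdead, hTeq, hcharted, hbdd, hrec⟩ :=
    exists_fibredChart_iter_reg (N := N) (P := F.P K) hα0 hα24 hα64 hαL hgap hvol hn
  have hs := F.sitesPerDir_eq (m := F.m) (K := J) (j := 0) (m' := F.m) (K' := K) (j' := K - J) (by omega)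
  set e : GaugeField (F.P K) (K - J) (SU N) → GaugeField (F.P J) 0 (SU N) := fieldShift hs with he_def
  set e' : GaugeField (F.P J) 0 (SU N) → GaugeField (F.P K) (K - J) (SU N) := fieldShift hs.symm with he'_def
  have he : Measurable e := measurable_fieldShift hs
  have he' : Measurable e' := measurable_fieldShift hs.symm
  have he'c : Continuous e' := continuous_pi fun c => continuous_apply (bondShift hs.symm c)
  have hee' : ∀ y', e (e' y') = y' := fieldShift_symm_fieldShift hs
  have he'e : ∀ y, e' (e y) = y := fieldShift_fieldShift_symm hs
  have hpres : (fieldMeasure (F.P K) (K - J) (SU N)).map e = fieldMeasure (F.P J) 0 (SU N) := (measurePreserving_fieldShift hs).map_eq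
  have hdesc : (descendTo F (expMeanLogSU (n := Fin N)) J K hJK : GaugeField (F.P K) 0 (SU N) → GaugeField (F.P J) 0 (SU N)) =
      e ∘ Averaging.iter (fun i => BlockAveraging.blockAvg (P := F.P K) (j := i) (expMeanLogSU (n := Fin N))) (K - J) := rfl
  have hJac' : Measurable fun p => (Jac p : ℝ≥0∞) := hJac.coe_nnreal_ennreal
  have hθ : Measurable fun p : GaugeField (F.P J) 0 (SU N) × GaugeField (F.P K) 0 (SU N) =>
      ((e' p.1, p.2) : GaugeField (F.P K) (K - J) (SU N) × GaugeField (F.P K) 0 (SU N)) := (he'.comp measurable_fst).prodMk measurable_snd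
  set S' : Set (GaugeField (F.P J) 0 (SU N) × GaugeField (F.P K) 0 (SU N)) := {p | Φ (e' p.1, p.2) ∈ Sfine} with hS'_def
  have hS'm : MeasurableSet S' := hSm.preimage (hΦ.comp hθ)
  have hdens : (fun p : GaugeField (F.P J) 0 (SU N) × GaugeField (F.P K) 0 (SU N) =>
      Sfine.indicator 1 (Φ (e' p.1, p.2)) * (Jac (e' p.1, p.2) : ℝ≥0∞)) =
      fun p => ((S'.indicator (fun p => Jac (e' p.1, p.2)) p : ℝ≥0) : ℝ≥0∞) := by
    funext p
    by_cases hp : Φ (e' p.1, p.2) ∈ Sfine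
    · have hp' : p ∈ S' := hp
      rw [Set.indicator_of_mem hp, Set.indicator_of_mem hp', Pi.one_apply, one_mul]
    · have hp' : p ∉ S' := hp
      rw [Set.indicator_of_notMem hp, Set.indicator_of_notMem hp', zero_mul, ENNReal.coe_zero]
  have hne : ∀ V z, S'.indicator (fun p => Jac (e' p.1, p.2)) (V, z) ≠ 0 ↔ (∀ c, V (bondShift hs.symm c) ∈ T c z) ∧ Φ (e' V, z) ∈ Sfine := by
    intro V z
    constructor
    · intro h
      have hmem : (V, z) ∈ S' := Set.mem_of_indicator_ne_zero h
      refine ⟨(hJT (e' V) z).1 fun h0 => h ?_, hmem⟩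
      rw [Set.indicator_of_mem hmem, h0]
    · rintro ⟨hV, hmem⟩
      have hmem' : (V, z) ∈ S' := hmem
      rw [Set.indicator_of_mem hmem']
      exact (hJT (e' V) z).2 hV
  refine ⟨fun p => Φ (e' p.1, p.2), S'.indicator fun p => Jac (e' p.1, p.2), T, fun c => bondShift hs.symm c, hΦ.comp hθ,
    (hJac.comp hθ).indicator hS'm, fun V z hj => ?_, fun V z hj => ((hne V z).1 hj).2, fun O hO => ?_, hTc, hne,
    fun V₀ z hint hfr => ?_, fun V₀ z hout => ?_, hTeq, fun V z hV => ?charted, fun p => ?bdd, fun V z g hg hS hd => ?recog⟩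
  case charted =>
    obtain ⟨hoff, hwin⟩ := hcharted (e' V) z hV
    refine ⟨hoff, hwin, ?_⟩
    have hJ : Jac (e' V, z) ≠ 0 := (hJT (e' V) z).2 hV
    rw [hdesc, Function.comp_apply, hfib _ _ hJ, hee']
  case bdd =>
    exact (mul_le_mul' le_rfl (Set.indicator_le_self _ _ p)).trans (hbdd (e' p.1, p.2))
  case recog =>
    have h1 := hd
    rw [hdesc, Function.comp_apply] at h1
    have hiter : ∀ c, e' V c =
        Averaging.iter (fun i => BlockAveraging.blockAvg (P := F.P K) (j := i) (expMeanLogSU (n := Fin N))) (K - J)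
          (extend (iterCentralBond (K - J)) g z) c := fun c => by
      rw [← h1, he'e]
    obtain ⟨hJ, hΦg⟩ := hrec (e' V) z g hg hiter
    have hmemS' : (V, z) ∈ S' := by
      show Φ (e' V, z) ∈ Sfine
      rw [hΦg]
      exact hS
    refine ⟨?_, hΦg⟩
    show S'.indicator (fun p => Jac (e' p.1, p.2)) (V, z) ≠ 0
    rw [Set.indicator_of_mem hmemS']
    exact hJ
  · have hJ : Jac (e' V, z) ≠ 0 := (hJT (e' V) z).2 ((hne V z).1 hj).1
    rw [hdesc, Function.comp_apply, hfib _ _ hJ, hee']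
  · rw [hdesc, ← hdens]
    exact fibredLaw_transport (fieldMeasure (F.P K) 0 (SU N)) (fieldMeasure (F.P K) (K - J) (SU N)) (fieldMeasure (F.P J) 0 (SU N))
      he he' he'e hpres hΦ hJac' hlaw hSm hSsub hO
  · -- continuity at an all-interior coarse point whose leaf point is off the frontier of `Sfine`
    obtain ⟨hΦat, hJat⟩ := hreg (e' V₀) z hint
    have hΦ'at : ContinuousAt (fun V : GaugeField (F.P J) 0 (SU N) => Φ (e' V, z)) V₀ :=
      ContinuousAt.comp (f := e') (x := V₀) hΦat he'c.continuousAt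
    have hJ'at : ContinuousAt (fun V : GaugeField (F.P J) 0 (SU N) => Jac (e' V, z)) V₀ :=
      ContinuousAt.comp (f := e') (x := V₀) hJat he'c.continuousAt
    refine ⟨hΦ'at, ?_⟩
    by_cases hi : Φ (e' V₀, z) ∈ interior Sfine
    · have hev : ∀ᶠ V in 𝓝 V₀, (V, z) ∈ S' := by
        filter_upwards [hΦ'at.preimage_mem_nhds (mem_interior_iff_mem_nhds.1 hi)] with V hV
        exact hV
      refine hJ'at.congr ?_
      filter_upwards [hev] with V hV
      exact (Set.indicator_of_mem hV (fun p : GaugeField (F.P J) 0 (SU N) × GaugeField (F.P K) 0 (SU N) => Jac (e' p.1, p.2))).symm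
    · have hcl : Φ (e' V₀, z) ∉ closure Sfine := fun h => hfr ⟨h, hi⟩
      have hev : ∀ᶠ V in 𝓝 V₀, (V, z) ∉ S' := by
        filter_upwards [hΦ'at.preimage_mem_nhds (isClosed_closure.isOpen_compl.mem_nhds hcl)] with V hV
        exact fun h => hV (subset_closure h)
      refine (continuousAt_const (y := (0 : ℝ≥0))).congr ?_
      filter_upwards [hev] with V hV
      exact (Set.indicator_of_notMem hV _).symm
  · -- death near a coarse point with a pivot coordinate outside the closure of its window
    have hev : ∀ᶠ V in 𝓝 V₀, Jac (e' V, z) = 0 := he'c.continuousAt.eventually (hdead (e' V₀) z hout)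
    filter_upwards [hev] with V hV
    exact Set.indicator_apply_eq_zero.2 fun _ => hV

end Descend

end ChainLawSec

/-! ## §1 The canonical version and the organ WREG — VERBATIM from `Lines/semiclassical_s2beta.lean` v4 / `Lines/polymer_norm_s2beta.lean` v3 -/

section Canonical

variable (F : T3Family) (γ : ℝ) {J K : ℕ} (hJK : J ≤ K) (S : Set (GaugeField (F.P K) 0 (Matrix.specialUnitaryGroup (Fin 2) ℂ)))

/-- **THE CANONICAL VERSION OF BAŁABAN'S RESTRICTED DENSITY AT HEIGHT `K − J`** (verbatim from v4). [cite: Balaban1985UV3, (2) p.256 and (41) p.266] -/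
def heightDensityCan (V : GaugeField (F.P J) 0 (Matrix.specialUnitaryGroup (Fin 2) ℂ)) : ℝ :=
  Node00.canonVersion (fieldMeasure (F.P J) 0 (Matrix.specialUnitaryGroup (Fin 2) ℂ)) (heightDensity F γ hJK S) V

end Canonical

/-- **WREG · WINDOW REGULARITY OF THE SMALL-FIELD FIBRE DENSITY** — VERBATIM from `runpair_organ` v4. [cite: Balaban1985Averaging, (10) p.19] -/
def WindowRegularity : Prop :=
  ∀ (L : ℕ) (b₀ p₀ : ℝ), 0 < b₀ → 0 < p₀ → ∃ γ₁ : ℝ, 0 < γ₁ ∧ ∀ (F : T3Family) (γ : ℝ), F.L = L → 0 < γ → γ ≤ γ₁ →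
    ∀ (J K : ℕ) (hJK : J ≤ K) (γ' : ℝ), 0 < γ' →
      {U : GaugeField (F.P J) 0 (Matrix.specialUnitaryGroup (Fin 2) ℂ) | PlaqSmall (θBal F.L γ b₀ p₀ J) U} ⊆
          Node00.regSet (fieldMeasure (F.P J) 0 (Matrix.specialUnitaryGroup (Fin 2) ℂ))
            (heightDensity F γ' hJK (histGood F ℰp (θBal F.L γ b₀ p₀) K J)) ∧
      ∀ U : GaugeField (F.P J) 0 (Matrix.specialUnitaryGroup (Fin 2) ℂ), PlaqSmall (θBal F.L γ b₀ p₀ J) U →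
          0 < heightDensityCan F γ' hJK (histGood F ℰp (θBal F.L γ b₀ p₀) K J) U

/-! ## §2 The posited interface: a WINDOW CHART of the iterated small-field averaging, and the two obligations -/

/-- **WINDOW CHART** (posited interface; its existence is the obligation CHART, never smuggled). [cite: Balaban1987RG1, (2.10) p.267 and (0.13) p.254] -/
structure WindowChart (F : T3Family) {J K : ℕ} (hJK : J ≤ K) (Sfine : Set (GaugeField (F.P K) 0 (Matrix.specialUnitaryGroup (Fin 2) ℂ)))
    (O : Set (GaugeField (F.P J) 0 (Matrix.specialUnitaryGroup (Fin 2) ℂ))) where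
  /-- the chart map `(V, z) ↦ Φ(V, z)` -/
  Φ : GaugeField (F.P J) 0 (Matrix.specialUnitaryGroup (Fin 2) ℂ) × GaugeField (F.P K) 0 (Matrix.specialUnitaryGroup (Fin 2) ℂ) →
    GaugeField (F.P K) 0 (Matrix.specialUnitaryGroup (Fin 2) ℂ)
  /-- its Jacobian against `μ_J⌊O ⊗ ν_K` -/
  jac : GaugeField (F.P J) 0 (Matrix.specialUnitaryGroup (Fin 2) ℂ) × GaugeField (F.P K) 0 (Matrix.specialUnitaryGroup (Fin 2) ℂ) → ℝ≥0
  /-- a uniform bound for the Jacobian -/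
  bound : ℝ≥0
  measurable_Φ : Measurable Φ
  measurable_jac : Measurable jac
  jac_le : ∀ p, jac p ≤ bound
  descendTo_Φ : ∀ V ∈ O, ∀ z, jac (V, z) ≠ 0 → descendTo F ℰp J K hJK (Φ (V, z)) = V
  map_Φ : (fieldMeasure (F.P K) 0 (Matrix.specialUnitaryGroup (Fin 2) ℂ)).restrict (descendTo F ℰp J K hJK ⁻¹' O ∩ Sfine) =
    ((((fieldMeasure (F.P J) 0 (Matrix.specialUnitaryGroup (Fin 2) ℂ)).restrict O).prod
        (fieldMeasure (F.P K) 0 (Matrix.specialUnitaryGroup (Fin 2) ℂ))).withDensity (fun p => (jac p : ℝ≥0∞))).map Φ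
  regular : ∀ V₀ ∈ O, ∀ᵐ z ∂fieldMeasure (F.P K) 0 (Matrix.specialUnitaryGroup (Fin 2) ℂ),
    (ContinuousAt (fun V => (jac (V, z) : ℝ)) V₀ ∧ ContinuousAt (fun V => Φ (V, z)) V₀ ∧ (jac (V₀, z) ≠ 0 → Φ (V₀, z) ∉ frontier Sfine)) ∨
      (∀ᶠ V in 𝓝 V₀, jac (V, z) = 0 ∨ Φ (V, z) ∉ Sfine)
  charge : ∀ V ∈ O, (∃ U, descendTo F ℰp J K hJK U = V ∧ U ∈ interior Sfine) →
    0 < fieldMeasure (F.P K) 0 (Matrix.specialUnitaryGroup (Fin 2) ℂ) {z | jac (V, z) ≠ 0 ∧ Φ (V, z) ∈ Sfine}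

/-- **CHART · WINDOW CHARTS EXIST** (obligation; proved from VOL + EDGE + LEVEL + CHARGE in §4e). [cite: Balaban1987RG1, (2.10) p.267] -/
def WindowChartsExist : Prop :=
  ∀ (L : ℕ) (b₀ p₀ : ℝ), 0 < b₀ → 0 < p₀ → ∃ γ₁ : ℝ, 0 < γ₁ ∧ ∀ (F : T3Family) (γ : ℝ), F.L = L → 0 < γ → γ ≤ γ₁ →
    ∀ (J K : ℕ) (hJK : J ≤ K) (V₀ : GaugeField (F.P J) 0 (Matrix.specialUnitaryGroup (Fin 2) ℂ)), PlaqSmall (θBal F.L γ b₀ p₀ J) V₀ →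
      ∃ O : Set (GaugeField (F.P J) 0 (Matrix.specialUnitaryGroup (Fin 2) ℂ)), IsOpen O ∧ V₀ ∈ O ∧
        Nonempty (WindowChart F hJK (histGood F ℰp (θBal F.L γ b₀ p₀) K J) O)

/-- **INTERIOR · EVERY WINDOW FIBRE MEETS THE INTERIOR OF THE UV-SMALL-HISTORY EVENT** (stub, S–M; keyed to the LEAD's … [cite: Balaban1985UV3, (7) p.257] -/
def WindowFibreInterior : Prop :=
  ∀ (L : ℕ) (b₀ p₀ : ℝ), 0 < b₀ → 0 < p₀ → ∃ γ₁ : ℝ, 0 < γ₁ ∧ ∀ (F : T3Family) (γ : ℝ), F.L = L → 0 < γ → γ ≤ γ₁ →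
    ∀ (J K : ℕ) (hJK : J ≤ K) (V : GaugeField (F.P J) 0 (Matrix.specialUnitaryGroup (Fin 2) ℂ)), PlaqSmall (θBal F.L γ b₀ p₀ J) V →
      ∃ U : GaugeField (F.P K) 0 (Matrix.specialUnitaryGroup (Fin 2) ℂ),
        descendTo F ℰp J K hJK U = V ∧ U ∈ interior (histGood F ℰp (θBal F.L γ b₀ p₀) K J)

/-! ## §3 GLUE, part 1 (PROVED): a window chart puts `O` inside `regSet` of every `γ′`-weighted restricted density and computes the canonical version -/

section Glue

variable {F : T3Family} {J K : ℕ} {hJK : J ≤ K} {Sfine : Set (GaugeField (F.P K) 0 (Matrix.specialUnitaryGroup (Fin 2) ℂ))}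
  {O : Set (GaugeField (F.P J) 0 (Matrix.specialUnitaryGroup (Fin 2) ℂ))}

/-- The Boltzmann weight is continuous in the configuration. [folklore] -/
theorem continuous_boltzmann (P : Params) (β : ℝ) :
    Continuous (boltzmann P β : GaugeField P 0 (Matrix.specialUnitaryGroup (Fin 2) ℂ) → ℝ) := by
  have hre : Continuous (reTr : Matrix.specialUnitaryGroup (Fin 2) ℂ → ℝ) :=
    UnitaryModel.continuous_nReTr.comp (Literature.MathematicalPhysics.QuantumLattice.continuous_fundamentalRep (Fin 2))
  have hA : Continuous (wilsonAction4 : GaugeField P 0 (Matrix.specialUnitaryGroup (Fin 2) ℂ) → ℝ) := by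
    unfold wilsonAction4 wilsonAction
    exact continuous_finsetSum _ fun p _ =>
      continuous_const.mul (continuous_const.sub (hre.comp (B12ContinuousTransportInvarianceOn.continuous_plaqHol_SU (N := 2) p)))
  unfold boltzmann
  exact Real.continuous_exp.comp (continuous_const.mul hA)

/-- The weighted event density of the glue: measurable, integrable. [cite: Balaban1985UV3, (2) p.256] -/
theorem rho_props (hSm : MeasurableSet Sfine) {β : ℝ} (hβ : 0 ≤ β) :
    Measurable (Sfine.indicator (boltzmann (F.P K) β)) ∧
      Integrable (Sfine.indicator (boltzmann (F.P K) β)) (fieldMeasure (F.P K) 0 (Matrix.specialUnitaryGroup (Fin 2) ℂ)) ∧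
      (∀ x, 0 ≤ Sfine.indicator (boltzmann (F.P K) β) x) ∧ (∀ x, Sfine.indicator (boltzmann (F.P K) β) x ≤ 1) ∧
      (∀ x, Sfine.indicator (boltzmann (F.P K) β) x ≠ 0 → x ∈ Sfine) := by
  refine ⟨(measurable_boltzmann RegularGaugeGroup.measurable_reTr _ _).indicator hSm,
    (integrable_boltzmann RegularGaugeGroup.measurable_reTr _ hβ).indicator hSm,
    fun x => Set.indicator_nonneg (fun y _ => (boltzmann_pos _ _ y).le) x,
    fun x => Set.indicator_apply_le' (fun _ => boltzmann_le_one _ hβ x) (fun _ => zero_le_one),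
    fun x hx => ?_⟩
  by_contra h
  exact hx (by simp [h])

/-- **LEAFWISE DOMINATED CONVERGENCE** for the fibre integral of a window chart. [cite: Balaban1987RG1, (0.13) p.254 (bookkeeping)] -/
theorem continuousOn_fibreInt (c : WindowChart F hJK Sfine O) (_hO : IsOpen O) (hSm : MeasurableSet Sfine) {β : ℝ} (hβ : 0 ≤ β) :
    ContinuousOn (fun V => ∫ z, (c.jac (V, z) : ℝ) * Sfine.indicator (boltzmann (F.P K) β) (c.Φ (V, z))
      ∂fieldMeasure (F.P K) 0 (Matrix.specialUnitaryGroup (Fin 2) ℂ)) O := by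
  obtain ⟨hρm, -, hρ0, hρ1, -⟩ := rho_props (F := F) (K := K) hSm hβ
  set ρ := Sfine.indicator (boltzmann (F.P K) β) with hρ_def
  have hFm : ∀ V, Measurable fun z => (c.jac (V, z) : ℝ) * ρ (c.Φ (V, z)) := fun V =>
    (measurable_coe_nnreal_real.comp (c.measurable_jac.comp measurable_prodMk_left)).mul
      (hρm.comp (c.measurable_Φ.comp measurable_prodMk_left))
  have hFb : ∀ V z, ‖(c.jac (V, z) : ℝ) * ρ (c.Φ (V, z))‖ ≤ (c.bound : ℝ) := fun V z => by
    rw [Real.norm_eq_abs, abs_mul, abs_of_nonneg (c.jac (V, z)).coe_nonneg, abs_of_nonneg (hρ0 _)]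
    calc (c.jac (V, z) : ℝ) * ρ (c.Φ (V, z)) ≤ (c.jac (V, z) : ℝ) * 1 :=
          mul_le_mul_of_nonneg_left (hρ1 _) (c.jac (V, z)).coe_nonneg
      _ ≤ (c.bound : ℝ) := by rw [mul_one]; exact_mod_cast c.jac_le (V, z)
  intro V₀ hV₀
  refine ContinuousAt.continuousWithinAt ?_
  refine continuousAt_of_dominated (bound := fun _ => (c.bound : ℝ)) (Eventually.of_forall fun V => (hFm V).aestronglyMeasurable)
    (Eventually.of_forall fun V => Eventually.of_forall fun z => hFb V z) (integrable_const _) ?_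
  filter_upwards [c.regular V₀ hV₀] with z hz
  rcases hz with ⟨hj, hΦ, hfr⟩ | hev
  · by_cases h0 : c.jac (V₀, z) = 0
    · -- the Jacobian vanishes at the leaf point: squeeze
      have hlim : Tendsto (fun V => (c.jac (V, z) : ℝ)) (𝓝 V₀) (𝓝 0) := by
        have := hj.tendsto
        rwa [h0, NNReal.coe_zero] at this
      have hF0 : (c.jac (V₀, z) : ℝ) * ρ (c.Φ (V₀, z)) = 0 := by rw [h0, NNReal.coe_zero, zero_mul]
      show Tendsto (fun V => (c.jac (V, z) : ℝ) * ρ (c.Φ (V, z))) (𝓝 V₀) (𝓝 ((c.jac (V₀, z) : ℝ) * ρ (c.Φ (V₀, z))))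
      rw [hF0]
      refine squeeze_zero_norm' (Eventually.of_forall fun V => ?_) hlim
      rw [Real.norm_eq_abs, abs_mul, abs_of_nonneg (c.jac (V, z)).coe_nonneg, abs_of_nonneg (hρ0 _)]
      calc (c.jac (V, z) : ℝ) * ρ (c.Φ (V, z)) ≤ (c.jac (V, z) : ℝ) * 1 :=
            mul_le_mul_of_nonneg_left (hρ1 _) (c.jac (V, z)).coe_nonneg
        _ = (c.jac (V, z) : ℝ) := mul_one _
    · -- off the frontier: the indicator is continuous at the leaf point
      have hρat : ContinuousAt ρ (c.Φ (V₀, z)) :=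
        ContinuousOn.continuousAt_indicator (continuous_boltzmann (F.P K) β).continuousOn (hfr h0)
      exact hj.mul (ContinuousAt.comp (g := ρ) (f := fun V => c.Φ (V, z)) hρat hΦ)
  · -- the leaf is eventually off the event near `V₀`: the integrand vanishes identically there
    have hzero : (fun _ : GaugeField (F.P J) 0 (Matrix.specialUnitaryGroup (Fin 2) ℂ) => (0 : ℝ)) =ᶠ[𝓝 V₀]
        fun V => (c.jac (V, z) : ℝ) * ρ (c.Φ (V, z)) := by
      filter_upwards [hev] with V hV
      rcases hV with hV | hV
      · rw [hV, NNReal.coe_zero, zero_mul]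
      · rw [hρ_def, Set.indicator_of_notMem hV, mul_zero]
    exact continuousAt_const.congr hzero

/-- **(R) FROM A CHART (PROVED)**: a window chart on `Sfine` over the open `O` puts `O` inside `regSet`. [cite: Balaban1987RG1, (2.10) p.267 and (0.13) p.254] -/
theorem chart_subset_regSet (c : WindowChart F hJK Sfine O) (hO : IsOpen O) (hSm : MeasurableSet Sfine) {γ' : ℝ} (hγ' : 0 ≤ γ') :
    O ⊆ Node00.regSet (fieldMeasure (F.P J) 0 (Matrix.specialUnitaryGroup (Fin 2) ℂ)) (heightDensity F γ' hJK Sfine) := by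
  have hβ : 0 ≤ (F.scheme ℰp γ').β K := F.scheme_β_nonneg ℰp hγ' K
  obtain ⟨-, hρi, -, -, hρS⟩ := rho_props (F := F) (K := K) hSm hβ
  exact Node00.subset_regSet_transform_of_fibredChart_of_ne_zero hO (measurable_descendTo F ℰp measurableE_ℰp hJK) c.measurable_Φ c.measurable_jac
    c.descendTo_Φ c.map_Φ hρi hρS (heightDensity_props F hJK hSm hγ').2.integrableOn
    (fun f hf hC => Summit.QuantumFields.YangMills.Theorems.LogComparisonOneTower.integral_heightDensity_mul F K hJK hγ' hSm f hf hC)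
    (continuousOn_fibreInt c hO hSm hβ)

/-- **THE CANONICAL VERSION IS THE FIBRE INTEGRAL ON `O` (PROVED)** … [cite: Balaban1987RG1, (0.13) p.254] -/
theorem heightDensityCan_eq_fibreInt (c : WindowChart F hJK Sfine O) (hO : IsOpen O) (hSm : MeasurableSet Sfine) {γ' : ℝ} (hγ' : 0 ≤ γ')
    {V : GaugeField (F.P J) 0 (Matrix.specialUnitaryGroup (Fin 2) ℂ)} (hV : V ∈ O) :
    heightDensityCan F γ' hJK Sfine V = ∫ z, (c.jac (V, z) : ℝ) *
      Sfine.indicator (boltzmann (F.P K) ((F.scheme ℰp γ').β K)) (c.Φ (V, z)) ∂fieldMeasure (F.P K) 0 (Matrix.specialUnitaryGroup (Fin 2) ℂ) := by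
  haveI := B12ContinuousTransportInvariance.isOpenPosMeasure_fieldMeasure_SU (N := 2) (F.P J) 0
  have hβ : 0 ≤ (F.scheme ℰp γ').β K := F.scheme_β_nonneg ℰp hγ' K
  obtain ⟨-, hρi, -, -, hρS⟩ := rho_props (F := F) (K := K) hSm hβ
  have havg := measurable_descendTo F ℰp measurableE_ℰp hJK
  refine Node00.canonVersion_eqOn_of_forall_integral_mul_eq hO (heightDensity_props F hJK hSm hγ').2.integrableOn
    (Node00.integrableOn_fibreIntegral_of_fibredChart c.measurable_Φ c.measurable_jac c.map_Φ hρi).locallyIntegrableOn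
    (continuousOn_fibreInt c hO hSm hβ) (fun f hf hC hf0 => ?_) hV
  exact (Summit.QuantumFields.YangMills.Theorems.LogComparisonOneTower.integral_heightDensity_mul F K hJK hγ' hSm f hf hC).trans
    (Node00.integral_mul_comp_eq_integral_fibreIntegral_mul_of_ne_zero hO.measurableSet havg c.measurable_Φ c.measurable_jac c.descendTo_Φ c.map_Φ
      hρi hρS hf hC hf0)

/-- **(P) FROM A CHART (PROVED)**. [cite: Balaban1985UV3, (2) p.256 and (41) p.266] -/
theorem chart_pos (c : WindowChart F hJK Sfine O) (hO : IsOpen O) (hSm : MeasurableSet Sfine) {γ' : ℝ} (hγ' : 0 ≤ γ')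
    {V : GaugeField (F.P J) 0 (Matrix.specialUnitaryGroup (Fin 2) ℂ)} (hV : V ∈ O)
    (hint : ∃ U, descendTo F ℰp J K hJK U = V ∧ U ∈ interior Sfine) :
    0 < heightDensityCan F γ' hJK Sfine V := by
  have hβ : 0 ≤ (F.scheme ℰp γ').β K := F.scheme_β_nonneg ℰp hγ' K
  obtain ⟨hρm, -, hρ0, hρ1, -⟩ := rho_props (F := F) (K := K) hSm hβ
  set ρ := Sfine.indicator (boltzmann (F.P K) ((F.scheme ℰp γ').β K)) with hρ_def
  rw [heightDensityCan_eq_fibreInt c hO hSm hγ' hV]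
  have hFm : Measurable fun z => (c.jac (V, z) : ℝ) * ρ (c.Φ (V, z)) :=
    (measurable_coe_nnreal_real.comp (c.measurable_jac.comp measurable_prodMk_left)).mul
      (hρm.comp (c.measurable_Φ.comp measurable_prodMk_left))
  have hFi : Integrable (fun z => (c.jac (V, z) : ℝ) * ρ (c.Φ (V, z))) (fieldMeasure (F.P K) 0 (Matrix.specialUnitaryGroup (Fin 2) ℂ)) := by
    refine (integrable_const (c.bound : ℝ)).mono' hFm.aestronglyMeasurable (Eventually.of_forall fun z => ?_)
    rw [Real.norm_eq_abs, abs_mul, abs_of_nonneg (c.jac (V, z)).coe_nonneg, abs_of_nonneg (hρ0 _)]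
    calc (c.jac (V, z) : ℝ) * ρ (c.Φ (V, z)) ≤ (c.jac (V, z) : ℝ) * 1 :=
          mul_le_mul_of_nonneg_left (hρ1 _) (c.jac (V, z)).coe_nonneg
      _ ≤ (c.bound : ℝ) := by rw [mul_one]; exact_mod_cast c.jac_le (V, z)
  rw [integral_pos_iff_support_of_nonneg_ae (Eventually.of_forall fun z => mul_nonneg (c.jac (V, z)).coe_nonneg (hρ0 _)) hFi]
  refine lt_of_lt_of_le (c.charge V hV hint) (measure_mono fun z hz => ?_)
  obtain ⟨hj, hS⟩ := hz
  rw [Function.mem_support]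
  refine mul_ne_zero (by exact_mod_cast hj) ?_
  rw [hρ_def, Set.indicator_of_mem hS]
  exact (boltzmann_pos _ _ _).ne'

end Glue

/-! ## §4 GLUE, part 2 (PROVED): CHART ∧ INTERIOR ⇒ WREG -/

/-- **WREG FROM THE TABLE (PROVED).** [cite: Balaban1987RG1, (2.10) p.267; Balaban1985UV3, (2) p.256] -/
theorem windowRegularity_of_chart (hC : WindowChartsExist) (hI : WindowFibreInterior) : WindowRegularity := by
  intro L b₀ p₀ hb hp
  obtain ⟨γC, hγC, hCF⟩ := hC L b₀ p₀ hb hp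
  obtain ⟨γI, hγI, hIF⟩ := hI L b₀ p₀ hb hp
  refine ⟨min γC γI, lt_min hγC hγI, fun F γ hL hγ hγle J K hJK γ' hγ' => ?_⟩
  have hSm : MeasurableSet (histGood F ℰp (θBal F.L γ b₀ p₀) K J) := measurableSet_histGood F ℰp measurableE_ℰp _ K J
  refine ⟨fun V₀ hV₀ => ?_, fun V₀ hV₀ => ?_⟩
  · obtain ⟨O, hO, hVO, ⟨c⟩⟩ := hCF F γ hL hγ (hγle.trans (min_le_left _ _)) J K hJK V₀ hV₀
    exact chart_subset_regSet c hO hSm hγ'.le hVO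
  · obtain ⟨O, hO, hVO, ⟨c⟩⟩ := hCF F γ hL hγ (hγle.trans (min_le_left _ _)) J K hJK V₀ hV₀
    exact chart_pos c hO hSm hγ'.le hVO (hIF F γ hL hγ (hγle.trans (min_le_right _ _)) J K hJK V₀ hV₀)

/-! ## §4b INTERIOR, PROVED (v5): `histGood` is open in the small-coupling regime; every window fibre meets it -/

section OpenProfile

variable {P : Params} {G : Type*} [GaugeGroup G] [TopologicalSpace G] (av : ∀ j, Averaging P j G) (ϑ : ℕ → ℝ) (δ₁ : ℝ)

/-- ★ **THE UV-SMALL HISTORIES FORM AN OPEN SET ON WHICH THE ITERATED AVERAGING IS CONTINUOUS**: if the small-field … [cite: Balaban1985UV3, (7) p.257] -/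
theorem isOpen_histProfile_and_continuousOn
    (hopen : ∀ (j : ℕ) (δ : ℝ), IsOpen {U : GaugeField P j G | PlaqSmall δ U})
    (hϑ : ∀ i, ϑ i ≤ δ₁)
    (hC : ∀ j, j + 1 ≤ P.m + P.K → ContinuousOn (av j).avg {U : GaugeField P j G | PlaqSmall δ₁ U}) :
    ∀ k : ℕ, k ≤ P.m + P.K →
      IsOpen {U : GaugeField P 0 G | ∀ i, i ≤ k → PlaqSmall (ϑ i) (Averaging.iter av i U)} ∧
        ContinuousOn (Averaging.iter av k) {U : GaugeField P 0 G | ∀ i, i ≤ k → PlaqSmall (ϑ i) (Averaging.iter av i U)}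
  | 0, _ => by
      have hS : {U : GaugeField P 0 G | ∀ i, i ≤ 0 → PlaqSmall (ϑ i) (Averaging.iter av i U)} = {U | PlaqSmall (ϑ 0) U} := by
        ext U
        simp only [Set.mem_setOf_eq]
        exact ⟨fun h => h 0 le_rfl, fun h i hi => by obtain rfl : i = 0 := Nat.le_zero.mp hi; exact h⟩
      rw [hS]
      exact ⟨hopen 0 (ϑ 0), continuousOn_id⟩
  | k + 1, hk => by
      obtain ⟨hSo, hSc⟩ := isOpen_histProfile_and_continuousOn hopen hϑ hC k (by omega)
      set S : Set (GaugeField P 0 G) := {U | ∀ i, i ≤ k → PlaqSmall (ϑ i) (Averaging.iter av i U)} with hSdef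
      have hmaps : MapsTo (Averaging.iter av k) S {U : GaugeField P k G | PlaqSmall δ₁ U} := by
        intro U hU
        exact fun p => (hU k le_rfl p).trans_le (hϑ k)
      have hcont : ContinuousOn (Averaging.iter av (k + 1)) S := (hC k (by omega)).comp hSc hmaps
      have hS' : {U : GaugeField P 0 G | ∀ i, i ≤ k + 1 → PlaqSmall (ϑ i) (Averaging.iter av i U)} =
          S ∩ Averaging.iter av (k + 1) ⁻¹' {W | PlaqSmall (ϑ (k + 1)) W} := by
        ext U
        simp only [hSdef, Set.mem_setOf_eq, Set.mem_inter_iff, Set.mem_preimage]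
        constructor
        · intro h
          exact ⟨fun i hi => h i (by omega), h (k + 1) le_rfl⟩
        · rintro ⟨h1, h2⟩ i hi
          rcases Nat.lt_or_ge i (k + 1) with hlt | hge
          · exact h1 i (by omega)
          · obtain rfl : i = k + 1 := le_antisymm hi hge
            exact h2
      rw [hS']
      refine ⟨hcont.isOpen_inter_preimage hSo (hopen (k + 1) (ϑ (k + 1))), hcont.mono Set.inter_subset_left⟩

end OpenProfile

/-- ★★ **`histGood` IS OPEN IN THE SMALL-COUPLING REGIME**. [cite: Balaban1985UV3, (7) p.257] -/
theorem isOpen_histGood (F : T3Family) {K : ℕ} {θ : ℕ → ℝ} {δ₁ : ℝ} (hδ₁ : 0 ≤ δ₁) (hθ : ∀ i, θ i ≤ δ₁)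
    (hsmall : (((((F.P K).d + 2) * (F.P K).L : ℕ) : ℝ) ^ 2 / 4) * δ₁ ≤ ExpMeanLog.deltaSU (Fin 2) / 2) {n : ℕ} (h : n ≤ K) :
    IsOpen (histGood F ℰp θ K n) := by
  rw [Summit.QuantumFields.YangMills.Theorems.PosOnSmallReduction.histGood_eq_setOf_forall_le F θ h]
  have hKK : (F.P K).K = K := rfl
  exact (isOpen_histProfile_and_continuousOn (fun i => BlockAveraging.blockAvg (P := F.P K) (j := i) ℰp) (fun i => θ (K - i)) δ₁
    (fun j δ => Node00.isOpen_plaqSmall δ) (fun i => hθ _)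
    (fun j _ => Summit.QuantumFields.YangMills.Theorems.FibrePositivity.continuousOn_blockAvg_expMeanLogSU hδ₁ hsmall) (K - n) (by omega)).1

/-- ★★★ **INTERIOR, PROVED**: every window datum has a fine history in the interior of `histGood`. [cite: Balaban1987RG1, (0.4) p.253–254] -/
theorem windowFibreInterior_holds : WindowFibreInterior := by
  intro L b₀ p₀ hb hp
  obtain ⟨κ, δ₀, hκ, hδ₀, hF⟩ := Summit.QuantumFields.YangMills.Theorems.ApproxLift.AnsatzT.stub_oneStepSmallLift L
  set δ₁ : ℝ := ExpMeanLog.deltaSU (Fin 2) / 2 / ((((3 + 2) * L : ℕ) : ℝ) ^ 2 / 4 + 1) with hδ₁def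
  have hD : 0 < ((((3 + 2) * L : ℕ) : ℝ) ^ 2 / 4 + 1) := by positivity
  have hδ₁ : 0 < δ₁ := by
    rw [hδ₁def]; exact div_pos (half_pos ExpMeanLog.deltaSU_pos) hD
  obtain ⟨γ₁, hγ₁, hγ₁1, hθ⟩ := exists_gamma_forall_θBal_le (b₀ := b₀) (p₀ := p₀) hb hp (lt_min hδ₀ hδ₁)
  refine ⟨γ₁, hγ₁, fun F γ hFL hγ hγγ₁ J K hJK V hV => ?_⟩
  have hL : 1 ≤ F.L := F.hL.2.le
  subst hFL
  have hγ1 : γ ≤ 1 := hγγ₁.trans hγ₁1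
  have hθ₀ : ∀ i, θBal F.L γ b₀ p₀ i ≤ δ₀ := fun i => (hθ F.L hL γ hγ hγγ₁ i).trans (min_le_left _ _)
  have hθ₁ : ∀ i, θBal F.L γ b₀ p₀ i ≤ δ₁ := fun i => (hθ F.L hL γ hγ hγγ₁ i).trans (min_le_right _ _)
  have hκ1 : κ ≤ 1 := by
    rcases le_or_gt κ 0 with hκ0 | hκ0
    · linarith
    · have h1 : (1 : ℝ) ≤ Real.sqrt F.L := by
        rw [show (1 : ℝ) = Real.sqrt 1 from Real.sqrt_one.symm]
        exact Real.sqrt_le_sqrt (by exact_mod_cast hL)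
      have h2 := mul_le_mul_of_nonneg_left h1 hκ0.le
      rw [mul_one] at h2
      exact h2.trans hκ
  have hθpos : ∀ i, 0 < θBal F.L γ b₀ p₀ i := fun i => T3MinimiserStabilityReduction.θBal_pos hL hγ hγ1 hb p₀ i
  have hθs : ∀ i, κ * θBal F.L γ b₀ p₀ i ≤ θBal F.L γ b₀ p₀ (i + 1) := mul_θBal_le_θBal_succ hL hγ hγ1 hb.le hp.le hκ
  obtain ⟨U, hU, hUg⟩ := exists_mem_fibre_histGood F ℰp (hF F rfl) hκ1 hθpos hθ₀ hθs hJK hV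
  have hsmall : (((((F.P K).d + 2) * (F.P K).L : ℕ) : ℝ) ^ 2 / 4) * δ₁ ≤ ExpMeanLog.deltaSU (Fin 2) / 2 := by
    have hd : (F.P K).d = 3 := T3Family.P_d F K
    have hLL : (F.P K).L = F.L := rfl
    rw [hd, hLL, hδ₁def]
    rw [mul_div_assoc', div_le_iff₀ hD]
    have hq : 0 ≤ ExpMeanLog.deltaSU (Fin 2) / 2 := (half_pos ExpMeanLog.deltaSU_pos).le
    nlinarith [hq]
  have hopen : IsOpen (histGood F ℰp (θBal F.L γ b₀ p₀) K J) := isOpen_histGood F hδ₁.le hθ₁ hsmall hJK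
  exact ⟨U, hU, hopen.interior_eq.symm ▸ hUg⟩

/-! ## §4c CHART-REG REDUCTION (PROVED, v6): the frontier of `histGood` lies on finitely many threshold level hypersurfaces. -/

section ClosedProfile

variable {P : Params} {G : Type*} [GaugeGroup G] [TopologicalSpace G] (av : ∀ j, Averaging P j G) (ϑ : ℕ → ℝ) (δ₁ : ℝ)

/-- ★ **CLOSURE OF THE UV-SMALL HISTORIES ⊆ THE CLOSED PROFILE SET, AND EVERY `avg^k` IS CONTINUOUS THERE**: if the … [cite: Balaban1985UV3, (7) p.257] -/
theorem closure_histProfile_subset_and_continuousAt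
    (hdist : ∀ (j : ℕ) (p : Plaq P j), Continuous fun U : GaugeField P j G => dist1 (GaugeField.plaqHol U p))
    (hopen : ∀ (j : ℕ) (δ : ℝ), IsOpen {U : GaugeField P j G | PlaqSmall δ U})
    (hϑ : ∀ i, ϑ i < δ₁)
    (hC : ∀ j, j + 1 ≤ P.m + P.K → ContinuousOn (av j).avg {U : GaugeField P j G | PlaqSmall δ₁ U}) :
    ∀ k : ℕ, k ≤ P.m + P.K →
      closure {U : GaugeField P 0 G | ∀ i, i ≤ k → PlaqSmall (ϑ i) (Averaging.iter av i U)} ⊆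
          {U : GaugeField P 0 G | ∀ i, i ≤ k → ∀ p, dist1 (GaugeField.plaqHol (Averaging.iter av i U) p) ≤ ϑ i} ∧
        ∀ U : GaugeField P 0 G, (∀ i, i ≤ k → ∀ p, dist1 (GaugeField.plaqHol (Averaging.iter av i U) p) ≤ ϑ i) →
          ContinuousAt (Averaging.iter av k) U
  | 0, _ => by
      refine ⟨?_, fun U _ => continuousAt_id⟩
      intro U hU i hi p
      obtain rfl : i = 0 := Nat.le_zero.mp hi
      have hsub : {U : GaugeField P 0 G | ∀ i, i ≤ 0 → PlaqSmall (ϑ i) (Averaging.iter av i U)} ⊆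
          {U | dist1 (GaugeField.plaqHol U p) < ϑ 0} := fun U h => h 0 le_rfl p
      have hcl := closure_mono hsub hU
      exact closure_lt_subset_le (hdist 0 p) continuous_const hcl
  | k + 1, hk => by
      obtain ⟨hcl, hca⟩ := closure_histProfile_subset_and_continuousAt hdist hopen hϑ hC k (by omega)
      have hca' : ∀ U : GaugeField P 0 G, (∀ i, i ≤ k → ∀ p, dist1 (GaugeField.plaqHol (Averaging.iter av i U) p) ≤ ϑ i) →
          ContinuousAt (Averaging.iter av (k + 1)) U := by
        intro U hU
        have hsm : PlaqSmall δ₁ (Averaging.iter av k U) := fun p => (hU k le_rfl p).trans_lt (hϑ k)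
        have h1 : ContinuousAt (av k).avg (Averaging.iter av k U) :=
          (hC k (by omega)).continuousAt ((hopen k δ₁).mem_nhds hsm)
        exact ContinuousAt.comp (g := (av k).avg) h1 (hca U hU)
      refine ⟨?_, fun U hU => hca' U fun i hi p => hU i (by omega) p⟩
      intro U hU
      have hsub0 : {U : GaugeField P 0 G | ∀ i, i ≤ k + 1 → PlaqSmall (ϑ i) (Averaging.iter av i U)} ⊆
          {U : GaugeField P 0 G | ∀ i, i ≤ k → PlaqSmall (ϑ i) (Averaging.iter av i U)} := fun W hW i hi => hW i (by omega)
      have hUk : U ∈ closure {U : GaugeField P 0 G | ∀ i, i ≤ k → PlaqSmall (ϑ i) (Averaging.iter av i U)} :=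
        closure_mono hsub0 hU
      have hCk := hcl hUk
      intro i hi p
      rcases Nat.lt_or_ge i (k + 1) with hlt | hge
      · exact hCk i (by omega) p
      · obtain rfl : i = k + 1 := le_antisymm hi hge
        have hf : ContinuousAt (fun W : GaugeField P 0 G => dist1 (GaugeField.plaqHol (Averaging.iter av (k + 1) W) p)) U :=
          (hdist (k + 1) p).continuousAt.comp (hca' U hCk)
        have hmem := hf.continuousWithinAt.mem_closure_image hU
        have hsub : (fun W : GaugeField P 0 G => dist1 (GaugeField.plaqHol (Averaging.iter av (k + 1) W) p)) ''
            {U : GaugeField P 0 G | ∀ i, i ≤ k + 1 → PlaqSmall (ϑ i) (Averaging.iter av i U)} ⊆ Set.Iic (ϑ (k + 1)) := by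
          rintro _ ⟨W, hW, rfl⟩
          exact (hW (k + 1) le_rfl p).le
        have h2 : dist1 (GaugeField.plaqHol (Averaging.iter av (k + 1) U) p) ∈ closure (Set.Iic (ϑ (k + 1))) :=
          closure_mono hsub hmem
        rw [closure_Iic] at h2
        exact h2

/-- ★★ **THE FRONTIER OF THE UV-SMALL HISTORIES LIES ON THE THRESHOLD LEVEL HYPERSURFACES**: under the same hypotheses … [cite: Balaban1985UV3, (7) p.257] -/
theorem frontier_histProfile_subset
    (hdist : ∀ (j : ℕ) (p : Plaq P j), Continuous fun U : GaugeField P j G => dist1 (GaugeField.plaqHol U p))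
    (hopen : ∀ (j : ℕ) (δ : ℝ), IsOpen {U : GaugeField P j G | PlaqSmall δ U})
    (hϑ : ∀ i, ϑ i < δ₁)
    (hC : ∀ j, j + 1 ≤ P.m + P.K → ContinuousOn (av j).avg {U : GaugeField P j G | PlaqSmall δ₁ U})
    {k : ℕ} (hk : k ≤ P.m + P.K) :
    frontier {U : GaugeField P 0 G | ∀ i, i ≤ k → PlaqSmall (ϑ i) (Averaging.iter av i U)} ⊆
      {U : GaugeField P 0 G | (∀ i, i ≤ k → ∀ p, dist1 (GaugeField.plaqHol (Averaging.iter av i U) p) ≤ ϑ i) ∧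
        ∃ i, i ≤ k ∧ ∃ p, dist1 (GaugeField.plaqHol (Averaging.iter av i U) p) = ϑ i} := by
  intro U hU
  have hSo := (isOpen_histProfile_and_continuousOn av ϑ δ₁ hopen (fun i => (hϑ i).le) hC k hk).1
  rw [hSo.frontier_eq, Set.mem_sdiff] at hU
  obtain ⟨hUcl, hUnot⟩ := hU
  have hle := (closure_histProfile_subset_and_continuousAt av ϑ δ₁ hdist hopen hϑ hC k hk).1 hUcl
  refine ⟨hle, ?_⟩
  by_contra hne
  push Not at hne
  exact hUnot fun i hi p => lt_of_le_of_ne (hle i hi p) (hne i hi p)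

end ClosedProfile

/-- ★★★ **CHART-REG REDUCTION**: the frontier of `histGood` lies on finitely many threshold level sets. [cite: Balaban1985UV3, (7) p.257] -/
theorem frontier_histGood_subset (F : T3Family) {K : ℕ} {θ : ℕ → ℝ} {δ' : ℝ} (hδ' : 0 ≤ δ') (hθ : ∀ i, θ i < δ')
    (hsmall : (((((F.P K).d + 2) * (F.P K).L : ℕ) : ℝ) ^ 2 / 4) * δ' ≤ ExpMeanLog.deltaSU (Fin 2) / 2) {n : ℕ} (h : n ≤ K) :
    frontier (histGood F ℰp θ K n) ⊆
      {U | ∃ j, j ≤ K - n ∧ ∃ p : Plaq (F.P K) j,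
        dist1 (GaugeField.plaqHol (Averaging.iter (fun i => BlockAveraging.blockAvg (P := F.P K) (j := i) ℰp) j U) p) = θ (K - j)} := by
  rw [Summit.QuantumFields.YangMills.Theorems.PosOnSmallReduction.histGood_eq_setOf_forall_le F θ h]
  have hKK : (F.P K).K = K := rfl
  have hdist : ∀ (j : ℕ) (p : Plaq (F.P K) j),
      Continuous fun U : GaugeField (F.P K) j (Matrix.specialUnitaryGroup (Fin 2) ℂ) => dist1 (GaugeField.plaqHol U p) := fun j p =>
    (UnitaryModel.continuous_opDist1.comp (Literature.MathematicalPhysics.QuantumLattice.continuous_fundamentalRep (Fin 2))).comp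
      (B12ContinuousTransportInvarianceOn.continuous_plaqHol_SU (N := 2) p)
  intro U hU
  obtain ⟨-, j, hj, p, hp⟩ := frontier_histProfile_subset (fun i => BlockAveraging.blockAvg (P := F.P K) (j := i) ℰp)
    (fun i => θ (K - i)) δ' hdist (fun j δ => Node00.isOpen_plaqSmall δ) (fun i => hθ _)
    (fun j _ => Summit.QuantumFields.YangMills.Theorems.FibrePositivity.continuousOn_blockAvg_expMeanLogSU hδ' hsmall) (by omega) hU
  exact ⟨j, hj, p, hp⟩

/-- ★★★ … and every intermediate averaging is continuous on the closure of the window. [cite: Balaban1985UV3, (7) p.257] -/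
theorem continuousAt_iter_of_mem_closure_histGood (F : T3Family) {K : ℕ} {θ : ℕ → ℝ} {δ' : ℝ} (hδ' : 0 ≤ δ') (hθ : ∀ i, θ i < δ')
    (hsmall : (((((F.P K).d + 2) * (F.P K).L : ℕ) : ℝ) ^ 2 / 4) * δ' ≤ ExpMeanLog.deltaSU (Fin 2) / 2) {n : ℕ} (h : n ≤ K)
    {U : GaugeField (F.P K) 0 (Matrix.specialUnitaryGroup (Fin 2) ℂ)} (hU : U ∈ closure (histGood F ℰp θ K n))
    {j : ℕ} (hj : j ≤ K - n) :
    ContinuousAt (Averaging.iter (fun i => BlockAveraging.blockAvg (P := F.P K) (j := i) ℰp) j) U := by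
  rw [Summit.QuantumFields.YangMills.Theorems.PosOnSmallReduction.histGood_eq_setOf_forall_le F θ h] at hU
  have hKK : (F.P K).K = K := rfl
  have hdist : ∀ (j : ℕ) (p : Plaq (F.P K) j),
      Continuous fun U : GaugeField (F.P K) j (Matrix.specialUnitaryGroup (Fin 2) ℂ) => dist1 (GaugeField.plaqHol U p) := fun j p =>
    (UnitaryModel.continuous_opDist1.comp (Literature.MathematicalPhysics.QuantumLattice.continuous_fundamentalRep (Fin 2))).comp
      (B12ContinuousTransportInvarianceOn.continuous_plaqHol_SU (N := 2) p)
  have hsub0 : {U : GaugeField (F.P K) 0 (Matrix.specialUnitaryGroup (Fin 2) ℂ) |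
      ∀ i, i ≤ K - n → PlaqSmall (θ (K - i)) (Averaging.iter (fun i => BlockAveraging.blockAvg (P := F.P K) (j := i) ℰp) i U)} ⊆
      {U | ∀ i, i ≤ j → PlaqSmall (θ (K - i)) (Averaging.iter (fun i => BlockAveraging.blockAvg (P := F.P K) (j := i) ℰp) i U)} :=
    fun W hW i hi => hW i (by omega)
  have hUj := closure_mono hsub0 hU
  obtain ⟨hcl, hca⟩ := closure_histProfile_subset_and_continuousAt (fun i => BlockAveraging.blockAvg (P := F.P K) (j := i) ℰp)
    (fun i => θ (K - i)) δ' hdist (fun j δ => Node00.isOpen_plaqSmall δ) (fun i => hθ _)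
    (fun j _ => Summit.QuantumFields.YangMills.Theorems.FibrePositivity.continuousOn_blockAvg_expMeanLogSU hδ' hsmall) j (by omega)
  exact hca U (hcl hUj)

/-- ★★★ **CHART-REG IN THE CELL'S CURRENCY** — a window chart from level-set avoidance. [cite: Balaban1985UV3, (7) p.257] -/
def WindowChart.ofLevelAvoiding (F : T3Family) {J K : ℕ} (hJK : J ≤ K) {θ : ℕ → ℝ} {δ' : ℝ} (hδ' : 0 ≤ δ') (hθ : ∀ i, θ i < δ')
    (hsmall : (((((F.P K).d + 2) * (F.P K).L : ℕ) : ℝ) ^ 2 / 4) * δ' ≤ ExpMeanLog.deltaSU (Fin 2) / 2)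
    (O : Set (GaugeField (F.P J) 0 (Matrix.specialUnitaryGroup (Fin 2) ℂ)))
    (Φ : GaugeField (F.P J) 0 (Matrix.specialUnitaryGroup (Fin 2) ℂ) × GaugeField (F.P K) 0 (Matrix.specialUnitaryGroup (Fin 2) ℂ) →
      GaugeField (F.P K) 0 (Matrix.specialUnitaryGroup (Fin 2) ℂ))
    (jac : GaugeField (F.P J) 0 (Matrix.specialUnitaryGroup (Fin 2) ℂ) × GaugeField (F.P K) 0 (Matrix.specialUnitaryGroup (Fin 2) ℂ) → ℝ≥0)
    (bound : ℝ≥0) (measurable_Φ : Measurable Φ) (measurable_jac : Measurable jac) (jac_le : ∀ p, jac p ≤ bound)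
    (descendTo_Φ : ∀ V ∈ O, ∀ z, jac (V, z) ≠ 0 → descendTo F ℰp J K hJK (Φ (V, z)) = V)
    (map_Φ : (fieldMeasure (F.P K) 0 (Matrix.specialUnitaryGroup (Fin 2) ℂ)).restrict
        (descendTo F ℰp J K hJK ⁻¹' O ∩ histGood F ℰp θ K J) =
      ((((fieldMeasure (F.P J) 0 (Matrix.specialUnitaryGroup (Fin 2) ℂ)).restrict O).prod
          (fieldMeasure (F.P K) 0 (Matrix.specialUnitaryGroup (Fin 2) ℂ))).withDensity (fun p => (jac p : ℝ≥0∞))).map Φ)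
    (levelAvoiding : ∀ V₀ ∈ O, ∀ᵐ z ∂fieldMeasure (F.P K) 0 (Matrix.specialUnitaryGroup (Fin 2) ℂ),
      (ContinuousAt (fun V => (jac (V, z) : ℝ)) V₀ ∧ ContinuousAt (fun V => Φ (V, z)) V₀ ∧
          (jac (V₀, z) ≠ 0 → ∀ j, j ≤ K - J → ∀ p : Plaq (F.P K) j,
            dist1 (GaugeField.plaqHol (Averaging.iter (fun i => BlockAveraging.blockAvg (P := F.P K) (j := i) ℰp) j (Φ (V₀, z))) p)
              ≠ θ (K - j))) ∨
        (∀ᶠ V in 𝓝 V₀, jac (V, z) = 0 ∨ Φ (V, z) ∉ histGood F ℰp θ K J))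
    (charge : ∀ V ∈ O, (∃ U, descendTo F ℰp J K hJK U = V ∧ U ∈ interior (histGood F ℰp θ K J)) →
      0 < fieldMeasure (F.P K) 0 (Matrix.specialUnitaryGroup (Fin 2) ℂ) {z | jac (V, z) ≠ 0 ∧ Φ (V, z) ∈ histGood F ℰp θ K J}) :
    WindowChart F hJK (histGood F ℰp θ K J) O where
  Φ := Φ
  jac := jac
  bound := bound
  measurable_Φ := measurable_Φ
  measurable_jac := measurable_jac
  jac_le := jac_le
  descendTo_Φ := descendTo_Φ
  map_Φ := map_Φ
  regular V₀ hV₀ := by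
    filter_upwards [levelAvoiding V₀ hV₀] with z hz
    rcases hz with ⟨h1, h2, h3⟩ | h
    · refine Or.inl ⟨h1, h2, fun hj hfr => ?_⟩
      obtain ⟨j, hj', p, hp⟩ := frontier_histGood_subset F hδ' hθ hsmall hJK hfr
      exact h3 hj j hj' p hp
    · exact Or.inr h
  charge := charge

/-! ## §4d CHART DATA (v10): the canonical fibred chart of `descendTo` on `histGood` with its image windows; `regular` from EDGE + LEVEL flatness -/

section ChartDataSec

open Literature.MathematicalPhysics.QuantumFieldTheory.Balaban1983to89.ExpMeanLog (deltaSU)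
open Literature.MathematicalPhysics.QuantumFieldTheory.Balaban1983to89.BlockAveraging (Idx)
open Literature.MathematicalPhysics.QuantumFieldTheory.Balaban1983to89.BlockAveragingEMLHaarAC (offCard)

/-- `histGood` lies in the charted set once `(((d+2)L)²/4)·θ(i) ≤ α`. [cite: Balaban1985UV3, (7) p.257] -/
theorem histGood_subset_charted (F : T3Family) {J K : ℕ} (hJK : J ≤ K) {θ : ℕ → ℝ} (hθ0 : ∀ i, 0 ≤ θ i) {α : ℝ}
    (hθα : ∀ i, (((((F.P K).d + 2) * (F.P K).L : ℕ) : ℝ) ^ 2 / 4) * θ i ≤ α) :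
    histGood F ℰp θ K J ⊆ {U | ∀ c, U (iterCentralBond (K - J) c) ∈ chainWindow (N := 2) α (K - J) U c} := by
  intro U hU c
  have hn : K - J ≤ (F.P K).m + (F.P K).K := by
    show K - J ≤ F.m + K
    omega
  exact self_mem_chainWindow (N := 2) (fun k => θ (K - k)) (fun k => hθ0 _) (fun k => hθα _) hn U c fun k hk => hU k (by omega)

/-- **CHART DATA** of `descendTo` on `Sfine` over `O`. [cite: Balaban1987RG1, (0.4) p.253, (2.4) p.266 and (2.10) p.267] -/
structure ChartData (F : T3Family) {J K : ℕ} (hJK : J ≤ K) (α : ℝ) (Sfine : Set (GaugeField (F.P K) 0 (Matrix.specialUnitaryGroup (Fin 2) ℂ)))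
    (O : Set (GaugeField (F.P J) 0 (Matrix.specialUnitaryGroup (Fin 2) ℂ))) where
  /-- the chart map -/
  Φ : GaugeField (F.P J) 0 (Matrix.specialUnitaryGroup (Fin 2) ℂ) × GaugeField (F.P K) 0 (Matrix.specialUnitaryGroup (Fin 2) ℂ) →
    GaugeField (F.P K) 0 (Matrix.specialUnitaryGroup (Fin 2) ℂ)
  /-- its Jacobian -/
  jac : GaugeField (F.P J) 0 (Matrix.specialUnitaryGroup (Fin 2) ℂ) × GaugeField (F.P K) 0 (Matrix.specialUnitaryGroup (Fin 2) ℂ) → ℝ≥0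
  /-- the closed image windows of the pivot coordinates -/
  T : PBond (F.P K) (K - J) → GaugeField (F.P K) 0 (Matrix.specialUnitaryGroup (Fin 2) ℂ) → Set (Matrix.specialUnitaryGroup (Fin 2) ℂ)
  /-- the pivot relabelling: `(fieldShift⁻¹ V) c = V (w c)` -/
  w : PBond (F.P K) (K - J) → PBond (F.P J) 0
  measurable_Φ : Measurable Φ
  measurable_jac : Measurable jac
  descendTo_Φ : ∀ V z, jac (V, z) ≠ 0 → descendTo F ℰp J K hJK (Φ (V, z)) = V
  mem_of_ne_zero : ∀ V z, jac (V, z) ≠ 0 → Φ (V, z) ∈ Sfine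
  map_Φ : (fieldMeasure (F.P K) 0 (Matrix.specialUnitaryGroup (Fin 2) ℂ)).restrict (descendTo F ℰp J K hJK ⁻¹' O ∩ Sfine) =
    ((((fieldMeasure (F.P J) 0 (Matrix.specialUnitaryGroup (Fin 2) ℂ)).restrict O).prod
        (fieldMeasure (F.P K) 0 (Matrix.specialUnitaryGroup (Fin 2) ℂ))).withDensity (fun p => (jac p : ℝ≥0∞))).map Φ
  isClosed_T : ∀ c z, IsClosed (T c z)
  ne_zero_iff : ∀ V z, jac (V, z) ≠ 0 ↔ (∀ c, V (w c) ∈ T c z) ∧ Φ (V, z) ∈ Sfine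
  continuousAt_of_interior : ∀ V₀ z, (∀ c, V₀ (w c) ∈ interior (T c z)) → Φ (V₀, z) ∉ frontier Sfine →
    ContinuousAt (fun V => Φ (V, z)) V₀ ∧ ContinuousAt (fun V => jac (V, z)) V₀
  eventually_eq_zero : ∀ V₀ z, (∃ c, V₀ (w c) ∉ closure (T c z)) → ∀ᶠ V in 𝓝 V₀, jac (V, z) = 0
  /-- the image windows ARE the images of the iterated central `α`-windows under the chain maps (chart-free description) -/
  T_eq : ∀ c z, T c z = chainMap ℰp (K - J) z c '' chainWindow (N := 2) α (K - J) z c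
  /-- at a raw-live point the chart value keeps the off-pivot coordinates of `z`, is charted, and descends to `V` -/
  charted : ∀ V z, (∀ c, V (w c) ∈ T c z) → (∀ b, (∀ c, iterCentralBond (K - J) c ≠ b) → Φ (V, z) b = z b) ∧
    (∀ c, Φ (V, z) (iterCentralBond (K - J) c) ∈ chainWindow (N := 2) α (K - J) (Φ (V, z)) c) ∧
    descendTo F ℰp J K hJK (Φ (V, z)) = V
  /-- RECOGNITION: a charted fine field in `Sfine` with off-pivot coordinates `z` descending to `V` is the chart value at … -/
  recog : ∀ V z (g : PBond (F.P K) (K - J) → Matrix.specialUnitaryGroup (Fin 2) ℂ), (∀ c, g c ∈ chainWindow (N := 2) α (K - J) z c) →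
    Function.extend (iterCentralBond (K - J)) g z ∈ Sfine →
    descendTo F ℰp J K hJK (Function.extend (iterCentralBond (K - J)) g z) = V →
    jac (V, z) ≠ 0 ∧ Φ (V, z) = Function.extend (iterCentralBond (K - J)) g z

/-- ★★★ **CHART DATA EXIST AT EVERY DEPTH ON `histGood`** (PROVED from VOL + EDGE + LEVEL + CHARGE). [cite: Balaban1987RG1, (0.4) p.253, (2.4) p.266 and (2.10) p.267] -/
theorem nonempty_chartData (F : T3Family) {J K : ℕ} (hJK : J ≤ K) {θ : ℕ → ℝ} (hθ0 : ∀ i, 0 ≤ θ i) {α : ℝ} (hα0 : 0 ≤ α) (hα24 : α ≤ 1 / 24)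
    (hα64 : 64 * α ≤ deltaSU (Fin 2)) (hαL : 157 * α < (((F.P K).L : ℝ) ^ ((F.P K).d - 1))⁻¹)
    (hgap : ∀ j (c : PBond (F.P K) (j + 1)), (offCard c : ℝ) / (Fintype.card (Idx (F.P K)) : ℝ) + 150 * α < 1)
    (hθα : ∀ i, (((((F.P K).d + 2) * (F.P K).L : ℕ) : ℝ) ^ 2 / 4) * θ i ≤ α)
    {O : Set (GaugeField (F.P J) 0 (Matrix.specialUnitaryGroup (Fin 2) ℂ))} (hO : MeasurableSet O) :
    Nonempty (ChartData F hJK α (histGood F ℰp θ K J) O) := by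
  obtain ⟨Φ, jac, T, w, hΦ, hjac, hfib, hmem, hlaw, hTc, hne, hreg, hdead, hTeq, hch, -, hrec⟩ :=
    exists_chartData_descendTo_reg (N := 2) F hJK hα0 hα24 hα64 hαL hgap (j₀ := 0) (Or.inl rfl)
      (measurableSet_histGood F ℰp measurableE_ℰp θ K J) (histGood_subset_charted F hJK hθ0 hθα)
  exact ⟨⟨Φ, jac, T, w, hΦ, hjac, hfib, hmem, hlaw O hO, hTc, hne, hreg, hdead, hTeq, hch, hrec⟩⟩

/-- ★★★ **BOUNDED CHART DATA UNDER CHART-VOL**. [cite: Balaban1987RG1, (0.4) p.253 and (2.10) p.267] -/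
theorem exists_chartData_bdd (F : T3Family) {J K : ℕ} (hJK : J ≤ K) {θ : ℕ → ℝ} (hθ0 : ∀ i, 0 ≤ θ i) {α : ℝ} (hα0 : 0 ≤ α) (hα24 : α ≤ 1 / 24)
    (hα64 : 64 * α ≤ deltaSU (Fin 2)) (hαL : 157 * α < (((F.P K).L : ℝ) ^ ((F.P K).d - 1))⁻¹)
    (hgap : ∀ j (c : PBond (F.P K) (j + 1)), (offCard c : ℝ) / (Fintype.card (Idx (F.P K)) : ℝ) + 150 * α < 1)
    (hθα : ∀ i, (((((F.P K).d + 2) * (F.P K).L : ℕ) : ℝ) ^ 2 / 4) * θ i ≤ α) {j₀ : ℝ≥0} (hj₀ : 0 < j₀) (hvol : ChainVol (F.P K) 2 α j₀)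
    {O : Set (GaugeField (F.P J) 0 (Matrix.specialUnitaryGroup (Fin 2) ℂ))} (hO : MeasurableSet O) :
    ∃ D : ChartData F hJK α (histGood F ℰp θ K J) O, ∀ p, D.jac p ≤ (j₀ ^ ((K - J) * Fintype.card (PBond (F.P K) (K - J))))⁻¹ := by
  obtain ⟨Φ, jac, T, w, hΦ, hjac, hfib, hmem, hlaw, hTc, hne, hreg, hdead, hTeq, hch, hbdd, hrec⟩ :=
    exists_chartData_descendTo_reg (N := 2) F hJK hα0 hα24 hα64 hαL hgap (Or.inr hvol)
      (measurableSet_histGood F ℰp measurableE_ℰp θ K J) (histGood_subset_charted F hJK hθ0 hθα)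
  refine ⟨⟨Φ, jac, T, w, hΦ, hjac, hfib, hmem, hlaw O hO, hTc, hne, hreg, hdead, hTeq, hch, hrec⟩, fun p => ?_⟩
  have hq : j₀ ^ ((K - J) * Fintype.card (PBond (F.P K) (K - J))) ≠ 0 := pow_ne_zero _ hj₀.ne'
  rw [NNReal.le_inv_iff_mul_le hq, mul_comm]
  exact hbdd p

/-- ★★ **`regular` FROM EDGE + LEVEL FLATNESS** — a window chart from chart data. [cite: Balaban1987RG1, (2.10) p.267] -/
def WindowChart.ofChartData {F : T3Family} {J K : ℕ} {hJK : J ≤ K} {θ : ℕ → ℝ} {O : Set (GaugeField (F.P J) 0 (Matrix.specialUnitaryGroup (Fin 2) ℂ))}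
    {α : ℝ} (D : ChartData F hJK α (histGood F ℰp θ K J) O) {δ' : ℝ} (hδ' : 0 ≤ δ') (hθ : ∀ i, θ i < δ')
    (hsmall : (((((F.P K).d + 2) * (F.P K).L : ℕ) : ℝ) ^ 2 / 4) * δ' ≤ ExpMeanLog.deltaSU (Fin 2) / 2)
    (bound : ℝ≥0) (jac_le : ∀ p, D.jac p ≤ bound)
    (edge : ∀ V₀ ∈ O, ∀ᵐ z ∂fieldMeasure (F.P K) 0 (Matrix.specialUnitaryGroup (Fin 2) ℂ),
      (∀ c, V₀ (D.w c) ∈ interior (D.T c z)) ∨ (∃ c, V₀ (D.w c) ∉ closure (D.T c z)))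
    (level : ∀ V₀ ∈ O, ∀ᵐ z ∂fieldMeasure (F.P K) 0 (Matrix.specialUnitaryGroup (Fin 2) ℂ),
      (∀ c, V₀ (D.w c) ∈ D.T c z) → ∀ j, j ≤ K - J → ∀ p : Plaq (F.P K) j,
        dist1 (GaugeField.plaqHol (Averaging.iter (fun i => BlockAveraging.blockAvg (P := F.P K) (j := i) ℰp) j (D.Φ (V₀, z))) p) ≠ θ (K - j))
    (charge : ∀ V ∈ O, (∃ U, descendTo F ℰp J K hJK U = V ∧ U ∈ interior (histGood F ℰp θ K J)) →
      0 < fieldMeasure (F.P K) 0 (Matrix.specialUnitaryGroup (Fin 2) ℂ) {z | D.jac (V, z) ≠ 0 ∧ D.Φ (V, z) ∈ histGood F ℰp θ K J}) :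
    WindowChart F hJK (histGood F ℰp θ K J) O where
  Φ := D.Φ
  jac := D.jac
  bound := bound
  measurable_Φ := D.measurable_Φ
  measurable_jac := D.measurable_jac
  jac_le := jac_le
  descendTo_Φ V _ z h := D.descendTo_Φ V z h
  map_Φ := D.map_Φ
  regular V₀ hV₀ := by
    filter_upwards [edge V₀ hV₀, level V₀ hV₀] with z hz hl
    rcases hz with hint | hout
    · have hT : ∀ c, V₀ (D.w c) ∈ D.T c z := fun c => interior_subset (hint c)
      have hfr : D.Φ (V₀, z) ∉ frontier (histGood F ℰp θ K J) := fun h => by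
        obtain ⟨j, hj, p, hp⟩ := frontier_histGood_subset F hδ' hθ hsmall hJK h
        exact hl hT j hj p hp
      obtain ⟨hΦc, hjc⟩ := D.continuousAt_of_interior V₀ z hint hfr
      exact Or.inl ⟨NNReal.continuous_coe.continuousAt.comp hjc, hΦc, fun _ => hfr⟩
    · exact Or.inr ((D.eventually_eq_zero V₀ z hout).mono fun V h => Or.inl h)
  charge := charge

end ChartDataSec

/-- ★★ The level-avoidance regime is reached for small coupling. [cite: Balaban1985UV3, (28)-(31) p.263] -/
theorem exists_gamma_levelRegime :
    ∀ (L : ℕ) (b₀ p₀ : ℝ), 0 < b₀ → 0 < p₀ → ∃ δ' γ₁ : ℝ, 0 < δ' ∧ 0 < γ₁ ∧ ∀ (F : T3Family) (γ : ℝ), F.L = L → 0 < γ → γ ≤ γ₁ →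
      ∀ K : ℕ, (((((F.P K).d + 2) * (F.P K).L : ℕ) : ℝ) ^ 2 / 4) * δ' ≤ ExpMeanLog.deltaSU (Fin 2) / 2 ∧
        ∀ i, θBal F.L γ b₀ p₀ i < δ' := by
  intro L b₀ p₀ hb hp
  set δ' : ℝ := ExpMeanLog.deltaSU (Fin 2) / 2 / ((((3 + 2) * L : ℕ) : ℝ) ^ 2 / 4 + 1) with hδdef
  have hD : 0 < ((((3 + 2) * L : ℕ) : ℝ) ^ 2 / 4 + 1) := by positivity
  have hδ' : 0 < δ' := by rw [hδdef]; exact div_pos (half_pos ExpMeanLog.deltaSU_pos) hD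
  obtain ⟨γ₁, hγ₁, hγ₁1, hθ⟩ := exists_gamma_forall_θBal_le (b₀ := b₀) (p₀ := p₀) hb hp (half_pos hδ')
  refine ⟨δ', γ₁, hδ', hγ₁, fun F γ hFL hγ hγγ₁ K => ?_⟩
  have hL : 1 ≤ F.L := F.hL.2.le
  subst hFL
  refine ⟨?_, fun i => (hθ F.L hL γ hγ hγγ₁ i).trans_lt (half_lt_self hδ')⟩
  have hd : (F.P K).d = 3 := T3Family.P_d F K
  have hLL : (F.P K).L = F.L := rfl
  rw [hd, hLL, hδdef, mul_div_assoc', div_le_iff₀ hD]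
  have hq : 0 ≤ ExpMeanLog.deltaSU (Fin 2) / 2 := (half_pos ExpMeanLog.deltaSU_pos).le
  nlinarith [hq]

/-! ## §4e (v11) THE CHART-FREE RE-CUT OF CHART: VOL + EDGE + LEVEL + CHARGE ⇒ `WindowChartsExist` (PROVED assembly) -/

section ChartFree

open Literature.MathematicalPhysics.QuantumFieldTheory.Balaban1983to89.ExpMeanLog (deltaSU)
open Literature.MathematicalPhysics.QuantumFieldTheory.Balaban1983to89.BlockAveraging (Idx)
open Literature.MathematicalPhysics.QuantumFieldTheory.Balaban1983to89.BlockAveragingEMLHaarAC (offCard offCard_lt_card)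

/-- **CHART-VOL (T³, SU(2))** — uniform volume non-compression on the central windows. [cite: Balaban1987RG1, (0.4) p.253 and (2.10) p.267] -/
def ChartVolT3 : Prop :=
  ∀ (F : T3Family) (K : ℕ) (α : ℝ), 0 < α → α ≤ 1 / 24 → 64 * α ≤ deltaSU (Fin 2) →
    157 * α < (((F.P K).L : ℝ) ^ ((F.P K).d - 1))⁻¹ →
    (∀ j (c : PBond (F.P K) (j + 1)), (offCard c : ℝ) / (Fintype.card (Idx (F.P K)) : ℝ) + 150 * α < 1) →
      ∃ j₀ : ℝ≥0, 0 < j₀ ∧ ChainVol (F.P K) 2 α j₀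

/-- **EDGE FLATNESS (T³, SU(2))**. [cite: Balaban1987RG1, (0.4) p.253 and (2.9) p.266] -/
def EdgeFlat : Prop :=
  ∀ (F : T3Family) (K n : ℕ), n ≤ (F.P K).m + (F.P K).K → ∀ (α : ℝ), 0 < α → α ≤ 1 / 24 → 64 * α ≤ deltaSU (Fin 2) →
    157 * α < (((F.P K).L : ℝ) ^ ((F.P K).d - 1))⁻¹ →
    (∀ j (c : PBond (F.P K) (j + 1)), (offCard c : ℝ) / (Fintype.card (Idx (F.P K)) : ℝ) + 150 * α < 1) →
    ∀ (c : PBond (F.P K) n) (v : Matrix.specialUnitaryGroup (Fin 2) ℂ),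
      ∀ᵐ z ∂fieldMeasure (F.P K) 0 (Matrix.specialUnitaryGroup (Fin 2) ℂ),
        v ∉ frontier (chainMap ℰp n z c '' chainWindow (N := 2) α n z c)

/-- **LEVEL FLATNESS (T³, SU(2))** — every plaquette of every level `j < n` avoids the thresholds a.e. [cite: Balaban1985UV3, (7) p.257 and (28)-(31) p.263] -/
def LevelFlat : Prop :=
  ∀ (F : T3Family) (K n : ℕ), n ≤ (F.P K).m + (F.P K).K → ∀ (α : ℝ), 0 < α → α ≤ 1 / 24 → 64 * α ≤ deltaSU (Fin 2) →
    157 * α < (((F.P K).L : ℝ) ^ ((F.P K).d - 1))⁻¹ →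
    (∀ j (c : PBond (F.P K) (j + 1)), (offCard c : ℝ) / (Fintype.card (Idx (F.P K)) : ℝ) + 150 * α < 1) →
    ∀ (t : ℕ → ℝ), (∀ j, t j ≠ 0) → ∀ (W : GaugeField (F.P K) n (Matrix.specialUnitaryGroup (Fin 2) ℂ)),
      ∀ᵐ z ∂fieldMeasure (F.P K) 0 (Matrix.specialUnitaryGroup (Fin 2) ℂ),
        ∀ U : GaugeField (F.P K) 0 (Matrix.specialUnitaryGroup (Fin 2) ℂ),
          (∀ b, (∀ c, iterCentralBond n c ≠ b) → U b = z b) →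
          (∀ c, U (iterCentralBond n c) ∈ chainWindow (N := 2) α n U c) →
          Averaging.iter (fun i => BlockAveraging.blockAvg (P := F.P K) (j := i) ℰp) n U = W →
            ∀ j, j < n → ∀ p : Plaq (F.P K) j,
              dist1 (GaugeField.plaqHol (Averaging.iter (fun i => BlockAveraging.blockAvg (P := F.P K) (j := i) ℰp) j U) p) ≠ t j

/-- **CHARGE (T³, SU(2))** — the charted fine fields charge every window of the interior set. [cite: Balaban1987RG1, (2.10) p.267 and (0.4) p.253] -/
def ChartCharge : Prop :=
  ∀ (F : T3Family) (K J : ℕ) (θ : ℕ → ℝ) (α : ℝ), (∀ i, 0 ≤ θ i) → 0 < α → α ≤ 1 / 24 → 64 * α ≤ deltaSU (Fin 2) →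
    157 * α < (((F.P K).L : ℝ) ^ ((F.P K).d - 1))⁻¹ →
    (∀ j (c : PBond (F.P K) (j + 1)), (offCard c : ℝ) / (Fintype.card (Idx (F.P K)) : ℝ) + 150 * α < 1) →
    (∀ i, (((((F.P K).d + 2) * (F.P K).L : ℕ) : ℝ) ^ 2 / 4) * θ i ≤ α) →
    ∀ W : GaugeField (F.P K) (K - J) (Matrix.specialUnitaryGroup (Fin 2) ℂ),
      (∃ U₀ ∈ interior (histGood F ℰp θ K J),
          Averaging.iter (fun i => BlockAveraging.blockAvg (P := F.P K) (j := i) ℰp) (K - J) U₀ = W) →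
      0 < fieldMeasure (F.P K) 0 (Matrix.specialUnitaryGroup (Fin 2) ℂ)
        {z | ∃ g : PBond (F.P K) (K - J) → Matrix.specialUnitaryGroup (Fin 2) ℂ,
          Function.extend (iterCentralBond (K - J)) g z ∈ histGood F ℰp θ K J ∧
          Averaging.iter (fun i => BlockAveraging.blockAvg (P := F.P K) (j := i) ℰp) (K - J)
            (Function.extend (iterCentralBond (K - J)) g z) = W}

/-- The sharp small-field class `{V | PlaqSmall δ V}` of `SU(2)`-configurations is open (finitely many strict … [cite: Balaban1987RG1, (0.18) p.255] -/
theorem isOpen_setOf_plaqSmall₂ (P : Params) (j : ℕ) (δ : ℝ) :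
    IsOpen {V : GaugeField P j (Matrix.specialUnitaryGroup (Fin 2) ℂ) | PlaqSmall δ V} := by
  have hdist : ∀ p : Plaq P j, Continuous fun U : GaugeField P j (Matrix.specialUnitaryGroup (Fin 2) ℂ) => dist1 (GaugeField.plaqHol U p) := fun p =>
    (UnitaryModel.continuous_opDist1.comp (Literature.MathematicalPhysics.QuantumLattice.continuous_fundamentalRep (Fin 2))).comp
      (B12ContinuousTransportInvarianceOn.continuous_plaqHol_SU (N := 2) p)
  simp only [PlaqSmall, setOf_forall]
  exact isOpen_iInter_of_finite fun p => isOpen_lt (hdist p) continuous_const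

/-- `#Idx(F.P K) = 36·L³` (`Idx = (Fin d → Fin L) × Perm(Fin d) × Perm(Fin d)`, `d = 3`). [cite: Balaban1985Averaging, (10) p.19 (bookkeeping)] -/
theorem card_Idx_T3 (F : T3Family) (K : ℕ) : Fintype.card (Idx (F.P K)) = F.L ^ 3 * 36 := by
  have h : Fintype.card (Idx (F.P K)) =
      Fintype.card ((Fin (F.P K).d → Fin (F.P K).L) × Equiv.Perm (Fin (F.P K).d) × Equiv.Perm (Fin (F.P K).d)) :=
    Fintype.card_congr (Equiv.refl _)
  rw [h, Fintype.card_prod, Fintype.card_prod, Fintype.card_fun, Fintype.card_perm, Fintype.card_fin, Fintype.card_fin, T3Family.P_d]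
  show F.L ^ 3 * _ = _
  norm_num [Nat.factorial]

/-- ★ The chart regime is non-empty: for every `L ≥ 1` some `α(L) > 0` meets all the numerics. [cite: Balaban1987RG1, (2.9)-(2.10) p.266-267] -/
theorem exists_chartRegime (L : ℕ) (hL : 1 ≤ L) :
    ∃ α : ℝ, 0 < α ∧ α ≤ 1 / 24 ∧ 64 * α ≤ deltaSU (Fin 2) ∧
      ∀ F : T3Family, F.L = L → ∀ K : ℕ, 157 * α < (((F.P K).L : ℝ) ^ ((F.P K).d - 1))⁻¹ ∧
        ∀ j (c : PBond (F.P K) (j + 1)), (offCard c : ℝ) / (Fintype.card (Idx (F.P K)) : ℝ) + 150 * α < 1 := by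
  have hLr : (1 : ℝ) ≤ L := by exact_mod_cast hL
  set C : ℝ := 36 * (L : ℝ) ^ 3 with hC
  have hCpos : 0 < C := by positivity
  set α : ℝ := min (1 / 24) (min (deltaSU (Fin 2) / 64) (min (1 / (158 * (L : ℝ) ^ 2)) (1 / (151 * C)))) with hαdef
  have hα1 : α ≤ 1 / 24 := min_le_left _ _
  have hα2 : α ≤ deltaSU (Fin 2) / 64 := (min_le_right _ _).trans (min_le_left _ _)
  have hα3 : α ≤ 1 / (158 * (L : ℝ) ^ 2) := (min_le_right _ _).trans ((min_le_right _ _).trans (min_le_left _ _))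
  have hα4 : α ≤ 1 / (151 * C) := (min_le_right _ _).trans ((min_le_right _ _).trans (min_le_right _ _))
  have hα0 : 0 < α := by
    rw [hαdef]
    refine lt_min (by norm_num) (lt_min (div_pos ExpMeanLog.deltaSU_pos (by norm_num)) (lt_min (by positivity) (by positivity)))
  refine ⟨α, hα0, hα1, by linarith, fun F hFL K => ?_⟩
  subst hFL
  have hd : (F.P K).d = 3 := T3Family.P_d F K
  have hLL : (F.P K).L = F.L := rfl
  refine ⟨?_, fun j c => ?_⟩
  · rw [hd, hLL]
    norm_num
    have hx : 0 < ((F.L : ℝ) ^ 2) := by positivity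
    rw [inv_eq_one_div, lt_div_iff₀ hx]
    calc 157 * α * (F.L : ℝ) ^ 2 ≤ 157 * (1 / (158 * (F.L : ℝ) ^ 2)) * (F.L : ℝ) ^ 2 := by gcongr
      _ = 157 / 158 := by field_simp
      _ < 1 := by norm_num
  · have hcard : (Fintype.card (Idx (F.P K)) : ℝ) = C := by
      rw [card_Idx_T3, hC]
      push_cast
      ring
    have hoff : (offCard c : ℝ) + 1 ≤ C := by
      rw [← hcard]
      exact_mod_cast Nat.succ_le_of_lt (offCard_lt_card c)
    rw [hcard]
    have h1 : (offCard c : ℝ) / C ≤ (C - 1) / C := div_le_div_of_nonneg_right (by linarith) hCpos.le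
    have h2 : 150 * α ≤ 150 / (151 * C) := by
      calc 150 * α ≤ 150 * (1 / (151 * C)) := by gcongr
        _ = 150 / (151 * C) := by ring
    have h3 : (C - 1) / C + 150 / (151 * C) = 1 - 1 / (151 * C) := by
      field_simp
      ring
    have h4 : 0 < 1 / (151 * C) := by positivity
    linarith

/-- ★★★ **THE ASSEMBLY (PROVED)**: VOL + EDGE + LEVEL + CHARGE ⇒ window charts exist. [cite: Balaban1987RG1, (2.10) p.267] -/
theorem windowChartsExist_of_flat (hV : ChartVolT3) (hE : EdgeFlat) (hLv : LevelFlat) (hC : ChartCharge) : WindowChartsExist := by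
  intro L b₀ p₀ hb hp
  by_cases hL : 1 ≤ L
  swap
  · refine ⟨1, one_pos, fun F γ hFL _ _ => ?_⟩
    exact absurd (hFL ▸ F.hL.2.le) hL
  obtain ⟨δ', γ₁, hδ', hγ₁, hreg⟩ := exists_gamma_levelRegime L b₀ p₀ hb hp
  obtain ⟨α, hα0, hα24, hα64, hαF⟩ := exists_chartRegime L hL
  set D₅ : ℝ := ((((3 + 2) * L : ℕ) : ℝ) ^ 2 / 4) with hD₅
  have hD₅0 : 0 ≤ D₅ := by positivity
  set σ : ℝ := α / (D₅ + 1) with hσ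
  have hσ0 : 0 < σ := div_pos hα0 (by positivity)
  obtain ⟨γ₂, hγ₂, hγ₂1, hθσ⟩ := exists_gamma_forall_θBal_le (b₀ := b₀) (p₀ := p₀) hb hp hσ0
  refine ⟨min γ₁ γ₂, lt_min hγ₁ hγ₂, fun F γ hFL hγ hγle J K hJK V₀ hV₀ => ?_⟩
  have hLF : 1 ≤ F.L := F.hL.2.le
  obtain ⟨hαL, hgap⟩ := hαF F hFL K
  obtain ⟨hsmall, hθlt⟩ := hreg F γ hFL hγ (hγle.trans (min_le_left _ _)) K
  have hγ1 : γ ≤ 1 := (hγle.trans (min_le_right _ _)).trans hγ₂1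
  have hθpos : ∀ i, 0 < θBal F.L γ b₀ p₀ i := fun i => T3MinimiserStabilityReduction.θBal_pos hLF hγ hγ1 hb p₀ i
  have hθ0 : ∀ i, 0 ≤ θBal F.L γ b₀ p₀ i := fun i => (hθpos i).le
  have hθα : ∀ i, (((((F.P K).d + 2) * (F.P K).L : ℕ) : ℝ) ^ 2 / 4) * θBal F.L γ b₀ p₀ i ≤ α := by
    intro i
    have hθi : θBal F.L γ b₀ p₀ i ≤ σ := hθσ F.L hLF γ hγ (hγle.trans (min_le_right _ _)) i
    have hd : (F.P K).d = 3 := T3Family.P_d F K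
    have hLL : (F.P K).L = L := hFL
    rw [hd, hLL, ← hD₅]
    calc D₅ * θBal F.L γ b₀ p₀ i ≤ D₅ * σ := mul_le_mul_of_nonneg_left hθi hD₅0
      _ ≤ α := by
          rw [hσ, mul_div_assoc', div_le_iff₀ (by positivity)]
          nlinarith [hα0.le]
  have hn : K - J ≤ (F.P K).m + (F.P K).K := by
    show K - J ≤ F.m + K
    omega
  have hβ := iterCentralBond_injective (P := F.P K) (n := K - J) hn
  set θ := θBal F.L γ b₀ p₀ with hθdef
  set O : Set (GaugeField (F.P J) 0 (Matrix.specialUnitaryGroup (Fin 2) ℂ)) := {V | PlaqSmall (θ J) V} with hOdef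
  have hO : IsOpen O := isOpen_setOf_plaqSmall₂ (F.P J) 0 (θ J)
  refine ⟨O, hO, hV₀, ?_⟩
  obtain ⟨j₀, hj₀, hvol⟩ := hV F K α hα0 hα24 hα64 hαL hgap
  obtain ⟨D, hDb⟩ := exists_chartData_bdd F hJK hθ0 hα0.le hα24 hα64 hαL hgap hθα hj₀ hvol hO.measurableSet
  have hs := F.sitesPerDir_eq (m := F.m) (K := J) (j := 0) (m' := F.m) (K' := K) (j' := K - J) (by omega)
  have hdesc : (descendTo F ℰp J K hJK : GaugeField (F.P K) 0 (Matrix.specialUnitaryGroup (Fin 2) ℂ) → GaugeField (F.P J) 0 _) =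
      fieldShift hs ∘ Averaging.iter (fun i => BlockAveraging.blockAvg (P := F.P K) (j := i) ℰp) (K - J) := rfl
  have he'e : ∀ y : GaugeField (F.P K) (K - J) (Matrix.specialUnitaryGroup (Fin 2) ℂ), fieldShift hs.symm (fieldShift hs y) = y :=
    fieldShift_fieldShift_symm hs
  have hee' : ∀ y' : GaugeField (F.P J) 0 (Matrix.specialUnitaryGroup (Fin 2) ℂ), fieldShift hs (fieldShift hs.symm y') = y' :=
    fieldShift_symm_fieldShift hs
  have hiter_of_desc : ∀ U V, descendTo F ℰp J K hJK U = V →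
      Averaging.iter (fun i => BlockAveraging.blockAvg (P := F.P K) (j := i) ℰp) (K - J) U = fieldShift hs.symm V := by
    intro U V h
    rw [hdesc, Function.comp_apply] at h
    rw [← h, he'e]
  refine ⟨WindowChart.ofChartData D hδ'.le hθlt hsmall _ hDb (fun V₁ _ => ?edge) (fun V₁ hV₁ => ?level) (fun V₁ _ hpre => ?charge)⟩
  case edge =>
    have hae : ∀ c, ∀ᵐ z ∂fieldMeasure (F.P K) 0 (Matrix.specialUnitaryGroup (Fin 2) ℂ),
        V₁ (D.w c) ∉ frontier (chainMap ℰp (K - J) z c '' chainWindow (N := 2) α (K - J) z c) := fun c =>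
      hE F K (K - J) hn α hα0 hα24 hα64 hαL hgap c (V₁ (D.w c))
    filter_upwards [ae_all_iff.2 hae] with z hz
    by_cases hT : ∀ c, V₁ (D.w c) ∈ D.T c z
    · refine Or.inl fun c => ?_
      rw [← self_sdiff_frontier]
      refine ⟨hT c, ?_⟩
      rw [D.T_eq]
      exact hz c
    · simp only [not_forall] at hT
      obtain ⟨c, hc⟩ := hT
      exact Or.inr ⟨c, by rwa [(D.isClosed_T c z).closure_eq]⟩
  case level =>
    have hae := hLv F K (K - J) hn α hα0 hα24 hα64 hαL hgap (fun j => θ (K - j)) (fun j => (hθpos _).ne') (fieldShift hs.symm V₁)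
    filter_upwards [hae] with z hz hT j hj p
    obtain ⟨hoff, hwin, hd⟩ := D.charted V₁ z hT
    have h2 := hiter_of_desc _ _ hd
    rcases hj.lt_or_eq with hlt | rfl
    · exact hz (D.Φ (V₁, z)) hoff hwin h2 j hlt p
    · rw [h2, Nat.sub_sub_self hJK]
      exact (lt_of_eq_of_lt (congrArg dist1 (plaqHol_fieldShift hs.symm V₁ p)) (hV₁ _)).ne
  case charge =>
    obtain ⟨U₀, hU₀V, hU₀int⟩ := hpre
    have hW := hiter_of_desc _ _ hU₀V
    have hpos := hC F K J θ α hθ0 hα0 hα24 hα64 hαL hgap hθα (fieldShift hs.symm V₁) ⟨U₀, hU₀int, hW⟩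
    refine hpos.trans_le (measure_mono ?_)
    rintro z ⟨g, hUgood, hUiter⟩
    have hch : ∀ c, g c ∈ chainWindow (N := 2) α (K - J) z c := fun c => by
      have h := histGood_subset_charted F hJK hθ0 hθα hUgood c
      rwa [hβ.extend_apply, chainWindow_extend α hn] at h
    have hd : descendTo F ℰp J K hJK (Function.extend (iterCentralBond (K - J)) g z) = V₁ := by
      rw [hdesc, Function.comp_apply, hUiter, hee']
    obtain ⟨hJ, hΦ⟩ := D.recog V₁ z g hch hUgood hd
    exact ⟨hJ, hΦ ▸ hUgood⟩

end ChartFree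

/-! ## §4f First rungs of EDGE and LEVEL: Haar level-set nullity in T³ currency (PROVED, v12) -/

section Rungs

open Literature.MathematicalPhysics.QuantumFieldTheory.Balaban1983to89.Node00 (SU)
open Literature.MathematicalPhysics.QuantumFieldTheory.Balaban1983to89.BlockAveraging (Idx loopHol)
open Literature.MathematicalPhysics.QuantumFieldTheory.Balaban1983to89.BlockAveragingHaarAC (centralBond pre post)
open Literature.MathematicalPhysics.QuantumFieldTheory.Balaban1983to89.BlockAveragingEMLHaarAC (fibreFamily)
open Literature.MathematicalPhysics.QuantumFieldTheory.Balaban1983to89.B14.Eq12InteriorLocality (plaqBonds plaqHol_congr)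

/-- The `dist1`-sphere of radius `t ≠ 0` in `SU(N)` is Haar-null (one-radius form of … [cite: BrockerTomDieck1985, IV (2.11) (proof)] -/
theorem haar_setOf_dist1_eq_eq_zero {N : ℕ} [NeZero N] {t : ℝ} (ht : t ≠ 0) :
    (HaarData.haar : Measure (SU N)) {g | dist1 g = t} = 0 := by
  have h := HaarDist1LevelHypersurface.haar_setOf_dist1_mem_eq_zero_specialUnitaryGroup (n := Fin N) (R := {t})
    (Set.countable_singleton t) (by simpa using ht.symm)
  simpa only [Set.mem_singleton_iff] using h

/-- **LEVEL⁰ (generic lattice, `SU(N)`)**: a plaquette variable on a plaquette AVOIDING the pivot bonds `β` is a.s. [cite: Balaban1985Averaging, (19) p.21] -/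
theorem ae_dist1_plaqHol_ne_of_offPivot {P : Params} {N : ℕ} [NeZero N] {j n : ℕ} (β : PBond P n → PBond P j) {t : ℝ} (ht : t ≠ 0)
    (p : Plaq P j) (hp : ∀ b ∈ plaqBonds p, ∀ c, β c ≠ b) :
    ∀ᵐ z ∂fieldMeasure P j (SU N), ∀ U : GaugeField P j (SU N), (∀ b, (∀ c, β c ≠ b) → U b = z b) →
      dist1 (GaugeField.plaqHol U p) ≠ t := by
  filter_upwards [PlaquetteVariableHaarLaw.ae_forall_dist1_plaqHol_ne (P := P) (j := j) (haar_setOf_dist1_eq_eq_zero (N := N) ht)]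
    with z hz U hUz
  rw [plaqHol_congr (U' := z) (fun b hb => hUz b (hp b hb))]
  exact hz p

/-- **LEVEL⁰ IN `LevelFlat`'S OWN BINDER SHAPE** (PROVED). [cite: Balaban1985Averaging, (19) p.21] -/
theorem levelFlat_zero_offPivot (F : T3Family) (K n : ℕ) (α : ℝ) {t : ℝ} (ht : t ≠ 0) (p : Plaq (F.P K) 0)
    (hp : ∀ b ∈ plaqBonds p, ∀ c : PBond (F.P K) n, iterCentralBond n c ≠ b)
    (W : GaugeField (F.P K) n (Matrix.specialUnitaryGroup (Fin 2) ℂ)) :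
    ∀ᵐ z ∂fieldMeasure (F.P K) 0 (Matrix.specialUnitaryGroup (Fin 2) ℂ),
      ∀ U : GaugeField (F.P K) 0 (Matrix.specialUnitaryGroup (Fin 2) ℂ),
        (∀ b, (∀ c, iterCentralBond n c ≠ b) → U b = z b) →
        (∀ c, U (iterCentralBond n c) ∈ chainWindow (N := 2) α n U c) →
        Averaging.iter (fun i => BlockAveraging.blockAvg (P := F.P K) (j := i) ℰp) n U = W →
          dist1 (GaugeField.plaqHol (Averaging.iter (fun i => BlockAveraging.blockAvg (P := F.P K) (j := i) ℰp) 0 U) p) ≠ t := by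
  filter_upwards [ae_dist1_plaqHol_ne_of_offPivot (N := 2) (iterCentralBond (P := F.P K) n) ht p hp] with z hz U hUz _ _
  exact hz U hUz

/-- **EDGE on the identity section (generic lattice, `SU(N)`)**: the sample's own pivot value `z(β(c))` is a.s. [cite: Balaban1987RG1, (0.4) p.253] -/
theorem ae_forall_dist1_fibreFamily_self_ne {P : Params} {N : ℕ} [NeZero N] {j : ℕ} (hj : j + 1 ≤ P.m + P.K) (c : PBond P (j + 1))
    {α : ℝ} (hα : α ≠ 0) :
    ∀ᵐ z ∂fieldMeasure P j (SU N), ∀ i : Idx P, dist1 (fibreFamily z c (pre z c * z (centralBond c) * post z c) i) ≠ α := by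
  classical
  have h0 := Summit.QuantumFields.YangMills.BalabanUVNodes.N09ContourThresholdNull.fieldMeasure_setOf_exists_dist1_loopHol_eq_eq_zero
    (P := P) (j := j) (N := N) hα
  rw [← compl_mem_ae_iff] at h0
  filter_upwards [h0] with z hz i hi
  apply hz
  refine ⟨c, i, ?_⟩
  have h := BlockAveragingEMLHaarAC.loopHol_update_centralBond_self hj z c (z (centralBond c))
  rw [Function.update_eq_self] at h
  rw [h]
  exact hi

/-- **EDGE⁰ (depth 1, window side)**: a.s. [cite: Balaban1987RG1, (0.4) p.253] -/
theorem edge_self_not_mem {P : Params} {N : ℕ} [NeZero N] (h1 : 0 + 1 ≤ P.m + P.K) (c : PBond P (0 + 1)) {α : ℝ} (hα : α ≠ 0) :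
    ∀ᵐ z ∂fieldMeasure P 0 (SU N),
      z (centralBond c) ∉ {g : SU N | ∃ i : Idx P, dist1 (fibreFamily z c (pre z c * g * post z c) i) = α} := by
  filter_upwards [ae_forall_dist1_fibreFamily_self_ne (N := N) h1 c hα] with z hz
  rintro ⟨i, hi⟩
  exact hz i hi

end Rungs

/-! ## §4g LEVEL off the central chains at EVERY level (PROVED, v13): triangularity + `HaarAC` of (0.4) -/

section FarRungs

open Literature.MathematicalPhysics.QuantumFieldTheory.Balaban1983to89.Node00 (SU)
open Literature.MathematicalPhysics.QuantumFieldTheory.Balaban1983to89.BlockAveraging (Idx avgFun measurable_avgFun)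
open Literature.MathematicalPhysics.QuantumFieldTheory.Balaban1983to89.BlockAveragingHaarAC (centralBond isLocal_avgFun)
open Literature.MathematicalPhysics.QuantumFieldTheory.Balaban1983to89.ExpMeanLog (deltaSU measurable_expMeanLogSU_E)
open Literature.MathematicalPhysics.QuantumFieldTheory.Balaban1983to89.BlockAveragingEMLHaarAC (offCard)
open Literature.MathematicalPhysics.QuantumFieldTheory.Balaban1983to89.B14.Eq12InteriorLocality (plaqBonds plaqHol_congr)

/-- The iterated central bonds of level `n` are iterated central bonds of every level `j + 1 ≤ n`: `range βₙ ⊆ range β_{j+1}`. [folklore] -/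
theorem exists_iterCentralBond_eq {P : Params} (j : ℕ) :
    ∀ n, j + 1 ≤ n → ∀ c : PBond P n, ∃ c'' : PBond P (j + 1), iterCentralBond n c = iterCentralBond (j + 1) c'' := by
  intro n hn
  induction n, hn using Nat.le_induction with
  | base => intro c; exact ⟨c, rfl⟩
  | succ n hn ih =>
      intro c
      obtain ⟨c'', h⟩ := ih (centralBond c)
      exact ⟨c'', by rw [iterCentralBond_succ, h]⟩

/-- ★ **FAR AGREEMENT AT EVERY LEVEL (triangularity)**: if two fine fields agree off the pivot bonds `βₙ`, then for every … -/
theorem iter_apply_eq_of_far {P : Params} {G : Type*} [GaugeGroup G] (ℰ : LoopAverage G) {n : ℕ} (hn : n ≤ P.m + P.K)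
    (U z : GaugeField P 0 G) (hUz : ∀ b, (∀ c : PBond P n, iterCentralBond n c ≠ b) → U b = z b) :
    ∀ j, j ≤ n → ∀ b' : PBond P j, (∀ c : PBond P n, iterCentralBond j b' ≠ iterCentralBond n c) →
      Averaging.iter (fun i => BlockAveraging.blockAvg (P := P) (j := i) ℰ) j U b' =
        Averaging.iter (fun i => BlockAveraging.blockAvg (P := P) (j := i) ℰ) j z b' := by
  intro j
  induction j with
  | zero =>
      intro _ b' hb'
      exact hUz b' (fun c h => hb' c (by rw [h]; rfl))
  | succ j ih =>
      intro hj c' hc'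
      classical
      show avgFun ℰ (Averaging.iter (fun i => BlockAveraging.blockAvg (P := P) (j := i) ℰ) j U) c' =
        avgFun ℰ (Averaging.iter (fun i => BlockAveraging.blockAvg (P := P) (j := i) ℰ) j z) c'
      refine T4TriangularPushforward.apply_eq_of_agree (isLocal_avgFun (by omega) ℰ) c'
        (Finset.univ.filter fun b' : PBond P j =>
          Averaging.iter (fun i => BlockAveraging.blockAvg (P := P) (j := i) ℰ) j U b' ≠
            Averaging.iter (fun i => BlockAveraging.blockAvg (P := P) (j := i) ℰ) j z b') _ _
        (fun b' hb' => by simpa using hb') ?_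
      intro b' hb'
      have hne := (Finset.mem_filter.mp hb').2
      have hex : ∃ c : PBond P n, iterCentralBond j b' = iterCentralBond n c := by
        by_contra h
        exact hne (ih (by omega) b' (fun c hcc => h ⟨c, hcc⟩))
      obtain ⟨c, hc⟩ := hex
      obtain ⟨c'', hc''⟩ := exists_iterCentralBond_eq j n (by omega) c
      refine ⟨c'', ?_, ?_⟩
      · rintro rfl
        exact hc' c hc''.symm
      · apply iterCentralBond_injective (n := j) (by omega)
        rw [← iterCentralBond_succ, ← hc'', ← hc]

/-- The law of `Ū⁽ʲ⁾` under product Haar is absolutely continuous (`SU(2)`). [cite: Balaban1987RG1, (0.4) p.253] -/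
theorem map_iter_absolutelyContinuous {P : Params} :
    ∀ j, j ≤ P.m + P.K →
      (fieldMeasure P 0 (Matrix.specialUnitaryGroup (Fin 2) ℂ)).map
          (Averaging.iter (fun i => BlockAveraging.blockAvg (P := P) (j := i) ℰp) j) ≪
        fieldMeasure P j (Matrix.specialUnitaryGroup (Fin 2) ℂ)
  | 0, _ => by
      rw [show Averaging.iter (fun i => BlockAveraging.blockAvg (P := P) (j := i) ℰp) 0 = id from rfl, Measure.map_id]
  | j + 1, hj => by
      have ih := map_iter_absolutelyContinuous (P := P) j (by omega)
      have hmi : Measurable (Averaging.iter (fun i => BlockAveraging.blockAvg (P := P) (j := i) ℰp) j) :=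
        T4Continuum.measurable_iter _ (fun j => by rw [BlockAveraging.blockAvg_avg]; exact measurable_avgFun _ measurable_expMeanLogSU_E) j
      have hma : Measurable (avgFun ℰp : GaugeField P j (Matrix.specialUnitaryGroup (Fin 2) ℂ) → _) :=
        measurable_avgFun _ measurable_expMeanLogSU_E
      rw [show Averaging.iter (fun i => BlockAveraging.blockAvg (P := P) (j := i) ℰp) (j + 1) =
          avgFun ℰp ∘ Averaging.iter (fun i => BlockAveraging.blockAvg (P := P) (j := i) ℰp) j from rfl,
        ← Measure.map_map hma hmi]
      exact (ih.map hma).trans (BlockAveragingEMLHaarAC.haarAC_avgFun_expMeanLogSU_of_le (P := P) (j := j) hj)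

/-- ★★ **LEVEL OFF THE CENTRAL CHAINS, EVERY LEVEL** (PROVED). [cite: Balaban1987RG1, (0.4) p.253] -/
theorem levelFlat_far (F : T3Family) (K n : ℕ) (hn : n ≤ (F.P K).m + (F.P K).K) (α : ℝ) {t : ℝ} (ht : t ≠ 0)
    {j : ℕ} (hj : j ≤ n) (p : Plaq (F.P K) j)
    (hp : ∀ b ∈ plaqBonds p, ∀ c : PBond (F.P K) n, iterCentralBond j b ≠ iterCentralBond n c)
    (W : GaugeField (F.P K) n (Matrix.specialUnitaryGroup (Fin 2) ℂ)) :
    ∀ᵐ z ∂fieldMeasure (F.P K) 0 (Matrix.specialUnitaryGroup (Fin 2) ℂ),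
      ∀ U : GaugeField (F.P K) 0 (Matrix.specialUnitaryGroup (Fin 2) ℂ),
        (∀ b, (∀ c, iterCentralBond n c ≠ b) → U b = z b) →
        (∀ c, U (iterCentralBond n c) ∈ chainWindow (N := 2) α n U c) →
        Averaging.iter (fun i => BlockAveraging.blockAvg (P := F.P K) (j := i) ℰp) n U = W →
          dist1 (GaugeField.plaqHol (Averaging.iter (fun i => BlockAveraging.blockAvg (P := F.P K) (j := i) ℰp) j U) p) ≠ t := by
  set A := Averaging.iter (fun i => BlockAveraging.blockAvg (P := F.P K) (j := i) ℰp) j with hA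
  have hmi : Measurable A :=
    T4Continuum.measurable_iter _ (fun j => by rw [BlockAveraging.blockAvg_avg]; exact measurable_avgFun _ measurable_expMeanLogSU_E) j
  have h1 : fieldMeasure (F.P K) j (Matrix.specialUnitaryGroup (Fin 2) ℂ)
      {V | dist1 (GaugeField.plaqHol V p) = t} = 0 :=
    PlaquetteVariableHaarLaw.fieldMeasure_setOf_dist1_plaqHol_eq_eq_zero p (haar_setOf_dist1_eq_eq_zero (N := 2) ht)
  have h2 := map_iter_absolutelyContinuous (P := F.P K) j (by omega) h1
  have hnull : fieldMeasure (F.P K) 0 (Matrix.specialUnitaryGroup (Fin 2) ℂ) (A ⁻¹' {V | dist1 (GaugeField.plaqHol V p) = t}) = 0 :=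
    le_antisymm ((Measure.le_map_apply hmi.aemeasurable _).trans h2.le) bot_le
  rw [← compl_mem_ae_iff] at hnull
  filter_upwards [hnull] with z hz U hUz _ _
  have hfar := iter_apply_eq_of_far (P := F.P K) ℰp hn U z hUz j hj
  rw [plaqHol_congr (U' := A z) (fun b hb => hfar b (hp b hb))]
  exact hz

/-- **LEVEL NEAR THE CENTRAL CHAINS (T³, SU(2))** — chain-touching plaquettes avoid the thresholds a.e. [cite: Balaban1985UV3, (7) p.257 and (28)-(31) p.263] -/
def LevelFlatNear : Prop :=
  ∀ (F : T3Family) (K n : ℕ), n ≤ (F.P K).m + (F.P K).K → ∀ (α : ℝ), 0 < α → α ≤ 1 / 24 → 64 * α ≤ deltaSU (Fin 2) →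
    157 * α < (((F.P K).L : ℝ) ^ ((F.P K).d - 1))⁻¹ →
    (∀ j (c : PBond (F.P K) (j + 1)), (offCard c : ℝ) / (Fintype.card (Idx (F.P K)) : ℝ) + 150 * α < 1) →
    ∀ (t : ℕ → ℝ), (∀ j, t j ≠ 0) → ∀ (W : GaugeField (F.P K) n (Matrix.specialUnitaryGroup (Fin 2) ℂ)),
      ∀ᵐ z ∂fieldMeasure (F.P K) 0 (Matrix.specialUnitaryGroup (Fin 2) ℂ),
        ∀ U : GaugeField (F.P K) 0 (Matrix.specialUnitaryGroup (Fin 2) ℂ),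
          (∀ b, (∀ c, iterCentralBond n c ≠ b) → U b = z b) →
          (∀ c, U (iterCentralBond n c) ∈ chainWindow (N := 2) α n U c) →
          Averaging.iter (fun i => BlockAveraging.blockAvg (P := F.P K) (j := i) ℰp) n U = W →
            ∀ j, j < n → ∀ p : Plaq (F.P K) j,
              (∃ b ∈ plaqBonds p, ∃ c : PBond (F.P K) n, iterCentralBond j b = iterCentralBond n c) →
              dist1 (GaugeField.plaqHol (Averaging.iter (fun i => BlockAveraging.blockAvg (P := F.P K) (j := i) ℰp) j U) p) ≠ t j

/-- ★★ **LEVEL = LEVEL-NEAR + LEVEL-FAR (PROVED)**. [cite: Balaban1987RG1, (0.4) p.253] -/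
theorem levelFlat_of_near (h : LevelFlatNear) : LevelFlat := by
  intro F K n hn α hα0 hα24 hα64 hαL hgap t ht W
  have hfar : ∀ j : ℕ, ∀ᵐ z ∂fieldMeasure (F.P K) 0 (Matrix.specialUnitaryGroup (Fin 2) ℂ), ∀ p : Plaq (F.P K) j,
      (∀ b ∈ plaqBonds p, ∀ c : PBond (F.P K) n, iterCentralBond j b ≠ iterCentralBond n c) → j ≤ n →
        ∀ U : GaugeField (F.P K) 0 (Matrix.specialUnitaryGroup (Fin 2) ℂ),
          (∀ b, (∀ c, iterCentralBond n c ≠ b) → U b = z b) →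
          (∀ c, U (iterCentralBond n c) ∈ chainWindow (N := 2) α n U c) →
          Averaging.iter (fun i => BlockAveraging.blockAvg (P := F.P K) (j := i) ℰp) n U = W →
            dist1 (GaugeField.plaqHol (Averaging.iter (fun i => BlockAveraging.blockAvg (P := F.P K) (j := i) ℰp) j U) p) ≠ t j := by
    intro j
    refine ae_all_iff.2 fun p => ?_
    by_cases hp : ∀ b ∈ plaqBonds p, ∀ c : PBond (F.P K) n, iterCentralBond j b ≠ iterCentralBond n c
    · by_cases hj : j ≤ n
      · filter_upwards [levelFlat_far F K n hn α (ht j) hj p hp W] with z hz _ _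
        exact hz
      · exact Filter.Eventually.of_forall fun z _ hj' => absurd hj' hj
    · exact Filter.Eventually.of_forall fun z hp' => absurd hp' hp
  filter_upwards [h F K n hn α hα0 hα24 hα64 hαL hgap t ht W, ae_all_iff.2 hfar] with z hnear hfz U hUz hch hW j hj p
  by_cases hp : ∀ b ∈ plaqBonds p, ∀ c : PBond (F.P K) n, iterCentralBond j b ≠ iterCentralBond n c
  · exact hfz j p hp hj.le U hUz hch hW
  · have hex : ∃ b ∈ plaqBonds p, ∃ c : PBond (F.P K) n, iterCentralBond j b = iterCentralBond n c := by
      by_contra hcon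
      exact hp fun b hb c hbc => hcon ⟨b, hb, c, hbc⟩
    exact hnear U hUz hch hW j hj p hex

end FarRungs

/-! ## §5 The stubs and the composition -/

/-- **VOL — PROVED (v15, §0w)**. [cite: Balaban1987RG1, (0.4) p.253 and (2.10) p.267] -/
theorem stub_chartVol : ChartVolT3 := by
  intro F K α hα0 hα24 h64 _ hgap
  have hαδ : α < ExpMeanLog.deltaSU (Fin 2) := by linarith
  obtain ⟨j₀, hj₀, h⟩ := QLemmaA.exists_chainVol_SU2 (F.P K) hα0 hα24 hαδ hgap
  exact ⟨j₀, hj₀, h⟩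

/-- **STUB · EDGE** (pen px17 g6): a fixed `v` is on the edge of the image window only for a null set of environments. -/
theorem stub_edgeFlat : EdgeFlat :=
  Summit.QuantumFields.YangMills.Theorems.FluctuationComparisonRegPrIntLWregChartEdge.edgeFlat_of_chainEqns
    (fun P n => iterCentralBond (P := P) n) (fun P n => chainMap (P := P) ℰp n) (fun P α n => chainWindow (P := P) (N := 2) α n)
    (fun _ _ => rfl) (fun _ _ _ => rfl) (fun _ _ _ _ _ => rfl) (fun _ _ _ _ => rfl) (fun _ _ _ _ _ => rfl)

/-- **STUB · LEVEL-NEAR** (pen w4-20520 g14): chain-touching plaquettes avoid the thresholds for a.e. environment. -/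
theorem stub_levelFlatNear : LevelFlatNear := by
  intro F K n hn α hα0 hα24 hα64 hαL hgap t ht W
  have hαδ : α < ExpMeanLog.deltaSU (Fin 2) := by linarith
  exact Summit.QuantumFields.YangMills.Theorems.FluctuationComparisonRegPrIntLWregChartLevelNear.levelFlatNear_of_chain (F.P K) n hn α t
    ht W iterCentralBond (fun _ => rfl) (fun _ _ => rfl) (chainMap ℰp) (fun _ _ _ _ => rfl) (chainWindow (N := 2) α) (fun _ _ => rfl)
    (fun k U c => chainWindow_succ α k U c) (fun U c => chainMap_injOn hα0.le hα24 hαδ hgap hn U c)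
    (fun U c A hA hA0 => chain_imageNull hα0.le hα24 hα64 hαL hgap hn U c hA hA0) (fun g U c => chainMap_extend ℰp hn g U c)
    (fun g U c => chainWindow_extend α hn g U c) (fun c => measurableSet_chainWindow₂ α n c) (fun c => measurable_chainMap₂ n c)

/-- **LEVEL — no longer a stub (v14)**: `levelFlat_of_near stub_levelFlatNear` (LEVEL-FAR proved, §4g). [cite: Balaban1985UV3, (7) p.257] -/
theorem stub_levelFlat : LevelFlat := levelFlat_of_near stub_levelFlatNear

/-- **STUB · CHARGE** (pen w3-20520 g13): the charted fine fields charge every window of the interior set. -/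
theorem stub_chartCharge : ChartCharge :=
  Summit.QuantumFields.YangMills.Theorems.FluctuationComparisonRegPrIntLWregChartCharge.chartCharge_holds
    (fun P n => iterCentralBond (P := P) n) (fun _ _ => rfl) (fun _ _ _ => rfl)

/-- **CHART** — closed in-file by the PROVED assembly (v11). [cite: Balaban1987RG1, (2.10) p.267] -/
theorem stub_windowCharts : WindowChartsExist :=
  windowChartsExist_of_flat stub_chartVol stub_edgeFlat stub_levelFlat stub_chartCharge

/-- **INTERIOR** — closed in-file by `windowFibreInterior_holds` (v5). [cite: Balaban1985UV3, (7) p.257] -/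
theorem stub_windowFibreInterior : WindowFibreInterior := windowFibreInterior_holds

/-- **THE ORGAN WREG, CLOSED BY THE TABLE** (v19: every entry proved — VOL in-file, EDGE ∕ LEVEL-NEAR ∕ CHARGE by name). [cite: Balaban1987RG1, (2.10) p.267] -/
theorem windowRegularity_of_stubs : WindowRegularity :=
  windowRegularity_of_chart stub_windowCharts stub_windowFibreInterior

/-- info: 'Summit.QuantumFields.YangMills.Cruxes.FluctuationComparisonRegPrIntL.RunPairOrgan.WregChart.windowRegularity_of_stubs' depends on axioms: [propext,
 Classical.choice,
 Quot.sound] -/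
#guard_msgs in
#print axioms windowRegularity_of_stubs

end Summit.QuantumFields.YangMills.Cruxes.FluctuationComparisonRegPrIntL.RunPairOrgan.WregChart

end
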